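import Mathlib
import Literature.Analysis.PDE.DivFormLiouville
import Literature.Analysis.FunctionSpaces.SmoothCutoff
import Literature.Analysis.FunctionSpaces.MoserIteration
import Literature.Analysis.FunctionSpaces.PoincareWirtingerConvex
import Literature.Analysis.FunctionSpaces.BMO
import Literature.Analysis.FunctionSpaces.BMOJohnNirenberg
import Literature.Analysis.FunctionSpaces.BMOJohnNirenbergLp
import HarnessLib

/-!
# Moser's Harnack inequality for divergence-form elliptic equations with bounded measurable coefficients (Moser 1961, Thm 1; De Giorgi–Nash–Moser: Caccioppoli, Moser iteration, log-BMO, John–Nirenberg crossover) — re-homed proofs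

**Moser's Harnack inequality** for entire `C¹` weak solutions of the divergence-form equation `div(a∇u) = 0` with bounded measurable
uniformly elliptic symmetric coefficients, `n ≥ 3` (J. Moser, *On Harnack's theorem for elliptic differential equations*, Comm. Pure Appl.
Math. 14 (1961), Theorem 1): `sup_{B̄(0,1)} w ≤ C_H(n,λ,Λ) · inf_{B̄(0,1)} w` for `w ≥ 1` (`Harnack.harnack_unit`), by the DE GIORGI–NASH–MOSER
route as printed — weighted energy identity and Caccioppoli inequalities (Parts 1–2), reverse Hölder and one Moser step through the Sobolev
cutoff machinery (Parts 3–4), the geometric Moser chain (Part 5), `log w ∈ BMO` by the logarithmic Caccioppoli inequality and Poincaré–Wirtinger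
(Part 6), the John–Nirenberg crossover `(⨍ w^{p₀})(⨍ w^{−p₀}) ≤ C` (Part 7, the tree's `john_nirenberg_holds`), and the assembly (Part 8) —
RE-HOMED into `Literature/` by the Hodge foundations lane (`lit-hodgefound`, seat p20, generation 36) from the cell ns-poloidal (route
`PoloidalWindowDoor`, crux K2, seat ns-poloidal-K2-p3): verbatim ports, in dependency order and each with its original module docstring, of
the modules `Summits/NavierStokesRegularity/NavierStokesRegularity/Theorems/PoloidalWindowDoorPoloidalWindowRigidityDivForm{Caccioppoli,
CaccioppoliPowers, ReverseHolder, MoserStep, MoserChain, LogBMO, Crossover, Harnack}.lean`, namespace `Summit.NavierStokesRegularity.NavierStokesRegularity.Theorems.PoloidalWindowDoorPoloidalWindowRigidityDivForm<Step>` re-rooted as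
`Literature.Analysis.PDE.DivForm.<Step>` (this file's path namespace + the source's step name).  SETTING throughout (the rendering of the
Literature named fact `Literature.Analysis.PDE.divFormLiouville`, Jost Thm 14.2.3 / Moser 1961): a measurable symmetric coefficient field
`a : ℝⁿ → Matₙ(ℝ)` with `λ|ξ|² ≤ ξ·a(y)ξ` and `|aᵢⱼ| ≤ Λ`, and `C¹` functions `u` satisfying the weak equation
`∫ Σᵢⱼ aᵢⱼ ∂ᵢu ∂ⱼη = 0` for all `C¹` compactly supported `η` (so `u ∈ W^{1,2}_loc`; the `C¹` rendering is the fact's, see its TODO).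
Theorems only unless said; no named fact; imports Mathlib/Literature only (the tree's `Literature/Analysis/FunctionSpaces/{SmoothCutoff,
MoserIteration, BMO, BMOJohnNirenberg(+Lp), PoincareWirtingerConvex, BombieriGiustiLemma}`); every declaration carries the citation of the
printed step it formalises (the originals' `[folklore]` helpers are re-tagged with the theorem they serve).  The Summits originals stay in
place (transitional duplication; twins = same short names under the Summits namespaces).  Nothing here is specific to Navier–Stokes, and
nothing about Navier–Stokes regularity is claimed.
Consumers: the sibling ports `DivForm/Liouville.lean` (Liouville in every dimension, discharging `divFormLiouville`) and
`DivForm/StrongMaximumPrinciple.lean` (Gilbarg–Trudinger Thm 8.19, discharging `divFormStrongMaximumPrinciple`).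
-/

noncomputable section

/-!
## Part 1 — port of `Summits/NavierStokesRegularity/NavierStokesRegularity/Theorems/PoloidalWindowDoorPoloidalWindowRigidityDivFormCaccioppoli.lean`

# Route `PoloidalWindowDoor`, crux K2 (stmt-NavierStokesRegularity-19708) — task H5, step M1: CACCIOPPOLI inequalities for
# divergence-form elliptic equations with bounded measurable coefficients (towards `divFormLiouville_holds`, De Giorgi–Nash–Moser)

Setting = the rendering of the named fact `divFormLiouville` (Jost Thm 14.2.3; Moser 1961): `a` measurable symmetric,
`λ|ξ|² ≤ ξ·aξ`, `|aᵢⱼ| ≤ Λ`; `u ∈ C¹(ℝⁿ)` with `∫ Σᵢⱼ aᵢⱼ ∂ᵢu ∂ⱼη = 0` for all `η ∈ C¹_c`.  Step M1 of Moser's route (Moser 1961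
§4; Gilbarg–Trudinger §8.6): the ENERGY IDENTITY with a weight `g(u)` and the weighted Caccioppoli inequality.

* `quadForm_*` — algebra of the coefficient form `Q_y(ξ) = ξ·a(y)ξ`: symmetry of the bilinear form, the Cauchy–Schwarz
  inequality `(ξ·aζ)² ≤ (ξ·aξ)(ζ·aζ)`, and the bounds `λ|ξ|² ≤ ξ·aξ ≤ nΛ|ξ|²`.
* `weakForm_eq_dotProduct` — the integrand `Σᵢⱼ aᵢⱼ ∂ᵢu ∂ⱼη = Du · (a Dη)` with `Du = (∂ᵢu)ᵢ`.
* `energy_identity_weighted` — for `u` a weak solution with `u ≥ 1`, `g ∈ C¹(]½,∞[)` and `χ ∈ C¹_c`: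
  `∫ χ² g′(u) Q(Du) = −2 ∫ χ g(u) Du·a Dχ` (test function `η = χ² g(u)`).
* `caccioppoli_weighted` — if moreover `g′ > 0` on `]½,∞[`: `∫ χ² g′(u) Q(Du) ≤ 4 ∫ (g²/g′)(u) Q(Dχ)`.
(The specialisations `g = s^β/β` and `g = −1/s` — power and logarithmic Caccioppoli — are in the sequel file.)
Housed under the route's Theorems as a HELPER of the crux (the named fact's discharge `divFormLiouville_holds` will cite
Moser 1961 / Jost Thm 14.2.3 in Literature once M4 closes); seat ns-poloidal-K2-p3 g2, `ledger fact claim` #1.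

WHAT THIS IS NOT: not yet the Liouville theorem — the named fact stays OPEN until M4; nothing here is specific to
Navier–Stokes (consumer: the K2 lead's conditional `…EllipticSlope.eq_zero_of_ellipticShear`, p482138).
-/

section Part1

noncomputable section

open _root_.MeasureTheory _root_.Set _root_.Function _root_.Filter _root_.Topology _root_.Metric
open scoped _root_.Matrix

namespace Literature.Analysis.PDE.DivForm.Caccioppoli

variable {n : ℕ}

/-! ### The coefficient form -/

/-- The vector of partial derivatives `Du(y) = (∂ᵢu(y))ᵢ = (D u(y)[eᵢ])ᵢ`.
[cite: Moser1961Harnack, Theorem 1, proof §4 (energy identity and Caccioppoli inequalities)] -/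
theorem fderiv_single_eq_inner (u : EuclideanSpace ℝ (Fin n) → ℝ) (y : EuclideanSpace ℝ (Fin n)) (i : Fin n) :
    fderiv ℝ u y (EuclideanSpace.single i 1) = (InnerProductSpace.toDual ℝ _).symm (fderiv ℝ u y) i := by
  set g := (InnerProductSpace.toDual ℝ (EuclideanSpace ℝ (Fin n))).symm (fderiv ℝ u y) with hg
  have h : fderiv ℝ u y = InnerProductSpace.toDual ℝ _ g := by simp [hg]
  rw [h, InnerProductSpace.toDual_apply_apply, EuclideanSpace.inner_single_right]
  simp

/-- `Σᵢ (∂ᵢu)² = ‖Du‖²` (the operator norm of the derivative of a real function on `ℝⁿ` is the Euclidean norm of its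
gradient). [cite: Moser1961Harnack, Theorem 1, proof §4 (energy identity and Caccioppoli inequalities)] -/
theorem sum_fderiv_single_sq (u : EuclideanSpace ℝ (Fin n) → ℝ) (y : EuclideanSpace ℝ (Fin n)) :
    ∑ i, fderiv ℝ u y (EuclideanSpace.single i 1) ^ 2 = ‖fderiv ℝ u y‖ ^ 2 := by
  set g := (InnerProductSpace.toDual ℝ (EuclideanSpace ℝ (Fin n))).symm (fderiv ℝ u y) with hg
  have hnorm : ‖fderiv ℝ u y‖ = ‖g‖ := by simp [hg]
  simp_rw [fderiv_single_eq_inner u y]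
  rw [hnorm, EuclideanSpace.norm_eq, Real.sq_sqrt (Finset.sum_nonneg fun i _ => sq_nonneg _)]
  simp [Real.norm_eq_abs, sq_abs, hg]

variable {a : EuclideanSpace ℝ (Fin n) → Matrix (Fin n) (Fin n) ℝ} {lam Λ : ℝ}

/-- Symmetry of the bilinear coefficient form: `ξ·a(y)ζ = ζ·a(y)ξ`.
[cite: Moser1961Harnack, Theorem 1, proof §4 (energy identity and Caccioppoli inequalities)] -/
theorem quadForm_symm (hsymm : ∀ y, (a y).IsSymm) (y : EuclideanSpace ℝ (Fin n)) (ξ ζ : Fin n → ℝ) :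
    ξ ⬝ᵥ (a y *ᵥ ζ) = ζ ⬝ᵥ (a y *ᵥ ξ) := by
  rw [Matrix.dotProduct_mulVec, ← Matrix.mulVec_transpose, (hsymm y).eq, dotProduct_comm]

/-- **Cauchy–Schwarz for the (positive semi-definite, symmetric) coefficient form**:
`(ξ·aζ)² ≤ (ξ·aξ)(ζ·aζ)`.
[cite: Moser1961Harnack, Theorem 1, proof §4 (energy identity and Caccioppoli inequalities)] -/
theorem quadForm_cauchySchwarz (hsymm : ∀ y, (a y).IsSymm) (hlam : 0 < lam)
    (hell : ∀ y (ξ : Fin n → ℝ), lam * (ξ ⬝ᵥ ξ) ≤ ξ ⬝ᵥ (a y *ᵥ ξ)) (y : EuclideanSpace ℝ (Fin n))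
    (ξ ζ : Fin n → ℝ) :
    (ξ ⬝ᵥ (a y *ᵥ ζ)) ^ 2 ≤ (ξ ⬝ᵥ (a y *ᵥ ξ)) * (ζ ⬝ᵥ (a y *ᵥ ζ)) := by
  have hpsd : ∀ θ : Fin n → ℝ, 0 ≤ θ ⬝ᵥ (a y *ᵥ θ) := fun θ =>
    (mul_nonneg hlam.le (by simpa [dotProduct] using Finset.sum_nonneg fun i _ => mul_self_nonneg (θ i))).trans
      (hell y θ)
  -- `t ↦ Q(ξ + tζ) = Q(ζ) t² + 2B(ξ,ζ) t + Q(ξ) ≥ 0`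
  have hquad : ∀ t : ℝ, 0 ≤ (ζ ⬝ᵥ (a y *ᵥ ζ)) * (t * t) + 2 * (ξ ⬝ᵥ (a y *ᵥ ζ)) * t + ξ ⬝ᵥ (a y *ᵥ ξ) := by
    intro t
    have h := hpsd (ξ + t • ζ)
    have hexp : (ξ + t • ζ) ⬝ᵥ (a y *ᵥ (ξ + t • ζ)) =
        ξ ⬝ᵥ (a y *ᵥ ξ) + t * (ξ ⬝ᵥ (a y *ᵥ ζ)) + t * (ζ ⬝ᵥ (a y *ᵥ ξ)) + t * t * (ζ ⬝ᵥ (a y *ᵥ ζ)) := by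
      simp only [Matrix.mulVec_add, Matrix.mulVec_smul, dotProduct_add, add_dotProduct, dotProduct_smul,
        smul_dotProduct, smul_eq_mul]
      ring
    rw [hexp, quadForm_symm hsymm y ζ ξ] at h
    linarith
  have hd := discrim_le_zero hquad
  rw [discrim] at hd
  nlinarith [hd]

/-- Lower bound of the coefficient form on a gradient vector: `λ Σᵢ ξᵢ² ≤ ξ·aξ`.
[cite: Moser1961Harnack, Theorem 1, proof §4 (energy identity and Caccioppoli inequalities)] -/
theorem quadForm_lower (hell : ∀ y (ξ : Fin n → ℝ), lam * (ξ ⬝ᵥ ξ) ≤ ξ ⬝ᵥ (a y *ᵥ ξ))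
    (y : EuclideanSpace ℝ (Fin n)) (ξ : Fin n → ℝ) : lam * ∑ i, ξ i ^ 2 ≤ ξ ⬝ᵥ (a y *ᵥ ξ) := by
  have h := hell y ξ
  simpa [dotProduct, sq] using h

/-- Upper bound of the coefficient form: `ξ·aξ ≤ nΛ Σᵢ ξᵢ²` (`|aᵢⱼ| ≤ Λ` and Cauchy–Schwarz).
[cite: Moser1961Harnack, Theorem 1, proof §4 (energy identity and Caccioppoli inequalities)] -/
theorem quadForm_upper (hbd : ∀ y i j, |a y i j| ≤ Λ) (y : EuclideanSpace ℝ (Fin n)) (ξ : Fin n → ℝ) :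
    ξ ⬝ᵥ (a y *ᵥ ξ) ≤ n * Λ * ∑ i, ξ i ^ 2 := by
  rcases Nat.eq_zero_or_pos n with hn | hn
  · subst hn
    simp [dotProduct]
  have hΛ : 0 ≤ Λ := (abs_nonneg _).trans (hbd y ⟨0, hn⟩ ⟨0, hn⟩)
  -- `|ξ·aξ| ≤ Λ (Σ|ξᵢ|)² ≤ Λ n Σ ξᵢ²`
  have h1 : ξ ⬝ᵥ (a y *ᵥ ξ) ≤ Λ * (∑ i, |ξ i|) ^ 2 := by
    calc ξ ⬝ᵥ (a y *ᵥ ξ) = ∑ i, ∑ j, a y i j * ξ i * ξ j := by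
            simp only [dotProduct, Matrix.mulVec, Finset.mul_sum]
            refine Finset.sum_congr rfl fun i _ => Finset.sum_congr rfl fun j _ => by ring
      _ ≤ ∑ i, ∑ j, Λ * (|ξ i| * |ξ j|) := by
            refine Finset.sum_le_sum fun i _ => Finset.sum_le_sum fun j _ => ?_
            calc a y i j * ξ i * ξ j ≤ |a y i j * ξ i * ξ j| := le_abs_self _
              _ = |a y i j| * (|ξ i| * |ξ j|) := by rw [abs_mul, abs_mul, mul_assoc]
              _ ≤ Λ * (|ξ i| * |ξ j|) := mul_le_mul_of_nonneg_right (hbd y i j) (by positivity)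
      _ = Λ * (∑ i, |ξ i|) ^ 2 := by
            rw [sq, Finset.sum_mul_sum, Finset.mul_sum]
            refine Finset.sum_congr rfl fun i _ => ?_
            rw [Finset.mul_sum]
  have h2 : (∑ i, |ξ i|) ^ 2 ≤ n * ∑ i, ξ i ^ 2 := by
    have h := sq_sum_le_card_mul_sum_sq (s := Finset.univ) (f := fun i => |ξ i|)
    simpa [sq_abs] using h
  calc ξ ⬝ᵥ (a y *ᵥ ξ) ≤ Λ * (∑ i, |ξ i|) ^ 2 := h1
    _ ≤ Λ * (n * ∑ i, ξ i ^ 2) := mul_le_mul_of_nonneg_left h2 hΛ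
    _ = n * Λ * ∑ i, ξ i ^ 2 := by ring

/-- `Σᵢⱼ aᵢⱼ(y) Fᵢ Gⱼ = F · (a(y) G)` (the weak form as a bilinear pairing of gradient vectors).
[cite: Moser1961Harnack, Theorem 1, proof §4 (energy identity and Caccioppoli inequalities)] -/
theorem sum_sum_mul_eq_dotProduct (A : Matrix (Fin n) (Fin n) ℝ) (F G : Fin n → ℝ) :
    ∑ i, ∑ j, A i j * F i * G j = F ⬝ᵥ (A *ᵥ G) := by
  simp only [dotProduct, Matrix.mulVec, Finset.mul_sum]
  exact Finset.sum_congr rfl fun i _ => Finset.sum_congr rfl fun j _ => by ring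

/-- A measurable function dominated by a continuous one, times a continuous compactly supported function, is
integrable. [cite: Moser1961Harnack, Theorem 1, proof §4 (energy identity and Caccioppoli inequalities)] -/
theorem integrable_mul_of_le_continuous {m M φ : EuclideanSpace ℝ (Fin n) → ℝ} (hm : Measurable m)
    (hM : Continuous M) (hle : ∀ y, |m y| ≤ M y) (hφ : Continuous φ) (hφc : HasCompactSupport φ) :
    Integrable (fun y => m y * φ y) := by
  have hdom : Integrable (fun y => M y * |φ y|) :=
    (hM.mul (continuous_abs.comp hφ)).integrable_of_hasCompactSupport (hφc.norm.mul_left)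
  refine hdom.mono' (hm.aestronglyMeasurable.mul hφ.aestronglyMeasurable) (Eventually.of_forall fun y => ?_)
  rw [Real.norm_eq_abs, abs_mul]
  exact mul_le_mul_of_nonneg_right (hle y) (abs_nonneg _)

variable {u : EuclideanSpace ℝ (Fin n) → ℝ}

/-- Measurability of `y ↦ F(y) · a(y) G(y)` for continuous vector functions `F, G` and measurable coefficients.
[cite: Moser1961Harnack, Theorem 1, proof §4 (energy identity and Caccioppoli inequalities)] -/
theorem measurable_dotProduct_mulVec (hmeas : ∀ i j, Measurable fun y => a y i j)
    {F G : EuclideanSpace ℝ (Fin n) → Fin n → ℝ} (hF : ∀ i, Continuous fun y => F y i)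
    (hG : ∀ j, Continuous fun y => G y j) : Measurable fun y => F y ⬝ᵥ (a y *ᵥ G y) := by
  have hfun : (fun y => F y ⬝ᵥ (a y *ᵥ G y)) = fun y => ∑ i, ∑ j, a y i j * F y i * G y j := by
    funext y; rw [sum_sum_mul_eq_dotProduct]
  rw [hfun]
  refine Finset.measurable_sum _ fun i _ => Finset.measurable_sum _ fun j _ => ?_
  exact ((hmeas i j).mul (hF i).measurable).mul (hG j).measurable

/-- The partial derivatives of a `C¹` function are continuous.
[cite: Moser1961Harnack, Theorem 1, proof §4 (energy identity and Caccioppoli inequalities)] -/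
theorem continuous_fderiv_single (hu : ContDiff ℝ 1 u) (i : Fin n) :
    Continuous fun y => fderiv ℝ u y (EuclideanSpace.single i 1) :=
  (hu.continuous_fderiv one_ne_zero).clm_apply continuous_const

/-- A pointwise bound for the bilinear form by a continuous function: `|F·aG| ≤ (F·aF + G·aG)/2 ≤ nΛ(ΣFᵢ² + ΣGⱼ²)/2`.
[cite: Moser1961Harnack, Theorem 1, proof §4 (energy identity and Caccioppoli inequalities)] -/
theorem abs_dotProduct_mulVec_le (hsymm : ∀ y, (a y).IsSymm) (hlam : 0 < lam)
    (hell : ∀ y (ξ : Fin n → ℝ), lam * (ξ ⬝ᵥ ξ) ≤ ξ ⬝ᵥ (a y *ᵥ ξ)) (hbd : ∀ y i j, |a y i j| ≤ Λ)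
    (y : EuclideanSpace ℝ (Fin n)) (F G : Fin n → ℝ) :
    |F ⬝ᵥ (a y *ᵥ G)| ≤ n * Λ * (∑ i, F i ^ 2 + ∑ j, G j ^ 2) / 2 := by
  have hcs := quadForm_cauchySchwarz hsymm hlam hell y F G
  have hF := quadForm_upper hbd y F
  have hG := quadForm_upper hbd y G
  have hF0 : 0 ≤ F ⬝ᵥ (a y *ᵥ F) :=
    (mul_nonneg hlam.le (Finset.sum_nonneg fun i _ => sq_nonneg (F i))).trans (quadForm_lower hell y F)
  have hG0 : 0 ≤ G ⬝ᵥ (a y *ᵥ G) :=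
    (mul_nonneg hlam.le (Finset.sum_nonneg fun i _ => sq_nonneg (G i))).trans (quadForm_lower hell y G)
  -- `|B| ≤ (Q(F) + Q(G))/2` from `B² ≤ Q(F) Q(G) ≤ ((Q(F)+Q(G))/2)²`
  have hsq : (F ⬝ᵥ (a y *ᵥ G)) ^ 2 ≤ ((F ⬝ᵥ (a y *ᵥ F) + G ⬝ᵥ (a y *ᵥ G)) / 2) ^ 2 := by
    nlinarith [sq_nonneg (F ⬝ᵥ (a y *ᵥ F) - G ⬝ᵥ (a y *ᵥ G))]
  have h1 : |F ⬝ᵥ (a y *ᵥ G)| ≤ (F ⬝ᵥ (a y *ᵥ F) + G ⬝ᵥ (a y *ᵥ G)) / 2 :=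
    abs_le_of_sq_le_sq hsq (by positivity)
  linarith

/-! ### Test functions `η = χ² g(u)` and the weighted energy identity -/

/-- For `u ∈ C¹` with `u ≥ 1`, `g ∈ C¹(]½,∞[)` and `χ ∈ C¹`: `η = χ² g(u)` is `C¹`.
[cite: Moser1961Harnack, Theorem 1, proof §4 (energy identity and Caccioppoli inequalities)] -/
theorem contDiff_testFun (hu : ContDiff ℝ 1 u) (hu1 : ∀ y, 1 ≤ u y) {g : ℝ → ℝ}
    (hg : ContDiffOn ℝ 1 g (Ioi (1 / 2))) {χ : EuclideanSpace ℝ (Fin n) → ℝ} (hχ : ContDiff ℝ 1 χ) :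
    ContDiff ℝ 1 fun y => χ y ^ 2 * g (u y) := by
  have hgu : ContDiff ℝ 1 fun y => g (u y) := by
    rw [contDiff_iff_contDiffAt]
    intro y
    have hy : u y ∈ Ioi (1 / 2 : ℝ) := by have := hu1 y; simp only [mem_Ioi]; linarith
    exact (hg.contDiffAt (Ioi_mem_nhds hy)).comp y hu.contDiffAt
  exact (hχ.pow 2).mul hgu

/-- … and compactly supported if `χ` is.
[cite: Moser1961Harnack, Theorem 1, proof §4 (energy identity and Caccioppoli inequalities)] -/
theorem hasCompactSupport_testFun {g : ℝ → ℝ} {χ : EuclideanSpace ℝ (Fin n) → ℝ} (hχc : HasCompactSupport χ) :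
    HasCompactSupport fun y => χ y ^ 2 * g (u y) := by
  have h : HasCompactSupport fun y => χ y ^ 2 := hχc.comp_left (g := fun s : ℝ => s ^ 2) (by simp)
  exact h.mul_right

/-- The partial derivatives of the test function: `∂ⱼ(χ² g(u)) = 2χ g(u) ∂ⱼχ + χ² g′(u) ∂ⱼu`.
[cite: Moser1961Harnack, Theorem 1, proof §4 (energy identity and Caccioppoli inequalities)] -/
theorem fderiv_testFun (hu : ContDiff ℝ 1 u) (hu1 : ∀ y, 1 ≤ u y) {g : ℝ → ℝ}
    (hg : ContDiffOn ℝ 1 g (Ioi (1 / 2))) {χ : EuclideanSpace ℝ (Fin n) → ℝ} (hχ : ContDiff ℝ 1 χ)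
    (y : EuclideanSpace ℝ (Fin n)) (w : EuclideanSpace ℝ (Fin n)) :
    fderiv ℝ (fun y => χ y ^ 2 * g (u y)) y w =
      2 * χ y * g (u y) * fderiv ℝ χ y w + χ y ^ 2 * deriv g (u y) * fderiv ℝ u y w := by
  have hy : u y ∈ Ioi (1 / 2 : ℝ) := by have := hu1 y; simp only [mem_Ioi]; linarith
  have hgd : HasDerivAt g (deriv g (u y)) (u y) :=
    ((hg.contDiffAt (Ioi_mem_nhds hy)).differentiableAt one_ne_zero).hasDerivAt
  have hud : HasFDerivAt u (fderiv ℝ u y) y := ((hu.differentiable one_ne_zero) y).hasFDerivAt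
  have hχd : HasFDerivAt χ (fderiv ℝ χ y) y := ((hχ.differentiable one_ne_zero) y).hasFDerivAt
  have hgu : HasFDerivAt (fun y => g (u y)) (deriv g (u y) • fderiv ℝ u y) y := hgd.comp_hasFDerivAt y hud
  have hχ2 : HasFDerivAt (fun y => χ y ^ 2) ((2 * χ y) • fderiv ℝ χ y) y := by
    have h := hχd.pow 2
    simpa using h
  have hprod := hχ2.mul hgu
  rw [show (fun y => χ y ^ 2 * g (u y)) = ((fun y => χ y ^ 2) * fun y => g (u y)) from rfl, hprod.fderiv]
  simp only [_root_.add_apply, FunLike.coe_smul, Pi.smul_apply, smul_eq_mul]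
  ring

/-- **Weighted energy identity.**  Let `u ∈ C¹(ℝⁿ)`, `u ≥ 1`, be a weak solution (`∫ Σ aᵢⱼ ∂ᵢu ∂ⱼη = 0` for all
`η ∈ C¹_c`), `g ∈ C¹(]½,∞[)`, `χ ∈ C¹_c`.  Then, with `Du = (∂ᵢu)ᵢ`, `Dχ = (∂ⱼχ)ⱼ`,
`∫ χ² g′(u) Du·a Du = −2 ∫ χ g(u) Du·a Dχ`.
[cite: Moser1961Harnack, Theorem 1, proof §4 (energy identity and Caccioppoli inequalities)] -/
theorem energy_identity_weighted (hsymm : ∀ y, (a y).IsSymm) (hlam : 0 < lam)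
    (hmeas : ∀ i j, Measurable fun y => a y i j)
    (hell : ∀ y (ξ : Fin n → ℝ), lam * (ξ ⬝ᵥ ξ) ≤ ξ ⬝ᵥ (a y *ᵥ ξ)) (hbd : ∀ y i j, |a y i j| ≤ Λ)
    (hu : ContDiff ℝ 1 u) (hu1 : ∀ y, 1 ≤ u y)
    (hweak : ∀ η : EuclideanSpace ℝ (Fin n) → ℝ, ContDiff ℝ 1 η → HasCompactSupport η →
      ∫ y, ∑ i, ∑ j, a y i j * fderiv ℝ u y (EuclideanSpace.single i 1) *
        fderiv ℝ η y (EuclideanSpace.single j 1) = 0)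
    {g : ℝ → ℝ} (hg : ContDiffOn ℝ 1 g (Ioi (1 / 2)))
    {χ : EuclideanSpace ℝ (Fin n) → ℝ} (hχ : ContDiff ℝ 1 χ) (hχc : HasCompactSupport χ) :
    ∫ y, χ y ^ 2 * deriv g (u y) *
        ((fun i => fderiv ℝ u y (EuclideanSpace.single i 1)) ⬝ᵥ
          (a y *ᵥ fun i => fderiv ℝ u y (EuclideanSpace.single i 1))) =
      -2 * ∫ y, χ y * g (u y) *
        ((fun i => fderiv ℝ u y (EuclideanSpace.single i 1)) ⬝ᵥ
          (a y *ᵥ fun j => fderiv ℝ χ y (EuclideanSpace.single j 1))) := by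
  -- continuity facts
  have hcu := continuous_fderiv_single hu
  have hcχ := continuous_fderiv_single hχ
  have hgu : Continuous fun y => g (u y) :=
    (contDiff_testFun hu hu1 hg (contDiff_const (c := (1 : ℝ)))).continuous.congr fun y => by simp
  have hg'u : Continuous fun y => deriv g (u y) := by
    have hg' : ContinuousOn (deriv g) (Ioi (1 / 2)) :=
      (hg.continuousOn_deriv_of_isOpen isOpen_Ioi le_rfl)
    refine hg'.comp_continuous hu.continuous fun y => ?_
    have := hu1 y; simp only [mem_Ioi]; linarith
  -- the test function and its gradient
  have hη := hweak _ (contDiff_testFun hu hu1 hg hχ) (hasCompactSupport_testFun hχc)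
  have hpt : ∀ y, ∑ i, ∑ j, a y i j * fderiv ℝ u y (EuclideanSpace.single i 1) *
        fderiv ℝ (fun y => χ y ^ 2 * g (u y)) y (EuclideanSpace.single j 1) =
      χ y ^ 2 * deriv g (u y) *
          ((fun i => fderiv ℝ u y (EuclideanSpace.single i 1)) ⬝ᵥ
            (a y *ᵥ fun i => fderiv ℝ u y (EuclideanSpace.single i 1))) +
        2 * (χ y * g (u y) *
          ((fun i => fderiv ℝ u y (EuclideanSpace.single i 1)) ⬝ᵥ
            (a y *ᵥ fun j => fderiv ℝ χ y (EuclideanSpace.single j 1)))) := by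
    intro y
    rw [← sum_sum_mul_eq_dotProduct, ← sum_sum_mul_eq_dotProduct]
    simp only [fderiv_testFun hu hu1 hg hχ y, Finset.mul_sum, ← Finset.sum_add_distrib]
    exact Finset.sum_congr rfl fun i _ => Finset.sum_congr rfl fun j _ => by ring
  simp_rw [hpt] at hη
  -- integrability of the two summands
  have hI1 : Integrable fun y => χ y ^ 2 * deriv g (u y) *
      ((fun i => fderiv ℝ u y (EuclideanSpace.single i 1)) ⬝ᵥ
        (a y *ᵥ fun i => fderiv ℝ u y (EuclideanSpace.single i 1))) := by
    have h := integrable_mul_of_le_continuous (n := n)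
      (m := fun y => (fun i => fderiv ℝ u y (EuclideanSpace.single i 1)) ⬝ᵥ
        (a y *ᵥ fun i => fderiv ℝ u y (EuclideanSpace.single i 1)))
      (M := fun y => n * Λ * (∑ i, fderiv ℝ u y (EuclideanSpace.single i 1) ^ 2 +
        ∑ j, fderiv ℝ u y (EuclideanSpace.single j 1) ^ 2) / 2)
      (φ := fun y => χ y ^ 2 * deriv g (u y))
      (measurable_dotProduct_mulVec hmeas hcu hcu) (by fun_prop)
      (fun y => abs_dotProduct_mulVec_le hsymm hlam hell hbd y _ _) ((hχ.continuous.pow 2).mul hg'u)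
      ((hasCompactSupport_testFun (u := u) (g := deriv g) hχc))
    exact h.congr (Eventually.of_forall fun y => by ring)
  have hI2 : Integrable fun y => χ y * g (u y) *
      ((fun i => fderiv ℝ u y (EuclideanSpace.single i 1)) ⬝ᵥ
        (a y *ᵥ fun j => fderiv ℝ χ y (EuclideanSpace.single j 1))) := by
    have h := integrable_mul_of_le_continuous (n := n)
      (m := fun y => (fun i => fderiv ℝ u y (EuclideanSpace.single i 1)) ⬝ᵥ
        (a y *ᵥ fun j => fderiv ℝ χ y (EuclideanSpace.single j 1)))
      (M := fun y => n * Λ * (∑ i, fderiv ℝ u y (EuclideanSpace.single i 1) ^ 2 +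
        ∑ j, fderiv ℝ χ y (EuclideanSpace.single j 1) ^ 2) / 2)
      (φ := fun y => χ y * g (u y))
      (measurable_dotProduct_mulVec hmeas hcu hcχ) (by fun_prop)
      (fun y => abs_dotProduct_mulVec_le hsymm hlam hell hbd y _ _) (hχ.continuous.mul hgu)
      (hχc.mul_right)
    exact h.congr (Eventually.of_forall fun y => by ring)
  rw [integral_add hI1 (hI2.const_mul 2), integral_const_mul] at hη
  linarith

/-- **Weighted Caccioppoli inequality.**  In the setting of `energy_identity_weighted`, if moreover `g′ > 0` on
`]½,∞[`, then `∫ χ² g′(u) Du·aDu ≤ 4 ∫ (g(u)²/g′(u)) Dχ·aDχ`.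
[cite: Moser1961Harnack, Theorem 1, proof §4 (energy identity and Caccioppoli inequalities)] -/
theorem caccioppoli_weighted (hsymm : ∀ y, (a y).IsSymm) (hlam : 0 < lam)
    (hmeas : ∀ i j, Measurable fun y => a y i j)
    (hell : ∀ y (ξ : Fin n → ℝ), lam * (ξ ⬝ᵥ ξ) ≤ ξ ⬝ᵥ (a y *ᵥ ξ)) (hbd : ∀ y i j, |a y i j| ≤ Λ)
    (hu : ContDiff ℝ 1 u) (hu1 : ∀ y, 1 ≤ u y)
    (hweak : ∀ η : EuclideanSpace ℝ (Fin n) → ℝ, ContDiff ℝ 1 η → HasCompactSupport η →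
      ∫ y, ∑ i, ∑ j, a y i j * fderiv ℝ u y (EuclideanSpace.single i 1) *
        fderiv ℝ η y (EuclideanSpace.single j 1) = 0)
    {g : ℝ → ℝ} (hg : ContDiffOn ℝ 1 g (Ioi (1 / 2))) (hg' : ∀ s, 1 / 2 < s → 0 < deriv g s)
    {χ : EuclideanSpace ℝ (Fin n) → ℝ} (hχ : ContDiff ℝ 1 χ) (hχc : HasCompactSupport χ) :
    ∫ y, χ y ^ 2 * deriv g (u y) *
        ((fun i => fderiv ℝ u y (EuclideanSpace.single i 1)) ⬝ᵥ
          (a y *ᵥ fun i => fderiv ℝ u y (EuclideanSpace.single i 1))) ≤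
      4 * ∫ y, g (u y) ^ 2 / deriv g (u y) *
        ((fun j => fderiv ℝ χ y (EuclideanSpace.single j 1)) ⬝ᵥ
          (a y *ᵥ fun j => fderiv ℝ χ y (EuclideanSpace.single j 1))) := by
  set Du : EuclideanSpace ℝ (Fin n) → Fin n → ℝ := fun y i => fderiv ℝ u y (EuclideanSpace.single i 1) with hDu
  set Dχ : EuclideanSpace ℝ (Fin n) → Fin n → ℝ := fun y j => fderiv ℝ χ y (EuclideanSpace.single j 1) with hDχ
  have hid := energy_identity_weighted hsymm hlam hmeas hell hbd hu hu1 hweak hg hχ hχc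
  have hcu := continuous_fderiv_single hu
  have hcχ := continuous_fderiv_single hχ
  have hgu : Continuous fun y => g (u y) :=
    (contDiff_testFun hu hu1 hg (contDiff_const (c := (1 : ℝ)))).continuous.congr fun y => by simp
  have hg'u : Continuous fun y => deriv g (u y) := by
    have hg'c : ContinuousOn (deriv g) (Ioi (1 / 2)) := hg.continuousOn_deriv_of_isOpen isOpen_Ioi le_rfl
    refine hg'c.comp_continuous hu.continuous fun y => ?_
    have := hu1 y; simp only [mem_Ioi]; linarith
  have hg'pos : ∀ y, 0 < deriv g (u y) := fun y => hg' _ (by have := hu1 y; linarith)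
  -- pointwise Young + Cauchy–Schwarz: `2|χ g B| ≤ ½ χ² g′ Q(Du) + 2 (g²/g′) Q(Dχ)`
  have hpt : ∀ y, 2 * |χ y * g (u y) * (Du y ⬝ᵥ (a y *ᵥ Dχ y))| ≤
      (1 / 2) * (χ y ^ 2 * deriv g (u y) * (Du y ⬝ᵥ (a y *ᵥ Du y))) +
        2 * (g (u y) ^ 2 / deriv g (u y) * (Dχ y ⬝ᵥ (a y *ᵥ Dχ y))) := by
    intro y
    have hcs := quadForm_cauchySchwarz hsymm hlam hell y (Du y) (Dχ y)
    have hQ1 : 0 ≤ Du y ⬝ᵥ (a y *ᵥ Du y) :=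
      (mul_nonneg hlam.le (Finset.sum_nonneg fun i _ => sq_nonneg (Du y i))).trans (quadForm_lower hell y _)
    have hQ2 : 0 ≤ Dχ y ⬝ᵥ (a y *ᵥ Dχ y) :=
      (mul_nonneg hlam.le (Finset.sum_nonneg fun i _ => sq_nonneg (Dχ y i))).trans (quadForm_lower hell y _)
    have hgp := hg'pos y
    set A := (1 / 2) * (χ y ^ 2 * deriv g (u y) * (Du y ⬝ᵥ (a y *ᵥ Du y))) with hA
    set Cc := 2 * (g (u y) ^ 2 / deriv g (u y) * (Dχ y ⬝ᵥ (a y *ᵥ Dχ y))) with hC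
    have hA0 : 0 ≤ A := by rw [hA]; positivity
    have hC0 : 0 ≤ Cc := by rw [hC]; positivity
    set x := χ y * g (u y) * (Du y ⬝ᵥ (a y *ᵥ Dχ y)) with hx
    -- `x² ≤ A·Cc`
    have hx2 : x ^ 2 ≤ A * Cc := by
      have h1 : x ^ 2 = χ y ^ 2 * g (u y) ^ 2 * (Du y ⬝ᵥ (a y *ᵥ Dχ y)) ^ 2 := by rw [hx]; ring
      have h2 : A * Cc = χ y ^ 2 * g (u y) ^ 2 * ((Du y ⬝ᵥ (a y *ᵥ Du y)) * (Dχ y ⬝ᵥ (a y *ᵥ Dχ y))) := by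
        rw [hA, hC]; field_simp
      rw [h1, h2]
      exact mul_le_mul_of_nonneg_left hcs (by positivity)
    nlinarith [sq_nonneg (A - Cc), sq_abs x, abs_nonneg x, hx2]
  -- integrate
  have hI2 : Integrable fun y => χ y * g (u y) * (Du y ⬝ᵥ (a y *ᵥ Dχ y)) := by
    have h := integrable_mul_of_le_continuous (n := n) (m := fun y => Du y ⬝ᵥ (a y *ᵥ Dχ y))
      (M := fun y => n * Λ * (∑ i, Du y i ^ 2 + ∑ j, Dχ y j ^ 2) / 2) (φ := fun y => χ y * g (u y))
      (measurable_dotProduct_mulVec hmeas hcu hcχ) (by simp only [hDu, hDχ]; fun_prop)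
      (fun y => abs_dotProduct_mulVec_le hsymm hlam hell hbd y _ _) (hχ.continuous.mul hgu) (hχc.mul_right)
    exact h.congr (Eventually.of_forall fun y => by ring)
  have hIA : Integrable fun y => χ y ^ 2 * deriv g (u y) * (Du y ⬝ᵥ (a y *ᵥ Du y)) := by
    have h := integrable_mul_of_le_continuous (n := n) (m := fun y => Du y ⬝ᵥ (a y *ᵥ Du y))
      (M := fun y => n * Λ * (∑ i, Du y i ^ 2 + ∑ j, Du y j ^ 2) / 2) (φ := fun y => χ y ^ 2 * deriv g (u y))
      (measurable_dotProduct_mulVec hmeas hcu hcu) (by simp only [hDu]; fun_prop)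
      (fun y => abs_dotProduct_mulVec_le hsymm hlam hell hbd y _ _) ((hχ.continuous.pow 2).mul hg'u)
      (hasCompactSupport_testFun (u := u) (g := deriv g) hχc)
    exact h.congr (Eventually.of_forall fun y => by ring)
  have hIC : Integrable fun y => g (u y) ^ 2 / deriv g (u y) * (Dχ y ⬝ᵥ (a y *ᵥ Dχ y)) := by
    -- dominate by the continuous compactly supported `(g(u)²/g′(u)) · nΛ Σⱼ (∂ⱼχ)²`
    have hM : Integrable fun y => g (u y) ^ 2 / deriv g (u y) * (n * Λ * ∑ j, Dχ y j ^ 2) := by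
      have hc : Continuous fun y => g (u y) ^ 2 / deriv g (u y) * (n * Λ * ∑ j, Dχ y j ^ 2) := by
        refine ((hgu.pow 2).div hg'u fun y => (hg'pos y).ne').mul ?_
        simp only [hDχ]; fun_prop
      refine hc.integrable_of_hasCompactSupport ?_
      have hs : HasCompactSupport fun y => n * Λ * ∑ j, Dχ y j ^ 2 := by
        refine (hχc.fderiv (𝕜 := ℝ)).mono (Function.support_subset_iff'.2 fun y hy => ?_)
        simp only [Function.mem_support, not_not] at hy
        simp [hDχ, hy]
      exact hs.mul_left
    refine hM.mono' ?_ (Eventually.of_forall fun y => ?_)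
    · exact ((hgu.pow 2).div hg'u fun y => (hg'pos y).ne').aestronglyMeasurable.mul
        (measurable_dotProduct_mulVec hmeas hcχ hcχ).aestronglyMeasurable
    · have hq0 : 0 ≤ Dχ y ⬝ᵥ (a y *ᵥ Dχ y) :=
        (mul_nonneg hlam.le (Finset.sum_nonneg fun i _ => sq_nonneg (Dχ y i))).trans (quadForm_lower hell y _)
      have hfac : 0 ≤ g (u y) ^ 2 / deriv g (u y) := div_nonneg (sq_nonneg _) (hg'pos y).le
      rw [Real.norm_eq_abs, abs_of_nonneg (mul_nonneg hfac hq0)]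
      exact mul_le_mul_of_nonneg_left (quadForm_upper hbd y _) hfac
  have hint : ∫ y, χ y ^ 2 * deriv g (u y) * (Du y ⬝ᵥ (a y *ᵥ Du y)) ≤
      (1 / 2) * (∫ y, χ y ^ 2 * deriv g (u y) * (Du y ⬝ᵥ (a y *ᵥ Du y))) +
        2 * (∫ y, g (u y) ^ 2 / deriv g (u y) * (Dχ y ⬝ᵥ (a y *ᵥ Dχ y))) := by
    calc ∫ y, χ y ^ 2 * deriv g (u y) * (Du y ⬝ᵥ (a y *ᵥ Du y))
        = -2 * ∫ y, χ y * g (u y) * (Du y ⬝ᵥ (a y *ᵥ Dχ y)) := hid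
      _ ≤ ∫ y, 2 * |χ y * g (u y) * (Du y ⬝ᵥ (a y *ᵥ Dχ y))| := by
          rw [← integral_const_mul]
          refine integral_mono (hI2.const_mul _) (hI2.abs.const_mul 2) fun y => ?_
          have := neg_abs_le (χ y * g (u y) * (Du y ⬝ᵥ (a y *ᵥ Dχ y)))
          simp only; linarith
      _ ≤ ∫ y, ((1 / 2) * (χ y ^ 2 * deriv g (u y) * (Du y ⬝ᵥ (a y *ᵥ Du y))) +
            2 * (g (u y) ^ 2 / deriv g (u y) * (Dχ y ⬝ᵥ (a y *ᵥ Dχ y)))) :=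
          integral_mono (hI2.abs.const_mul 2) ((hIA.const_mul _).add (hIC.const_mul _)) hpt
      _ = (1 / 2) * (∫ y, χ y ^ 2 * deriv g (u y) * (Du y ⬝ᵥ (a y *ᵥ Du y))) +
            2 * (∫ y, g (u y) ^ 2 / deriv g (u y) * (Dχ y ⬝ᵥ (a y *ᵥ Dχ y))) := by
          rw [integral_add (hIA.const_mul _) (hIC.const_mul _), integral_const_mul, integral_const_mul]
  linarith

end Literature.Analysis.PDE.DivForm.Caccioppoli

end

end Part1

/-!
## Part 2 — port of `Summits/NavierStokesRegularity/NavierStokesRegularity/Theorems/PoloidalWindowDoorPoloidalWindowRigidityDivFormCaccioppoliPowers.lean`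

# Route `PoloidalWindowDoor`, crux K2 (stmt-NavierStokesRegularity-19708) — task H5, step M1b: POWER and LOGARITHMIC
# Caccioppoli inequalities for `div(a∇u) = 0` (towards `divFormLiouville_holds`, De Giorgi–Nash–Moser)

Specialisations of `…DivFormCaccioppoli.caccioppoli_weighted` (seat ns-poloidal-K2-p3 g2, `ledger fact claim` #1 on
`Literature.Analysis.PDE.divFormLiouville`; setting = that fact's rendering, `u ≥ 1`):

* `caccioppoli_rpow` — weight `g(s) = s^β/β`, `β ≠ 0` (Moser 1961 §4, (4.4); Gilbarg–Trudinger (8.52)):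
  `∫ χ² u^{β−1} Du·aDu ≤ (4/β²) ∫ u^{β+1} Dχ·aDχ`;
* `caccioppoli_log` — weight `g(s) = −1/s` (the case `β = −1`; Moser 1961 §5, the logarithmic estimate):
  `∫ χ² u^{−2} Du·aDu ≤ 4 ∫ Dχ·aDχ`, i.e. `λ ∫ χ²|∇ log u|² ≤ 4nΛ ∫ |∇χ|²` (`gradLog_estimate`);
(The Sobolev-ready form for `w = u^{p/2}` — `λ ∫ χ² ‖D(u^{p/2})‖² ≤ (p/(p−1))²·nΛ·∫ u^p ‖Dχ‖²` — is derived in the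
Moser-iteration file M3 from `caccioppoli_rpow`.)

WHAT THIS IS NOT: not yet the Liouville theorem (M2–M4 to come); nothing NS-specific.
-/

section Part2

noncomputable section

open _root_.MeasureTheory _root_.Set _root_.Function _root_.Filter _root_.Topology _root_.Metric
open scoped _root_.Matrix

namespace Literature.Analysis.PDE.DivForm.CaccioppoliPowers

open Literature.Analysis.PDE.DivForm.Caccioppoli

variable {n : ℕ} {a : EuclideanSpace ℝ (Fin n) → Matrix (Fin n) (Fin n) ℝ} {lam Λ : ℝ}
  {u : EuclideanSpace ℝ (Fin n) → ℝ}

/-! ### The two weights -/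

/-- `s ↦ s^β/β` is `C¹` on `]½,∞[`.
[cite: Moser1961Harnack, Theorem 1, proof §4 (power and logarithmic Caccioppoli)] -/
theorem contDiffOn_rpow_div (β : ℝ) : ContDiffOn ℝ 1 (fun s : ℝ => s ^ β / β) (Ioi (1 / 2)) := by
  intro s hs
  have hs0 : s ≠ 0 := by simp only [mem_Ioi] at hs; exact (by linarith : (0:ℝ) < s).ne'
  exact ((Real.contDiffAt_rpow_const_of_ne (p := β) (n := 1) hs0).div_const β).contDiffWithinAt

/-- `(s^β/β)′ = s^{β−1}` for `s ≠ 0`, `β ≠ 0`.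
[cite: Moser1961Harnack, Theorem 1, proof §4 (power and logarithmic Caccioppoli)] -/
theorem deriv_rpow_div {β : ℝ} (hβ : β ≠ 0) {s : ℝ} (hs : s ≠ 0) :
    deriv (fun s : ℝ => s ^ β / β) s = s ^ (β - 1) := by
  have h : HasDerivAt (fun s : ℝ => s ^ β / β) (β * s ^ (β - 1) / β) s :=
    (Real.hasDerivAt_rpow_const (Or.inl hs)).div_const β
  rw [h.deriv]
  field_simp

/-- `s ↦ −1/s` is `C¹` on `]½,∞[`.
[cite: Moser1961Harnack, Theorem 1, proof §4 (power and logarithmic Caccioppoli)] -/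
theorem contDiffOn_neg_inv : ContDiffOn ℝ 1 (fun s : ℝ => -s⁻¹) (Ioi (1 / 2)) := by
  intro s hs
  have hs0 : s ≠ 0 := by simp only [mem_Ioi] at hs; exact (by linarith : (0:ℝ) < s).ne'
  exact (contDiffAt_inv ℝ hs0).neg.contDiffWithinAt

/-- `(−1/s)′ = 1/s²` for `s ≠ 0`. [cite: Moser1961Harnack, Theorem 1, proof §4 (power and logarithmic Caccioppoli)] -/
theorem deriv_neg_inv {s : ℝ} (hs : s ≠ 0) : deriv (fun s : ℝ => -s⁻¹) s = (s ^ 2)⁻¹ := by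
  have h : HasDerivAt (fun s : ℝ => -s⁻¹) (-(-(s ^ 2)⁻¹)) s := (hasDerivAt_inv hs).neg
  rw [h.deriv, neg_neg]

/-! ### Power Caccioppoli -/

/-- **POWER CACCIOPPOLI** (Moser 1961 (4.4)): for a `C¹` weak solution `u ≥ 1` of `div(a∇u) = 0`, `β ≠ 0` and `χ ∈ C¹_c`:
`∫ χ² u^{β−1} Du·aDu ≤ (4/β²) ∫ u^{β+1} Dχ·aDχ`.
[cite: Moser1961Harnack, Theorem 1, proof §4 (power and logarithmic Caccioppoli)] -/
theorem caccioppoli_rpow (hsymm : ∀ y, (a y).IsSymm) (hlam : 0 < lam)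
    (hmeas : ∀ i j, Measurable fun y => a y i j)
    (hell : ∀ y (ξ : Fin n → ℝ), lam * (ξ ⬝ᵥ ξ) ≤ ξ ⬝ᵥ (a y *ᵥ ξ)) (hbd : ∀ y i j, |a y i j| ≤ Λ)
    (hu : ContDiff ℝ 1 u) (hu1 : ∀ y, 1 ≤ u y)
    (hweak : ∀ η : EuclideanSpace ℝ (Fin n) → ℝ, ContDiff ℝ 1 η → HasCompactSupport η →
      ∫ y, ∑ i, ∑ j, a y i j * fderiv ℝ u y (EuclideanSpace.single i 1) *
        fderiv ℝ η y (EuclideanSpace.single j 1) = 0)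
    {β : ℝ} (hβ : β ≠ 0) {χ : EuclideanSpace ℝ (Fin n) → ℝ} (hχ : ContDiff ℝ 1 χ) (hχc : HasCompactSupport χ) :
    ∫ y, χ y ^ 2 * u y ^ (β - 1) *
        ((fun i => fderiv ℝ u y (EuclideanSpace.single i 1)) ⬝ᵥ
          (a y *ᵥ fun i => fderiv ℝ u y (EuclideanSpace.single i 1))) ≤
      4 / β ^ 2 * ∫ y, u y ^ (β + 1) *
        ((fun j => fderiv ℝ χ y (EuclideanSpace.single j 1)) ⬝ᵥ
          (a y *ᵥ fun j => fderiv ℝ χ y (EuclideanSpace.single j 1))) := by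
  have hupos : ∀ y, 0 < u y := fun y => lt_of_lt_of_le one_pos (hu1 y)
  have hg' : ∀ s : ℝ, 1 / 2 < s → 0 < deriv (fun s : ℝ => s ^ β / β) s := by
    intro s hs
    have hs0 : (0 : ℝ) < s := by linarith
    rw [deriv_rpow_div hβ hs0.ne']
    exact Real.rpow_pos_of_pos hs0 _
  have h := caccioppoli_weighted hsymm hlam hmeas hell hbd hu hu1 hweak (contDiffOn_rpow_div β) hg' hχ hχc
  -- rewrite the weights: `g′(u) = u^{β−1}`, `g(u)²/g′(u) = u^{β+1}/β²`
  have h1 : ∀ y, deriv (fun s : ℝ => s ^ β / β) (u y) = u y ^ (β - 1) := fun y => deriv_rpow_div hβ (hupos y).ne'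
  have h2 : ∀ y, (u y ^ β / β) ^ 2 / u y ^ (β - 1) = (1 / β ^ 2) * u y ^ (β + 1) := by
    intro y
    have hy := hupos y
    have hr : (u y ^ β) ^ 2 = u y ^ (β + 1) * u y ^ (β - 1) := by
      rw [← Real.rpow_add hy, sq, ← Real.rpow_add hy]; congr 1; ring
    have hne : u y ^ (β - 1) ≠ 0 := (Real.rpow_pos_of_pos hy _).ne'
    rw [div_pow, hr]
    field_simp
  simp_rw [h1, h2] at h
  calc ∫ y, χ y ^ 2 * u y ^ (β - 1) *
          ((fun i => fderiv ℝ u y (EuclideanSpace.single i 1)) ⬝ᵥ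
            (a y *ᵥ fun i => fderiv ℝ u y (EuclideanSpace.single i 1)))
      ≤ 4 * ∫ y, 1 / β ^ 2 * u y ^ (β + 1) *
          ((fun j => fderiv ℝ χ y (EuclideanSpace.single j 1)) ⬝ᵥ
            (a y *ᵥ fun j => fderiv ℝ χ y (EuclideanSpace.single j 1))) := h
    _ = 4 / β ^ 2 * ∫ y, u y ^ (β + 1) *
          ((fun j => fderiv ℝ χ y (EuclideanSpace.single j 1)) ⬝ᵥ
            (a y *ᵥ fun j => fderiv ℝ χ y (EuclideanSpace.single j 1))) := by
        rw [← integral_const_mul, ← integral_const_mul]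
        congr 1; funext y; ring

/-! ### Logarithmic Caccioppoli -/

/-- **LOGARITHMIC CACCIOPPOLI** (Moser 1961 §5): for a `C¹` weak solution `u ≥ 1` and `χ ∈ C¹_c`:
`∫ χ² u^{−2} Du·aDu ≤ 4 ∫ Dχ·aDχ` (note `u^{−2} Du·aDu = D(log u)·aD(log u)`).
[cite: Moser1961Harnack, Theorem 1, proof §4 (power and logarithmic Caccioppoli)] -/
theorem caccioppoli_log (hsymm : ∀ y, (a y).IsSymm) (hlam : 0 < lam)
    (hmeas : ∀ i j, Measurable fun y => a y i j)
    (hell : ∀ y (ξ : Fin n → ℝ), lam * (ξ ⬝ᵥ ξ) ≤ ξ ⬝ᵥ (a y *ᵥ ξ)) (hbd : ∀ y i j, |a y i j| ≤ Λ)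
    (hu : ContDiff ℝ 1 u) (hu1 : ∀ y, 1 ≤ u y)
    (hweak : ∀ η : EuclideanSpace ℝ (Fin n) → ℝ, ContDiff ℝ 1 η → HasCompactSupport η →
      ∫ y, ∑ i, ∑ j, a y i j * fderiv ℝ u y (EuclideanSpace.single i 1) *
        fderiv ℝ η y (EuclideanSpace.single j 1) = 0)
    {χ : EuclideanSpace ℝ (Fin n) → ℝ} (hχ : ContDiff ℝ 1 χ) (hχc : HasCompactSupport χ) :
    ∫ y, χ y ^ 2 * (u y ^ 2)⁻¹ *
        ((fun i => fderiv ℝ u y (EuclideanSpace.single i 1)) ⬝ᵥ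
          (a y *ᵥ fun i => fderiv ℝ u y (EuclideanSpace.single i 1))) ≤
      4 * ∫ y, ((fun j => fderiv ℝ χ y (EuclideanSpace.single j 1)) ⬝ᵥ
          (a y *ᵥ fun j => fderiv ℝ χ y (EuclideanSpace.single j 1))) := by
  have hupos : ∀ y, 0 < u y := fun y => lt_of_lt_of_le one_pos (hu1 y)
  have hg' : ∀ s : ℝ, 1 / 2 < s → 0 < deriv (fun s : ℝ => -s⁻¹) s := by
    intro s hs
    have hs0 : (0 : ℝ) < s := by linarith
    rw [deriv_neg_inv hs0.ne']
    positivity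
  have h := caccioppoli_weighted hsymm hlam hmeas hell hbd hu hu1 hweak contDiffOn_neg_inv hg' hχ hχc
  have h1 : ∀ y, deriv (fun s : ℝ => -s⁻¹) (u y) = (u y ^ 2)⁻¹ := fun y => deriv_neg_inv (hupos y).ne'
  have h2 : ∀ y, (-(u y)⁻¹) ^ 2 / (u y ^ 2)⁻¹ = 1 := by
    intro y
    have hy := (hupos y).ne'
    field_simp
  simp_rw [h1, h2, one_mul] at h
  exact h

/-! ### Gradient-norm forms (ellipticity in, coefficient form out) -/

/-- `λ Σᵢ (∂ᵢu)² ≤ Du·aDu` and `Dχ·aDχ ≤ nΛ ‖Dχ‖²` turn the logarithmic Caccioppoli inequality into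
**`λ ∫ χ² ‖D u‖²/u² ≤ 4 n Λ ∫ ‖Dχ‖²`** — the `BMO` input of M2 (`‖D u‖/u = ‖D log u‖`).
[cite: Moser1961Harnack, Theorem 1, proof §4 (power and logarithmic Caccioppoli)] -/
theorem gradLog_estimate (hsymm : ∀ y, (a y).IsSymm) (hlam : 0 < lam)
    (hmeas : ∀ i j, Measurable fun y => a y i j)
    (hell : ∀ y (ξ : Fin n → ℝ), lam * (ξ ⬝ᵥ ξ) ≤ ξ ⬝ᵥ (a y *ᵥ ξ)) (hbd : ∀ y i j, |a y i j| ≤ Λ)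
    (hu : ContDiff ℝ 1 u) (hu1 : ∀ y, 1 ≤ u y)
    (hweak : ∀ η : EuclideanSpace ℝ (Fin n) → ℝ, ContDiff ℝ 1 η → HasCompactSupport η →
      ∫ y, ∑ i, ∑ j, a y i j * fderiv ℝ u y (EuclideanSpace.single i 1) *
        fderiv ℝ η y (EuclideanSpace.single j 1) = 0)
    {χ : EuclideanSpace ℝ (Fin n) → ℝ} (hχ : ContDiff ℝ 1 χ) (hχc : HasCompactSupport χ) :
    lam * ∫ y, χ y ^ 2 * (u y ^ 2)⁻¹ * ‖fderiv ℝ u y‖ ^ 2 ≤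
      4 * (n * Λ) * ∫ y, ‖fderiv ℝ χ y‖ ^ 2 := by
  have hupos : ∀ y, 0 < u y := fun y => lt_of_lt_of_le one_pos (hu1 y)
  have h := caccioppoli_log hsymm hlam hmeas hell hbd hu hu1 hweak hχ hχc
  have hcu := continuous_fderiv_single hu
  have hcχ := continuous_fderiv_single hχ
  -- continuity of the two norm integrands, compact support
  have hnu : Continuous fun y => ‖fderiv ℝ u y‖ ^ 2 := ((hu.continuous_fderiv one_ne_zero).norm).pow 2
  have hnχ : Continuous fun y => ‖fderiv ℝ χ y‖ ^ 2 := ((hχ.continuous_fderiv one_ne_zero).norm).pow 2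
  have hinvu : Continuous fun y => (u y ^ 2)⁻¹ :=
    ((hu.continuous.pow 2).inv₀ fun y => (pow_pos (hupos y) 2).ne')
  have hIl : Integrable fun y => χ y ^ 2 * (u y ^ 2)⁻¹ * ‖fderiv ℝ u y‖ ^ 2 := by
    have hc : Continuous fun y => χ y ^ 2 * (u y ^ 2)⁻¹ * ‖fderiv ℝ u y‖ ^ 2 :=
      ((hχ.continuous.pow 2).mul hinvu).mul hnu
    refine hc.integrable_of_hasCompactSupport ?_
    exact ((hasCompactSupport_testFun (u := u) (g := fun s => (s ^ 2)⁻¹) hχc).mul_right)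
  have hIr : Integrable fun y => ‖fderiv ℝ χ y‖ ^ 2 := by
    refine hnχ.integrable_of_hasCompactSupport ?_
    exact (hχc.fderiv (𝕜 := ℝ)).norm.comp_left (g := fun s : ℝ => s ^ 2) (by simp)
  -- lower bound on the left integrand, upper bound on the right integrand
  have hle_l : ∀ y, lam * (χ y ^ 2 * (u y ^ 2)⁻¹ * ‖fderiv ℝ u y‖ ^ 2) ≤
      χ y ^ 2 * (u y ^ 2)⁻¹ *
        ((fun i => fderiv ℝ u y (EuclideanSpace.single i 1)) ⬝ᵥ
          (a y *ᵥ fun i => fderiv ℝ u y (EuclideanSpace.single i 1))) := by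
    intro y
    have hq := quadForm_lower hell y (fun i => fderiv ℝ u y (EuclideanSpace.single i 1))
    rw [sum_fderiv_single_sq] at hq
    have hw : 0 ≤ χ y ^ 2 * (u y ^ 2)⁻¹ := by positivity
    nlinarith
  have hle_r : ∀ y, ((fun j => fderiv ℝ χ y (EuclideanSpace.single j 1)) ⬝ᵥ
          (a y *ᵥ fun j => fderiv ℝ χ y (EuclideanSpace.single j 1))) ≤ n * Λ * ‖fderiv ℝ χ y‖ ^ 2 := by
    intro y
    have hq := quadForm_upper hbd y (fun j => fderiv ℝ χ y (EuclideanSpace.single j 1))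
    rwa [sum_fderiv_single_sq] at hq
  -- integrability of the coefficient-form integrands (from the Caccioppoli file's lemmas)
  have hIql : Integrable fun y => χ y ^ 2 * (u y ^ 2)⁻¹ *
      ((fun i => fderiv ℝ u y (EuclideanSpace.single i 1)) ⬝ᵥ
        (a y *ᵥ fun i => fderiv ℝ u y (EuclideanSpace.single i 1))) := by
    have h' := integrable_mul_of_le_continuous (n := n)
      (m := fun y => (fun i => fderiv ℝ u y (EuclideanSpace.single i 1)) ⬝ᵥ
        (a y *ᵥ fun i => fderiv ℝ u y (EuclideanSpace.single i 1)))
      (M := fun y => n * Λ * (∑ i, fderiv ℝ u y (EuclideanSpace.single i 1) ^ 2 +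
        ∑ j, fderiv ℝ u y (EuclideanSpace.single j 1) ^ 2) / 2)
      (φ := fun y => χ y ^ 2 * (u y ^ 2)⁻¹)
      (measurable_dotProduct_mulVec hmeas hcu hcu) (by fun_prop)
      (fun y => abs_dotProduct_mulVec_le hsymm hlam hell hbd y _ _) ((hχ.continuous.pow 2).mul hinvu)
      (hasCompactSupport_testFun (u := u) (g := fun s => (s ^ 2)⁻¹) hχc)
    exact h'.congr (Eventually.of_forall fun y => by ring)
  have hIqr : Integrable fun y => ((fun j => fderiv ℝ χ y (EuclideanSpace.single j 1)) ⬝ᵥ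
      (a y *ᵥ fun j => fderiv ℝ χ y (EuclideanSpace.single j 1))) := by
    refine (hIr.const_mul (n * Λ)).mono' (measurable_dotProduct_mulVec hmeas hcχ hcχ).aestronglyMeasurable
      (Eventually.of_forall fun y => ?_)
    have hq0 : 0 ≤ ((fun j => fderiv ℝ χ y (EuclideanSpace.single j 1)) ⬝ᵥ
        (a y *ᵥ fun j => fderiv ℝ χ y (EuclideanSpace.single j 1))) :=
      (mul_nonneg hlam.le (Finset.sum_nonneg fun i _ => sq_nonneg _)).trans (quadForm_lower hell y _)
    rw [Real.norm_eq_abs, abs_of_nonneg hq0]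
    exact hle_r y
  calc lam * ∫ y, χ y ^ 2 * (u y ^ 2)⁻¹ * ‖fderiv ℝ u y‖ ^ 2
      = ∫ y, lam * (χ y ^ 2 * (u y ^ 2)⁻¹ * ‖fderiv ℝ u y‖ ^ 2) := (integral_const_mul _ _).symm
    _ ≤ ∫ y, χ y ^ 2 * (u y ^ 2)⁻¹ *
          ((fun i => fderiv ℝ u y (EuclideanSpace.single i 1)) ⬝ᵥ
            (a y *ᵥ fun i => fderiv ℝ u y (EuclideanSpace.single i 1))) :=
        integral_mono (hIl.const_mul lam) hIql hle_l
    _ ≤ 4 * ∫ y, ((fun j => fderiv ℝ χ y (EuclideanSpace.single j 1)) ⬝ᵥ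
          (a y *ᵥ fun j => fderiv ℝ χ y (EuclideanSpace.single j 1))) := h
    _ ≤ 4 * ∫ y, n * Λ * ‖fderiv ℝ χ y‖ ^ 2 :=
        mul_le_mul_of_nonneg_left (integral_mono hIqr (hIr.const_mul _) hle_r) (by norm_num)
    _ = 4 * (n * Λ) * ∫ y, ‖fderiv ℝ χ y‖ ^ 2 := by rw [integral_const_mul]; ring

end Literature.Analysis.PDE.DivForm.CaccioppoliPowers

end

end Part2

/-!
## Part 3 — port of `Summits/NavierStokesRegularity/NavierStokesRegularity/Theorems/PoloidalWindowDoorPoloidalWindowRigidityDivFormReverseHolder.lean`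

# Route `PoloidalWindowDoor`, crux K2 (stmt-NavierStokesRegularity-19708) — task H5, step M3a: the ENERGY side of Moser's
# reverse Hölder step for `div(a∇u) = 0` (towards `divFormLiouville_holds`, De Giorgi–Nash–Moser)

Seat ns-poloidal-K2-p3 g2 (`ledger fact claim` #1 on `Literature.Analysis.PDE.divFormLiouville`; setting = that fact's
rendering, `w ≥ 1` an entire `C¹` weak solution).  Moser 1961 §4 / Gilbarg–Trudinger Thm 8.18, proof: for a real power
`q ∉ {0, 1}` and a two-radius cutoff `χ` (`χ = 1` on `B(x₀,ρ')`, `χ = 0` off `B(x₀,ρ)`, `‖Dχ‖ ≤ C₀/(ρ−ρ')`), the test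
function `φ = χ w^{q/2} ∈ C¹_c(ℝⁿ)` satisfies the energy bound
`λ ∫ ‖Dφ‖² ≤ 2 (λ + (q/(q−1))² nΛ) (C₀/(ρ−ρ'))² ∫_{B(x₀,ρ)} w^q`,
which the Sobolev inequality (M3b) turns into the reverse Hölder step of the Moser iteration, for `w` (`q > 0`) and for
`w⁻¹` (`q < 0`) alike.

* `exists_ball_cutoff₂` — two-radius ball cutoffs (from `SmoothCutoff.exists_smooth_cutoff`);
* `contDiff_rpow_of_one_le`, `fderiv_rpow_of_one_le`, `norm_fderiv_rpow_half_sq` — calculus of `w^{q/2}`;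
* `gradPow_estimate` — `λ ∫ χ² ‖D(w^{q/2})‖² ≤ (q/(q−1))² nΛ ∫ w^q ‖Dχ‖²` (from M1b `caccioppoli_rpow`, `β = q − 1`);
* `energy_testPow_le` — the displayed bound for `φ = χ w^{q/2}`, with the right side an integral over `B(x₀,ρ)`.

WHAT THIS IS NOT: not yet the Liouville theorem (M3b Sobolev/iteration, M4 Harnack ⇒ Liouville to come); nothing NS-specific.
-/

section Part3

noncomputable section

open _root_.MeasureTheory _root_.Set _root_.Function _root_.Filter _root_.Topology _root_.Metric
open scoped _root_.Matrix _root_.ENNReal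

namespace Literature.Analysis.PDE.DivForm.ReverseHolder

open Literature.Analysis.PDE.DivForm.Caccioppoli
open Literature.Analysis.PDE.DivForm.CaccioppoliPowers
open Literature.Analysis.FunctionSpaces

variable {n : ℕ}

/-! ### Two-radius cutoffs -/

/-- **Two-radius ball cutoffs.**  There is `C₀ ≥ 0` (depending only on `n`) such that for all `x₀` and `0 < ρ' < ρ`
there is `χ ∈ C¹_c(ℝⁿ)`, `0 ≤ χ ≤ 1`, `χ = 1` on `B(x₀,ρ')`, `χ = 0` off `B(x₀,ρ)`, `‖Dχ‖ ≤ C₀/(ρ − ρ')`.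
[cite: Moser1961Harnack, Theorem 1, proof (reverse Hölder step)] -/
theorem exists_ball_cutoff₂ (n : ℕ) : ∃ C₀ : ℝ, 0 ≤ C₀ ∧ ∀ (x₀ : EuclideanSpace ℝ (Fin n)) (ρ' ρ : ℝ),
    0 < ρ' → ρ' < ρ →
    ∃ χ : EuclideanSpace ℝ (Fin n) → ℝ, ContDiff ℝ 1 χ ∧ HasCompactSupport χ ∧ (∀ x, 0 ≤ χ x ∧ χ x ≤ 1) ∧
      (∀ x ∈ ball x₀ ρ', χ x = 1) ∧ (∀ x, x ∉ ball x₀ ρ → χ x = 0) ∧ ∀ x, ‖fderiv ℝ χ x‖ ≤ C₀ / (ρ - ρ') := by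
  obtain ⟨C, hC0, hC⟩ := exists_smooth_cutoff (volume : Measure (EuclideanSpace ℝ (Fin n)))
  refine ⟨2 * C, by positivity, fun x₀ ρ' ρ hρ' hρ => ?_⟩
  have hδ : 0 < (ρ - ρ') / 2 := by linarith
  obtain ⟨χ, hχs, hχ01, hχ1, hχ0, hχD⟩ := hC (ball x₀ ((ρ + ρ') / 2)) measurableSet_ball ((ρ - ρ') / 2) hδ
  have hzero : ∀ x, x ∉ ball x₀ ρ → χ x = 0 := by
    intro x hx
    refine hχ0 x (Metric.ball_disjoint_ball ?_)
    rw [mem_ball, not_lt] at hx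
    linarith
  refine ⟨χ, hχs.of_le (by norm_cast), ?_, hχ01, fun x hx => hχ1 x ?_, hzero,
    fun x => (hχD x).trans_eq (by field_simp)⟩
  · refine HasCompactSupport.intro (isCompact_closedBall x₀ ρ) fun x hx => hzero x fun hx' => hx ?_
    exact ball_subset_closedBall hx'
  · rw [mem_ball] at hx
    intro z hz
    rw [mem_ball] at hz ⊢
    calc dist z x₀ ≤ dist z x + dist x x₀ := dist_triangle _ _ _
      _ < (ρ - ρ') / 2 + ρ' := by linarith
      _ = (ρ + ρ') / 2 := by ring

/-! ### Powers of a solution bounded below by `1` -/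

variable {w : EuclideanSpace ℝ (Fin n) → ℝ}

/-- `w^s ∈ C¹` for `w ∈ C¹`, `w ≥ 1`. [cite: Moser1961Harnack, Theorem 1, proof (reverse Hölder step)] -/
theorem contDiff_rpow_of_one_le (hw : ContDiff ℝ 1 w) (hw1 : ∀ y, 1 ≤ w y) (s : ℝ) :
    ContDiff ℝ 1 fun y => w y ^ s := by
  rw [contDiff_iff_contDiffAt]
  intro y
  have hy : w y ≠ 0 := (lt_of_lt_of_le one_pos (hw1 y)).ne'
  exact (Real.contDiffAt_rpow_const_of_ne (p := s) (n := 1) hy).comp y hw.contDiffAt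

/-- `D(w^s) = s w^{s−1} Dw` for `w ≥ 1`. [cite: Moser1961Harnack, Theorem 1, proof (reverse Hölder step)] -/
theorem fderiv_rpow_of_one_le (hw : ContDiff ℝ 1 w) (hw1 : ∀ y, 1 ≤ w y) (s : ℝ) (y : EuclideanSpace ℝ (Fin n)) :
    fderiv ℝ (fun y => w y ^ s) y = (s * w y ^ (s - 1)) • fderiv ℝ w y := by
  have hy : w y ≠ 0 := (lt_of_lt_of_le one_pos (hw1 y)).ne'
  have h := ((Real.hasDerivAt_rpow_const (p := s) (Or.inl hy))).comp_hasFDerivAt y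
    ((hw.differentiable one_ne_zero) y).hasFDerivAt
  rw [show (fun y => w y ^ s) = (fun x : ℝ => x ^ s) ∘ w from rfl, h.fderiv]

/-- `‖D(w^{q/2})‖² = (q/2)² w^{q−2} ‖Dw‖²` for `w ≥ 1`.
[cite: Moser1961Harnack, Theorem 1, proof (reverse Hölder step)] -/
theorem norm_fderiv_rpow_half_sq (hw : ContDiff ℝ 1 w) (hw1 : ∀ y, 1 ≤ w y) (q : ℝ) (y : EuclideanSpace ℝ (Fin n)) :
    ‖fderiv ℝ (fun y => w y ^ (q / 2)) y‖ ^ 2 = (q / 2) ^ 2 * w y ^ (q - 2) * ‖fderiv ℝ w y‖ ^ 2 := by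
  have hpos : 0 < w y := lt_of_lt_of_le one_pos (hw1 y)
  rw [fderiv_rpow_of_one_le hw hw1, norm_smul, mul_pow, Real.norm_eq_abs, sq_abs, mul_pow]
  have h : (w y ^ (q / 2 - 1)) ^ 2 = w y ^ (q - 2) := by
    rw [← Real.rpow_natCast, ← Real.rpow_mul hpos.le]; congr 1; push_cast; ring
  rw [h]

/-! ### The gradient of `w^{q/2}`: energy estimate -/

variable {a : EuclideanSpace ℝ (Fin n) → Matrix (Fin n) (Fin n) ℝ} {lam Λ : ℝ}

/-- **Energy estimate for powers** (Moser 1961 (4.5)): for an entire `C¹` weak solution `w ≥ 1`, `q ∉ {0,1}` and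
`χ ∈ C¹_c`: `λ ∫ χ² ‖D(w^{q/2})‖² ≤ (q/(q−1))² · nΛ · ∫ w^q ‖Dχ‖²`.
[cite: Moser1961Harnack, Theorem 1, proof (reverse Hölder step)] -/
theorem gradPow_estimate (hsymm : ∀ y, (a y).IsSymm) (hlam : 0 < lam)
    (hmeas : ∀ i j, Measurable fun y => a y i j)
    (hell : ∀ y (ξ : Fin n → ℝ), lam * (ξ ⬝ᵥ ξ) ≤ ξ ⬝ᵥ (a y *ᵥ ξ)) (hbd : ∀ y i j, |a y i j| ≤ Λ)
    (hw : ContDiff ℝ 1 w) (hw1 : ∀ y, 1 ≤ w y)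
    (hweak : ∀ η : EuclideanSpace ℝ (Fin n) → ℝ, ContDiff ℝ 1 η → HasCompactSupport η →
      ∫ y, ∑ i, ∑ j, a y i j * fderiv ℝ w y (EuclideanSpace.single i 1) *
        fderiv ℝ η y (EuclideanSpace.single j 1) = 0)
    {q : ℝ} (hq0 : q ≠ 0) (hq1 : q ≠ 1)
    {χ : EuclideanSpace ℝ (Fin n) → ℝ} (hχ : ContDiff ℝ 1 χ) (hχc : HasCompactSupport χ) :
    lam * ∫ y, χ y ^ 2 * ‖fderiv ℝ (fun y => w y ^ (q / 2)) y‖ ^ 2 ≤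
      (q / (q - 1)) ^ 2 * (n * Λ) * ∫ y, w y ^ q * ‖fderiv ℝ χ y‖ ^ 2 := by
  have hpos : ∀ y, 0 < w y := fun y => lt_of_lt_of_le one_pos (hw1 y)
  have hβ : q - 1 ≠ 0 := sub_ne_zero.2 hq1
  have hC := caccioppoli_rpow hsymm hlam hmeas hell hbd hw hw1 hweak hβ hχ hχc
  simp only [sub_add_cancel] at hC
  have hcw := continuous_fderiv_single hw
  have hcχ := continuous_fderiv_single hχ
  -- continuity of the weights
  have hwq : ∀ s : ℝ, Continuous fun y => w y ^ s := fun s => (contDiff_rpow_of_one_le hw hw1 s).continuous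
  have hnw : Continuous fun y => ‖fderiv ℝ w y‖ ^ 2 := ((hw.continuous_fderiv one_ne_zero).norm).pow 2
  have hnχ : Continuous fun y => ‖fderiv ℝ χ y‖ ^ 2 := ((hχ.continuous_fderiv one_ne_zero).norm).pow 2
  -- (1) left side: `λ χ² ‖D(w^{q/2})‖² = (q/2)² χ² w^{q−2} · λ‖Dw‖² ≤ (q/2)² χ² w^{(q−1)−1} Q(Dw)`
  have hgC : ContDiff ℝ 1 fun y => w y ^ (q / 2) := contDiff_rpow_of_one_le hw hw1 (q / 2)
  have hng : Continuous fun y => ‖fderiv ℝ (fun y => w y ^ (q / 2)) y‖ ^ 2 :=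
    ((hgC.continuous_fderiv one_ne_zero).norm).pow 2
  have hsuppχ2 : HasCompactSupport fun y => χ y ^ 2 := hχc.comp_left (g := fun s : ℝ => s ^ 2) (by simp)
  have hsuppL : HasCompactSupport fun y => χ y ^ 2 * ‖fderiv ℝ (fun y => w y ^ (q / 2)) y‖ ^ 2 :=
    hsuppχ2.mul_right (f' := fun y => ‖fderiv ℝ (fun y => w y ^ (q / 2)) y‖ ^ 2)
  have hL_int : Integrable fun y => χ y ^ 2 * ‖fderiv ℝ (fun y => w y ^ (q / 2)) y‖ ^ 2 :=
    ((hχ.continuous.pow 2).mul hng).integrable_of_hasCompactSupport hsuppL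
  have hQ_int : Integrable fun y => χ y ^ 2 * w y ^ (q - 1 - 1) *
      ((fun i => fderiv ℝ w y (EuclideanSpace.single i 1)) ⬝ᵥ
        (a y *ᵥ fun i => fderiv ℝ w y (EuclideanSpace.single i 1))) := by
    have h' := integrable_mul_of_le_continuous (n := n)
      (m := fun y => (fun i => fderiv ℝ w y (EuclideanSpace.single i 1)) ⬝ᵥ
        (a y *ᵥ fun i => fderiv ℝ w y (EuclideanSpace.single i 1)))
      (M := fun y => n * Λ * (∑ i, fderiv ℝ w y (EuclideanSpace.single i 1) ^ 2 +
        ∑ j, fderiv ℝ w y (EuclideanSpace.single j 1) ^ 2) / 2)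
      (φ := fun y => χ y ^ 2 * w y ^ (q - 1 - 1))
      (measurable_dotProduct_mulVec hmeas hcw hcw) (by fun_prop)
      (fun y => abs_dotProduct_mulVec_le hsymm hlam hell hbd y _ _) ((hχ.continuous.pow 2).mul (hwq _))
      (hasCompactSupport_testFun (u := w) (g := fun s => s ^ (q - 1 - 1)) hχc)
    exact h'.congr (Eventually.of_forall fun y => by ring)
  have hL : lam * ∫ y, χ y ^ 2 * ‖fderiv ℝ (fun y => w y ^ (q / 2)) y‖ ^ 2 ≤
      (q / 2) ^ 2 * ∫ y, χ y ^ 2 * w y ^ (q - 1 - 1) *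
        ((fun i => fderiv ℝ w y (EuclideanSpace.single i 1)) ⬝ᵥ
          (a y *ᵥ fun i => fderiv ℝ w y (EuclideanSpace.single i 1))) := by
    rw [← integral_const_mul, ← integral_const_mul]
    refine integral_mono (hL_int.const_mul lam) (hQ_int.const_mul _) fun y => ?_
    have hq := quadForm_lower hell y (fun i => fderiv ℝ w y (EuclideanSpace.single i 1))
    rw [sum_fderiv_single_sq] at hq
    rw [norm_fderiv_rpow_half_sq hw hw1 q y, show q - 1 - 1 = q - 2 by ring]
    have hw0 : 0 ≤ χ y ^ 2 * w y ^ (q - 2) * (q / 2) ^ 2 :=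
      mul_nonneg (mul_nonneg (sq_nonneg _) (Real.rpow_nonneg (hpos y).le _)) (sq_nonneg _)
    have hm := mul_le_mul_of_nonneg_left hq hw0
    calc lam * (χ y ^ 2 * ((q / 2) ^ 2 * w y ^ (q - 2) * ‖fderiv ℝ w y‖ ^ 2))
        = χ y ^ 2 * w y ^ (q - 2) * (q / 2) ^ 2 * (lam * ‖fderiv ℝ w y‖ ^ 2) := by ring
      _ ≤ χ y ^ 2 * w y ^ (q - 2) * (q / 2) ^ 2 *
          ((fun i => fderiv ℝ w y (EuclideanSpace.single i 1)) ⬝ᵥ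
            (a y *ᵥ fun i => fderiv ℝ w y (EuclideanSpace.single i 1))) := hm
      _ = (q / 2) ^ 2 * (χ y ^ 2 * w y ^ (q - 2) *
          ((fun i => fderiv ℝ w y (EuclideanSpace.single i 1)) ⬝ᵥ
            (a y *ᵥ fun i => fderiv ℝ w y (EuclideanSpace.single i 1)))) := by ring
  -- (2) right side: `Q(Dχ) ≤ nΛ ‖Dχ‖²`
  have hR_int : Integrable fun y => w y ^ q * ‖fderiv ℝ χ y‖ ^ 2 := by
    refine ((hwq q).mul hnχ).integrable_of_hasCompactSupport ?_
    exact ((hχc.fderiv (𝕜 := ℝ)).norm.comp_left (g := fun s : ℝ => s ^ 2) (by simp)).mul_left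
  have hRq_int : Integrable fun y => w y ^ q *
      ((fun j => fderiv ℝ χ y (EuclideanSpace.single j 1)) ⬝ᵥ
        (a y *ᵥ fun j => fderiv ℝ χ y (EuclideanSpace.single j 1))) := by
    refine (hR_int.const_mul (n * Λ)).mono'
      ((hwq q).aestronglyMeasurable.mul (measurable_dotProduct_mulVec hmeas hcχ hcχ).aestronglyMeasurable)
      (Eventually.of_forall fun y => ?_)
    have hq0' : 0 ≤ ((fun j => fderiv ℝ χ y (EuclideanSpace.single j 1)) ⬝ᵥ
        (a y *ᵥ fun j => fderiv ℝ χ y (EuclideanSpace.single j 1))) :=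
      (mul_nonneg hlam.le (Finset.sum_nonneg fun i _ => sq_nonneg _)).trans (quadForm_lower hell y _)
    have hup := quadForm_upper hbd y (fun j => fderiv ℝ χ y (EuclideanSpace.single j 1))
    rw [sum_fderiv_single_sq] at hup
    rw [Real.norm_eq_abs, abs_of_nonneg (mul_nonneg (Real.rpow_nonneg (hpos y).le _) hq0')]
    calc w y ^ q * ((fun j => fderiv ℝ χ y (EuclideanSpace.single j 1)) ⬝ᵥ
          (a y *ᵥ fun j => fderiv ℝ χ y (EuclideanSpace.single j 1)))
        ≤ w y ^ q * (n * Λ * ‖fderiv ℝ χ y‖ ^ 2) := mul_le_mul_of_nonneg_left hup (Real.rpow_nonneg (hpos y).le _)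
      _ = n * Λ * (w y ^ q * ‖fderiv ℝ χ y‖ ^ 2) := by ring
  have hR : ∫ y, w y ^ q * ((fun j => fderiv ℝ χ y (EuclideanSpace.single j 1)) ⬝ᵥ
        (a y *ᵥ fun j => fderiv ℝ χ y (EuclideanSpace.single j 1))) ≤
      n * Λ * ∫ y, w y ^ q * ‖fderiv ℝ χ y‖ ^ 2 := by
    rw [← integral_const_mul]
    refine integral_mono hRq_int (hR_int.const_mul _) fun y => ?_
    have hup := quadForm_upper hbd y (fun j => fderiv ℝ χ y (EuclideanSpace.single j 1))
    rw [sum_fderiv_single_sq] at hup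
    calc w y ^ q * ((fun j => fderiv ℝ χ y (EuclideanSpace.single j 1)) ⬝ᵥ
          (a y *ᵥ fun j => fderiv ℝ χ y (EuclideanSpace.single j 1)))
        ≤ w y ^ q * (n * Λ * ‖fderiv ℝ χ y‖ ^ 2) := mul_le_mul_of_nonneg_left hup (Real.rpow_nonneg (hpos y).le _)
      _ = n * Λ * (w y ^ q * ‖fderiv ℝ χ y‖ ^ 2) := by ring
  -- assemble: `λ∫χ²‖Dg‖² ≤ (q/2)² · (4/(q−1)²) ∫ w^q Q(Dχ) ≤ (q/(q−1))² nΛ ∫ w^q ‖Dχ‖²`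
  have hq2 : 0 ≤ (q / 2) ^ 2 := sq_nonneg _
  calc lam * ∫ y, χ y ^ 2 * ‖fderiv ℝ (fun y => w y ^ (q / 2)) y‖ ^ 2
      ≤ (q / 2) ^ 2 * ∫ y, χ y ^ 2 * w y ^ (q - 1 - 1) *
          ((fun i => fderiv ℝ w y (EuclideanSpace.single i 1)) ⬝ᵥ
            (a y *ᵥ fun i => fderiv ℝ w y (EuclideanSpace.single i 1))) := hL
    _ ≤ (q / 2) ^ 2 * (4 / (q - 1) ^ 2 * ∫ y, w y ^ q *
          ((fun j => fderiv ℝ χ y (EuclideanSpace.single j 1)) ⬝ᵥ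
            (a y *ᵥ fun j => fderiv ℝ χ y (EuclideanSpace.single j 1)))) :=
        mul_le_mul_of_nonneg_left hC hq2
    _ ≤ (q / 2) ^ 2 * (4 / (q - 1) ^ 2 * (n * Λ * ∫ y, w y ^ q * ‖fderiv ℝ χ y‖ ^ 2)) :=
        mul_le_mul_of_nonneg_left (mul_le_mul_of_nonneg_left hR (by positivity)) hq2
    _ = (q / (q - 1)) ^ 2 * (n * Λ) * ∫ y, w y ^ q * ‖fderiv ℝ χ y‖ ^ 2 := by
        field_simp
        ring

/-! ### The test function `φ = χ w^{q/2}` -/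

/-- `‖D(χ g)‖² ≤ 2 (χ² ‖Dg‖² + g² ‖Dχ‖²)`. [cite: Moser1961Harnack, Theorem 1, proof (reverse Hölder step)] -/
theorem norm_fderiv_mul_sq_le {χ g : EuclideanSpace ℝ (Fin n) → ℝ} (hχ : ContDiff ℝ 1 χ) (hg : ContDiff ℝ 1 g)
    (y : EuclideanSpace ℝ (Fin n)) :
    ‖fderiv ℝ (fun y => χ y * g y) y‖ ^ 2 ≤ 2 * (χ y ^ 2 * ‖fderiv ℝ g y‖ ^ 2 + g y ^ 2 * ‖fderiv ℝ χ y‖ ^ 2) := by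
  have hχd : DifferentiableAt ℝ χ y := (hχ.differentiable one_ne_zero) y
  have hgd : DifferentiableAt ℝ g y := (hg.differentiable one_ne_zero) y
  rw [fderiv_fun_mul hχd hgd]
  have h1 : ‖χ y • fderiv ℝ g y + g y • fderiv ℝ χ y‖ ≤ |χ y| * ‖fderiv ℝ g y‖ + |g y| * ‖fderiv ℝ χ y‖ := by
    refine (norm_add_le _ _).trans (le_of_eq ?_)
    rw [norm_smul, norm_smul, Real.norm_eq_abs, Real.norm_eq_abs]
  have h0 : 0 ≤ |χ y| * ‖fderiv ℝ g y‖ + |g y| * ‖fderiv ℝ χ y‖ := by positivity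
  calc ‖χ y • fderiv ℝ g y + g y • fderiv ℝ χ y‖ ^ 2
      ≤ (|χ y| * ‖fderiv ℝ g y‖ + |g y| * ‖fderiv ℝ χ y‖) ^ 2 := pow_le_pow_left₀ (norm_nonneg _) h1 2
    _ ≤ 2 * (χ y ^ 2 * ‖fderiv ℝ g y‖ ^ 2 + g y ^ 2 * ‖fderiv ℝ χ y‖ ^ 2) := by
        rw [← sq_abs (χ y), ← sq_abs (g y)]
        nlinarith [sq_nonneg (|χ y| * ‖fderiv ℝ g y‖ - |g y| * ‖fderiv ℝ χ y‖)]

/-- **Energy of the Moser test function.**  For an entire `C¹` weak solution `w ≥ 1`, `q ∉ {0,1}`, and a two-radius cutoff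
`χ` of `B(x₀,ρ') ⊂ B(x₀,ρ)` with `‖Dχ‖ ≤ C₀/(ρ−ρ')` and `χ = 0` off `B(x₀,ρ)`:
`λ ∫ ‖D(χ w^{q/2})‖² ≤ 2 ((q/(q−1))² nΛ + λ) (C₀/(ρ−ρ'))² ∫_{B̄(x₀,ρ)} w^q`.
[cite: Moser1961Harnack, Theorem 1, proof (reverse Hölder step)] -/
theorem energy_testPow_le (hsymm : ∀ y, (a y).IsSymm) (hlam : 0 < lam)
    (hmeas : ∀ i j, Measurable fun y => a y i j)
    (hell : ∀ y (ξ : Fin n → ℝ), lam * (ξ ⬝ᵥ ξ) ≤ ξ ⬝ᵥ (a y *ᵥ ξ)) (hbd : ∀ y i j, |a y i j| ≤ Λ)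
    (hw : ContDiff ℝ 1 w) (hw1 : ∀ y, 1 ≤ w y)
    (hweak : ∀ η : EuclideanSpace ℝ (Fin n) → ℝ, ContDiff ℝ 1 η → HasCompactSupport η →
      ∫ y, ∑ i, ∑ j, a y i j * fderiv ℝ w y (EuclideanSpace.single i 1) *
        fderiv ℝ η y (EuclideanSpace.single j 1) = 0)
    {q : ℝ} (hq0 : q ≠ 0) (hq1 : q ≠ 1) {x₀ : EuclideanSpace ℝ (Fin n)} {ρ' ρ C₀ : ℝ}
    {χ : EuclideanSpace ℝ (Fin n) → ℝ} (hχ : ContDiff ℝ 1 χ) (hχc : HasCompactSupport χ)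
    (hχ0 : ∀ x, x ∉ ball x₀ ρ → χ x = 0) (hχD : ∀ x, ‖fderiv ℝ χ x‖ ≤ C₀ / (ρ - ρ')) :
    lam * ∫ y, ‖fderiv ℝ (fun y => χ y * w y ^ (q / 2)) y‖ ^ 2 ≤
      2 * ((q / (q - 1)) ^ 2 * (n * Λ) + lam) * (C₀ / (ρ - ρ')) ^ 2 * ∫ y in closedBall x₀ ρ, w y ^ q := by
  have hpos : ∀ y, 0 < w y := fun y => lt_of_lt_of_le one_pos (hw1 y)
  have hG := gradPow_estimate hsymm hlam hmeas hell hbd hw hw1 hweak hq0 hq1 hχ hχc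
  have hgC : ContDiff ℝ 1 fun y => w y ^ (q / 2) := contDiff_rpow_of_one_le hw hw1 (q / 2)
  have hwq : ∀ s : ℝ, Continuous fun y => w y ^ s := fun s => (contDiff_rpow_of_one_le hw hw1 s).continuous
  have hng : Continuous fun y => ‖fderiv ℝ (fun y => w y ^ (q / 2)) y‖ ^ 2 :=
    ((hgC.continuous_fderiv one_ne_zero).norm).pow 2
  have hnχ : Continuous fun y => ‖fderiv ℝ χ y‖ ^ 2 := ((hχ.continuous_fderiv one_ne_zero).norm).pow 2
  have hg2 : ∀ y, (w y ^ (q / 2)) ^ 2 = w y ^ q := fun y => by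
    rw [← Real.rpow_natCast, ← Real.rpow_mul (hpos y).le]; congr 1; push_cast; ring
  -- compact supports
  have hsuppχ2 : HasCompactSupport fun y => χ y ^ 2 := hχc.comp_left (g := fun s : ℝ => s ^ 2) (by simp)
  have hsuppDχ : HasCompactSupport fun y => ‖fderiv ℝ χ y‖ ^ 2 :=
    (hχc.fderiv (𝕜 := ℝ)).norm.comp_left (g := fun s : ℝ => s ^ 2) (by simp)
  have hsuppφ : HasCompactSupport fun y => χ y * w y ^ (q / 2) := hχc.mul_right (f' := fun y => w y ^ (q / 2))
  -- integrability
  have hI1 : Integrable fun y => χ y ^ 2 * ‖fderiv ℝ (fun y => w y ^ (q / 2)) y‖ ^ 2 :=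
    ((hχ.continuous.pow 2).mul hng).integrable_of_hasCompactSupport
      (hsuppχ2.mul_right (f' := fun y => ‖fderiv ℝ (fun y => w y ^ (q / 2)) y‖ ^ 2))
  have hI2 : Integrable fun y => w y ^ q * ‖fderiv ℝ χ y‖ ^ 2 :=
    ((hwq q).mul hnχ).integrable_of_hasCompactSupport (hsuppDχ.mul_left (f := fun y => w y ^ q))
  have hφC : ContDiff ℝ 1 fun y => χ y * w y ^ (q / 2) := hχ.mul hgC
  have hnφ : Continuous fun y => ‖fderiv ℝ (fun y => χ y * w y ^ (q / 2)) y‖ ^ 2 :=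
    ((hφC.continuous_fderiv one_ne_zero).norm).pow 2
  have hsuppDφ0 : HasCompactSupport (fderiv ℝ fun y => χ y * w y ^ (q / 2)) := hsuppφ.fderiv (𝕜 := ℝ)
  have hsuppDφ : HasCompactSupport fun y => ‖fderiv ℝ (fun y => χ y * w y ^ (q / 2)) y‖ ^ 2 := by
    refine hsuppDφ0.norm.mono (Function.support_subset_iff'.2 fun y hy => ?_)
    simp only [Function.mem_support, not_not] at hy
    simp [hy]
  have hIφ : Integrable fun y => ‖fderiv ℝ (fun y => χ y * w y ^ (q / 2)) y‖ ^ 2 :=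
    hnφ.integrable_of_hasCompactSupport hsuppDφ
  -- (1) `∫ ‖Dφ‖² ≤ 2 ∫ χ²‖Dg‖² + 2 ∫ w^q ‖Dχ‖²`
  have h1 : ∫ y, ‖fderiv ℝ (fun y => χ y * w y ^ (q / 2)) y‖ ^ 2 ≤
      2 * (∫ y, χ y ^ 2 * ‖fderiv ℝ (fun y => w y ^ (q / 2)) y‖ ^ 2) + 2 * (∫ y, w y ^ q * ‖fderiv ℝ χ y‖ ^ 2) := by
    rw [← integral_const_mul, ← integral_const_mul, ← integral_add (hI1.const_mul 2) (hI2.const_mul 2)]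
    refine integral_mono hIφ ((hI1.const_mul 2).add (hI2.const_mul 2)) fun y => ?_
    have h := norm_fderiv_mul_sq_le hχ hgC y
    rw [hg2 y] at h
    simp only
    linarith
  -- (2) `∫ w^q ‖Dχ‖² ≤ (C₀/(ρ−ρ'))² ∫_{B̄(x₀,ρ)} w^q`
  have hDχ_out : ∀ x, x ∉ closedBall x₀ ρ → fderiv ℝ χ x = 0 := by
    intro x hx
    have hev : χ =ᶠ[𝓝 x] fun _ => 0 := by
      filter_upwards [isClosed_closedBall.isOpen_compl.mem_nhds hx] with z hz
      exact hχ0 z fun hz' => hz (ball_subset_closedBall hz')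
    rw [hev.fderiv_eq, fderiv_const_apply]
  have h2 : ∫ y, w y ^ q * ‖fderiv ℝ χ y‖ ^ 2 ≤ (C₀ / (ρ - ρ')) ^ 2 * ∫ y in closedBall x₀ ρ, w y ^ q := by
    have heq : ∫ y, w y ^ q * ‖fderiv ℝ χ y‖ ^ 2 = ∫ y in closedBall x₀ ρ, w y ^ q * ‖fderiv ℝ χ y‖ ^ 2 := by
      refine (setIntegral_eq_integral_of_forall_compl_eq_zero fun y hy => ?_).symm
      rw [hDχ_out y hy, norm_zero, zero_pow two_ne_zero, mul_zero]
    rw [heq, ← integral_const_mul]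
    have hIw : IntegrableOn (fun y => w y ^ q) (closedBall x₀ ρ) :=
      (hwq q).continuousOn.integrableOn_compact (isCompact_closedBall _ _)
    refine setIntegral_mono_on hI2.integrableOn (hIw.const_mul _) measurableSet_closedBall fun y _ => ?_
    have hwq0 : 0 ≤ w y ^ q := Real.rpow_nonneg (hpos y).le _
    calc w y ^ q * ‖fderiv ℝ χ y‖ ^ 2 ≤ w y ^ q * (C₀ / (ρ - ρ')) ^ 2 :=
          mul_le_mul_of_nonneg_left (pow_le_pow_left₀ (norm_nonneg _) (hχD y) 2) hwq0
      _ = (C₀ / (ρ - ρ')) ^ 2 * w y ^ q := mul_comm _ _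
  -- assemble
  have hI0 : 0 ≤ ∫ y in closedBall x₀ ρ, w y ^ q :=
    setIntegral_nonneg measurableSet_closedBall fun y _ => Real.rpow_nonneg (hpos y).le _
  have hnΛq : 0 ≤ (q / (q - 1)) ^ 2 * (n * Λ) := by
    rcases Nat.eq_zero_or_pos n with hn | hn
    · simp [hn]
    · exact mul_nonneg (sq_nonneg _) (mul_nonneg (Nat.cast_nonneg n) ((abs_nonneg _).trans (hbd x₀ ⟨0, hn⟩ ⟨0, hn⟩)))
  calc lam * ∫ y, ‖fderiv ℝ (fun y => χ y * w y ^ (q / 2)) y‖ ^ 2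
      ≤ lam * (2 * (∫ y, χ y ^ 2 * ‖fderiv ℝ (fun y => w y ^ (q / 2)) y‖ ^ 2) +
          2 * (∫ y, w y ^ q * ‖fderiv ℝ χ y‖ ^ 2)) := mul_le_mul_of_nonneg_left h1 hlam.le
    _ = 2 * (lam * ∫ y, χ y ^ 2 * ‖fderiv ℝ (fun y => w y ^ (q / 2)) y‖ ^ 2) +
          2 * lam * (∫ y, w y ^ q * ‖fderiv ℝ χ y‖ ^ 2) := by ring
    _ ≤ 2 * ((q / (q - 1)) ^ 2 * (n * Λ) * ∫ y, w y ^ q * ‖fderiv ℝ χ y‖ ^ 2) +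
          2 * lam * (∫ y, w y ^ q * ‖fderiv ℝ χ y‖ ^ 2) := by
        have := mul_le_mul_of_nonneg_left hG (by norm_num : (0 : ℝ) ≤ 2)
        linarith
    _ = 2 * ((q / (q - 1)) ^ 2 * (n * Λ) + lam) * ∫ y, w y ^ q * ‖fderiv ℝ χ y‖ ^ 2 := by ring
    _ ≤ 2 * ((q / (q - 1)) ^ 2 * (n * Λ) + lam) * ((C₀ / (ρ - ρ')) ^ 2 * ∫ y in closedBall x₀ ρ, w y ^ q) :=
        mul_le_mul_of_nonneg_left h2 (by positivity)
    _ = 2 * ((q / (q - 1)) ^ 2 * (n * Λ) + lam) * (C₀ / (ρ - ρ')) ^ 2 * ∫ y in closedBall x₀ ρ, w y ^ q := by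
        ring

end Literature.Analysis.PDE.DivForm.ReverseHolder

end

end Part3

/-!
## Part 4 — port of `Summits/NavierStokesRegularity/NavierStokesRegularity/Theorems/PoloidalWindowDoorPoloidalWindowRigidityDivFormMoserStep.lean`

# Route `PoloidalWindowDoor`, crux K2 (stmt-NavierStokesRegularity-19708) — task H5, step M3b: Moser's REVERSE HÖLDER STEP
# in `eLpNorm` form for `div(a∇u) = 0`, `n ≥ 3` (towards `divFormLiouville_holds`, De Giorgi–Nash–Moser)

Seat ns-poloidal-K2-p3 g2 (`ledger fact claim` #1 on `Literature.Analysis.PDE.divFormLiouville`; setting = that fact's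
rendering, `w ≥ 1` an entire `C¹` weak solution).  Moser 1961 §4 / Gilbarg–Trudinger Thm 8.18: the energy bound of M3a
(`energy_testPow_le`) and the Gagliardo–Nirenberg–Sobolev inequality (Mathlib `eLpNorm_le_eLpNorm_fderiv_of_eq_inner`, `p = 2`,
`2* = 2n/(n−2)`) give, for `f = w^σ` (`σ = ±1`), `p > 0` with `σp ≠ 1`, concentric closed balls `B̄(x₀,ρ') ⊂ B̄(x₀,ρ)` and
`κ = n/(n−2)`:
`‖f‖_{L^{pκ}(B̄(x₀,ρ'))} ≤ (C_S² M)^{1/p} ‖f‖_{L^p(B̄(x₀,ρ))}`, `M = 2((q/(q−1))²nΛ + λ)/λ · (C₀/(ρ−ρ'))²`, `q = σp`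
— exactly the hypothesis shape of the tree's `Literature.Analysis.FunctionSpaces.eLpNorm_top_le_of_moser_chain`.

* `exists_closedBall_cutoff` — two-radius cutoffs equal to `1` on the CLOSED inner ball;
* `eLpNorm_rpow_eq` — `‖w^s‖_{L^r} = (∫⁻ w^{sr})^{1/r}` for `w > 0`;
* `moser_step` — the displayed reverse Hölder inequality.

WHAT THIS IS NOT: not yet the Liouville theorem (M3c chain, M4 Harnack ⇒ Liouville to come); nothing NS-specific.
-/

section Part4

noncomputable section

open _root_.MeasureTheory _root_.Set _root_.Function _root_.Filter _root_.Topology _root_.Metric _root_.Module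
open scoped _root_.Matrix _root_.ENNReal _root_.NNReal

namespace Literature.Analysis.PDE.DivForm.MoserStep

open Literature.Analysis.PDE.DivForm.Caccioppoli
open Literature.Analysis.PDE.DivForm.ReverseHolder
open Literature.Analysis.FunctionSpaces

variable {n : ℕ}

/-! ### Cutoffs equal to one on a closed ball -/

/-- **Two-radius cutoffs, closed inner ball.**  There is `C₀ ≥ 0` such that for all `x₀` and `0 < ρ' < ρ` there is
`χ ∈ C¹_c(ℝⁿ)`, `0 ≤ χ ≤ 1`, `χ = 1` on `B̄(x₀,ρ')`, `χ = 0` off `B(x₀,ρ)`, `‖Dχ‖ ≤ C₀/(ρ − ρ')`.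
[cite: Moser1961Harnack, Theorem 1, proof (one Moser iteration step)] -/
theorem exists_closedBall_cutoff (n : ℕ) : ∃ C₀ : ℝ, 0 ≤ C₀ ∧ ∀ (x₀ : EuclideanSpace ℝ (Fin n)) (ρ' ρ : ℝ),
    0 < ρ' → ρ' < ρ →
    ∃ χ : EuclideanSpace ℝ (Fin n) → ℝ, ContDiff ℝ 1 χ ∧ HasCompactSupport χ ∧ (∀ x, 0 ≤ χ x ∧ χ x ≤ 1) ∧
      (∀ x ∈ closedBall x₀ ρ', χ x = 1) ∧ (∀ x, x ∉ ball x₀ ρ → χ x = 0) ∧ ∀ x, ‖fderiv ℝ χ x‖ ≤ C₀ / (ρ - ρ') := by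
  obtain ⟨C, hC0, hC⟩ := exists_smooth_cutoff (volume : Measure (EuclideanSpace ℝ (Fin n)))
  refine ⟨2 * C, by positivity, fun x₀ ρ' ρ hρ' hρ => ?_⟩
  have hδ : 0 < (ρ - ρ') / 2 := by linarith
  obtain ⟨χ, hχs, hχ01, hχ1, hχ0, hχD⟩ := hC (ball x₀ ((ρ + ρ') / 2)) measurableSet_ball ((ρ - ρ') / 2) hδ
  have hzero : ∀ x, x ∉ ball x₀ ρ → χ x = 0 := by
    intro x hx
    refine hχ0 x (Metric.ball_disjoint_ball ?_)
    rw [mem_ball, not_lt] at hx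
    linarith
  refine ⟨χ, hχs.of_le (by norm_cast), ?_, hχ01, fun x hx => hχ1 x ?_, hzero,
    fun x => (hχD x).trans_eq (by field_simp)⟩
  · refine HasCompactSupport.intro (isCompact_closedBall x₀ ρ) fun x hx => hzero x fun hx' => hx ?_
    exact ball_subset_closedBall hx'
  · rw [mem_closedBall] at hx
    intro z hz
    rw [mem_ball] at hz ⊢
    calc dist z x₀ ≤ dist z x + dist x x₀ := dist_triangle _ _ _
      _ < (ρ - ρ') / 2 + ρ' := by linarith
      _ = (ρ + ρ') / 2 := by ring

/-! ### `eLpNorm` of powers -/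

/-- `‖w^s‖_{L^r(μ)} = (∫⁻ w^{sr} dμ)^{1/r}` for `w > 0`, `r > 0`.
[cite: Moser1961Harnack, Theorem 1, proof (one Moser iteration step)] -/
theorem eLpNorm_rpow_eq {α : Type*} [MeasurableSpace α] (μ : Measure α) {w : α → ℝ} (hw : ∀ x, 0 < w x) (s : ℝ)
    {r : ℝ} (hr : 0 < r) :
    eLpNorm (fun x => w x ^ s) (ENNReal.ofReal r) μ = (∫⁻ x, ENNReal.ofReal (w x ^ (s * r)) ∂μ) ^ (1 / r) := by
  rw [eLpNorm_eq_lintegral_rpow_enorm_toReal (ENNReal.ofReal_pos.2 hr).ne' ENNReal.ofReal_ne_top,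
    ENNReal.toReal_ofReal hr.le]
  congr 1
  refine lintegral_congr fun x => ?_
  rw [Real.enorm_eq_ofReal (Real.rpow_nonneg (hw x).le _),
    ENNReal.ofReal_rpow_of_nonneg (Real.rpow_nonneg (hw x).le _) hr.le, ← Real.rpow_mul (hw x).le]

/-- `∫⁻ ‖Dφ‖ₑ^2 = ofReal (∫ ‖Dφ‖²)` for `φ ∈ C¹_c`.
[cite: Moser1961Harnack, Theorem 1, proof (one Moser iteration step)] -/
theorem lintegral_enorm_fderiv_sq {φ : EuclideanSpace ℝ (Fin n) → ℝ} (hφ : ContDiff ℝ 1 φ) (hφc : HasCompactSupport φ) :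
    ∫⁻ y, ‖fderiv ℝ φ y‖ₑ ^ (2 : ℝ) = ENNReal.ofReal (∫ y, ‖fderiv ℝ φ y‖ ^ 2) := by
  have hc : Continuous fun y => ‖fderiv ℝ φ y‖ ^ 2 := ((hφ.continuous_fderiv one_ne_zero).norm).pow 2
  have hs0 : HasCompactSupport (fderiv ℝ φ) := hφc.fderiv (𝕜 := ℝ)
  have hs : HasCompactSupport fun y => ‖fderiv ℝ φ y‖ ^ 2 := by
    refine hs0.norm.mono (Function.support_subset_iff'.2 fun y hy => ?_)
    simp only [Function.mem_support, not_not] at hy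
    simp [hy]
  have hI : Integrable fun y => ‖fderiv ℝ φ y‖ ^ 2 := hc.integrable_of_hasCompactSupport hs
  rw [ofReal_integral_eq_lintegral_ofReal hI (Eventually.of_forall fun y => by positivity)]
  refine lintegral_congr fun y => ?_
  rw [← ofReal_norm, ENNReal.ofReal_rpow_of_nonneg (norm_nonneg _) (by norm_num : (0:ℝ) ≤ 2)]
  norm_num

variable {a : EuclideanSpace ℝ (Fin n) → Matrix (Fin n) (Fin n) ℝ} {lam Λ : ℝ} {w : EuclideanSpace ℝ (Fin n) → ℝ}

/-- **MOSER'S REVERSE HÖLDER STEP** (Moser 1961 §4; Gilbarg–Trudinger, proof of Thm 8.18), `n ≥ 3`, `κ = n/(n−2)`: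
for an entire `C¹` weak solution `w ≥ 1`, `σ = ±1`, `p > 0` with `σp ≠ 1`, `0 < ρ' < ρ`, and a cutoff constant `C₀`
as in `exists_closedBall_cutoff`,
`‖w^σ‖_{L^{pκ}(B̄(x₀,ρ'))} ≤ (C_S² · 2((q/(q−1))²nΛ+λ)/λ · (C₀/(ρ−ρ'))²)^{1/p} ‖w^σ‖_{L^p(B̄(x₀,ρ))}`, `q = σp`,
`C_S` = Mathlib's Sobolev constant `eLpNormLESNormFDerivOfEqInnerConst volume 2`.
[cite: Moser1961Harnack, Theorem 1, proof (one Moser iteration step)] -/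
theorem moser_step (hn : 3 ≤ n) (hsymm : ∀ y, (a y).IsSymm) (hlam : 0 < lam)
    (hmeas : ∀ i j, Measurable fun y => a y i j)
    (hell : ∀ y (ξ : Fin n → ℝ), lam * (ξ ⬝ᵥ ξ) ≤ ξ ⬝ᵥ (a y *ᵥ ξ)) (hbd : ∀ y i j, |a y i j| ≤ Λ)
    (hw : ContDiff ℝ 1 w) (hw1 : ∀ y, 1 ≤ w y)
    (hweak : ∀ η : EuclideanSpace ℝ (Fin n) → ℝ, ContDiff ℝ 1 η → HasCompactSupport η →
      ∫ y, ∑ i, ∑ j, a y i j * fderiv ℝ w y (EuclideanSpace.single i 1) *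
        fderiv ℝ η y (EuclideanSpace.single j 1) = 0)
    {σ : ℝ} (hσ : σ = 1 ∨ σ = -1) {p : ℝ} (hp : 0 < p) (hq1 : σ * p ≠ 1)
    {C₀ : ℝ} (hcut : ∀ (x₀ : EuclideanSpace ℝ (Fin n)) (ρ' ρ : ℝ), 0 < ρ' → ρ' < ρ →
      ∃ χ : EuclideanSpace ℝ (Fin n) → ℝ, ContDiff ℝ 1 χ ∧ HasCompactSupport χ ∧ (∀ x, 0 ≤ χ x ∧ χ x ≤ 1) ∧
        (∀ x ∈ closedBall x₀ ρ', χ x = 1) ∧ (∀ x, x ∉ ball x₀ ρ → χ x = 0) ∧ ∀ x, ‖fderiv ℝ χ x‖ ≤ C₀ / (ρ - ρ'))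
    (x₀ : EuclideanSpace ℝ (Fin n)) {ρ' ρ : ℝ} (hρ' : 0 < ρ') (hρ : ρ' < ρ) :
    eLpNorm (fun y => w y ^ σ) (ENNReal.ofReal (p * (n / (n - 2 : ℝ)))) (volume.restrict (closedBall x₀ ρ')) ≤
      ENNReal.ofReal ((eLpNormLESNormFDerivOfEqInnerConst (volume : Measure (EuclideanSpace ℝ (Fin n))) 2 : ℝ) ^ 2 *
          (2 * ((σ * p / (σ * p - 1)) ^ 2 * (n * Λ) + lam) / lam * (C₀ / (ρ - ρ')) ^ 2)) ^ (1 / p) *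
        eLpNorm (fun y => w y ^ σ) (ENNReal.ofReal p) (volume.restrict (closedBall x₀ ρ)) := by
  -- notation and positivity
  set q : ℝ := σ * p with hq
  set κ : ℝ := n / (n - 2 : ℝ) with hκ
  set CS : ℝ≥0 := eLpNormLESNormFDerivOfEqInnerConst (volume : Measure (EuclideanSpace ℝ (Fin n))) 2 with hCS
  set M₀ : ℝ := 2 * ((q / (q - 1)) ^ 2 * (n * Λ) + lam) / lam * (C₀ / (ρ - ρ')) ^ 2 with hM₀
  have hn2 : (0 : ℝ) < n - 2 := by
    have : (3 : ℝ) ≤ n := by exact_mod_cast hn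
    linarith
  have hnpos : (0 : ℝ) < n := by linarith
  have hκpos : 0 < κ := by rw [hκ]; positivity
  have hpos : ∀ y, 0 < w y := fun y => lt_of_lt_of_le one_pos (hw1 y)
  have hq0 : q ≠ 0 := by
    rw [hq]; rcases hσ with h | h <;> simp [h, hp.ne']
  have hnΛ : 0 ≤ (n : ℝ) * Λ :=
    mul_nonneg (Nat.cast_nonneg n) ((abs_nonneg _).trans (hbd x₀ ⟨0, by omega⟩ ⟨0, by omega⟩))
  have hM₀nn : 0 ≤ M₀ := by rw [hM₀]; positivity
  -- the cutoff and the test function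
  obtain ⟨χ, hχ, hχc, hχ01, hχ1, hχ0, hχD⟩ := hcut x₀ ρ' ρ hρ' hρ
  have hgC : ContDiff ℝ 1 fun y => w y ^ (q / 2) := contDiff_rpow_of_one_le hw hw1 (q / 2)
  have hφC : ContDiff ℝ 1 fun y => χ y * w y ^ (q / 2) := hχ.mul hgC
  have hφc : HasCompactSupport fun y => χ y * w y ^ (q / 2) := hχc.mul_right (f' := fun y => w y ^ (q / 2))
  -- (E) energy: `λ ∫ ‖Dφ‖² ≤ λ M₀ ∫_{B̄ρ} w^q`
  have hE := energy_testPow_le hsymm hlam hmeas hell hbd hw hw1 hweak hq0 hq1 hχ hχc hχ0 hχD (x₀ := x₀)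
  have hY0 : 0 ≤ ∫ y in closedBall x₀ ρ, w y ^ q :=
    setIntegral_nonneg measurableSet_closedBall fun y _ => Real.rpow_nonneg (hpos y).le _
  have hE' : ∫ y, ‖fderiv ℝ (fun y => χ y * w y ^ (q / 2)) y‖ ^ 2 ≤ M₀ * ∫ y in closedBall x₀ ρ, w y ^ q := by
    rw [← le_div_iff₀' hlam] at hE
    refine hE.trans (le_of_eq ?_)
    rw [hM₀]
    field_simp
  -- (S) Sobolev: `‖φ‖_{2κ} ≤ C_S ‖Dφ‖₂`
  have hfin : finrank ℝ (EuclideanSpace ℝ (Fin n)) = n := finrank_euclideanSpace_fin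
  have hp'inv : ((Real.toNNReal (2 * κ) : ℝ≥0) : ℝ)⁻¹ = (2 : ℝ≥0)⁻¹ - (finrank ℝ (EuclideanSpace ℝ (Fin n)) : ℝ)⁻¹ := by
    rw [Real.coe_toNNReal _ (by positivity), hfin, hκ]
    push_cast
    field_simp
  have hS := eLpNorm_le_eLpNorm_fderiv_of_eq_inner (μ := (volume : Measure (EuclideanSpace ℝ (Fin n)))) hφC hφc
    (p := 2) (p' := Real.toNNReal (2 * κ)) (by norm_num) (by rw [hfin]; omega) hp'inv
  -- (A) `‖Dφ‖₂ ≤ (M₀ · Z)^{1/2}`, `Z = ∫⁻_{B̄ρ} w^q`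
  set Z : ℝ≥0∞ := ∫⁻ y in closedBall x₀ ρ, ENNReal.ofReal (w y ^ q) with hZ
  have hZeq : ENNReal.ofReal (∫ y in closedBall x₀ ρ, w y ^ q) = Z := by
    rw [hZ, ofReal_integral_eq_lintegral_ofReal]
    · exact ((contDiff_rpow_of_one_le hw hw1 q).continuous.continuousOn.integrableOn_compact (isCompact_closedBall _ _))
    · exact Eventually.of_forall fun y => Real.rpow_nonneg (hpos y).le _
  have hA : eLpNorm (fderiv ℝ fun y => χ y * w y ^ (q / 2)) 2 volume ≤ (ENNReal.ofReal M₀ * Z) ^ (1 / 2 : ℝ) := by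
    rw [eLpNorm_eq_lintegral_rpow_enorm_toReal two_ne_zero ENNReal.ofNat_ne_top, ENNReal.toReal_ofNat,
      lintegral_enorm_fderiv_sq hφC hφc]
    refine ENNReal.rpow_le_rpow ?_ (by norm_num)
    rw [← hZeq, ← ENNReal.ofReal_mul hM₀nn]
    exact ENNReal.ofReal_le_ofReal hE'
  -- (B) `X^{1/(2κ)} ≤ ‖φ‖_{2κ}`, `X = ∫⁻_{B̄ρ'} w^{qκ}`
  set X : ℝ≥0∞ := ∫⁻ y in closedBall x₀ ρ', ENNReal.ofReal (w y ^ (q * κ)) with hX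
  have hcoe : ((Real.toNNReal (2 * κ) : ℝ≥0) : ℝ≥0∞) = ENNReal.ofReal (2 * κ) := rfl
  have hB : X ^ (1 / (2 * κ)) ≤ eLpNorm (fun y => χ y * w y ^ (q / 2)) (Real.toNNReal (2 * κ)) volume := by
    have hres : eLpNorm (fun y => χ y * w y ^ (q / 2)) (Real.toNNReal (2 * κ)) (volume.restrict (closedBall x₀ ρ')) ≤
        eLpNorm (fun y => χ y * w y ^ (q / 2)) (Real.toNNReal (2 * κ)) volume :=
      eLpNorm_mono_measure _ Measure.restrict_le_self
    refine le_trans (le_of_eq ?_) hres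
    rw [hcoe, eLpNorm_eq_lintegral_rpow_enorm_toReal (ENNReal.ofReal_pos.2 (by positivity)).ne' ENNReal.ofReal_ne_top,
      ENNReal.toReal_ofReal (by positivity), hX]
    congr 1
    refine setLIntegral_congr_fun measurableSet_closedBall fun y hy => ?_
    rw [hχ1 y hy, one_mul, Real.enorm_eq_ofReal (Real.rpow_nonneg (hpos y).le _),
      ENNReal.ofReal_rpow_of_nonneg (Real.rpow_nonneg (hpos y).le _) (by positivity), ← Real.rpow_mul (hpos y).le]
    congr 2
    ring
  -- (C) combine: `X^{1/(2κ)} ≤ C_S (M₀ Z)^{1/2}`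
  have hC : X ^ (1 / (2 * κ)) ≤ (CS : ℝ≥0∞) * (ENNReal.ofReal M₀ * Z) ^ (1 / 2 : ℝ) :=
    hB.trans (hS.trans (mul_le_mul' le_rfl hA))
  -- (D) raise to the power `2/p` and identify the `eLpNorm`s
  have hD := ENNReal.rpow_le_rpow hC (by positivity : (0 : ℝ) ≤ 2 / p)
  have hL : eLpNorm (fun y => w y ^ σ) (ENNReal.ofReal (p * κ)) (volume.restrict (closedBall x₀ ρ')) =
      (X ^ (1 / (2 * κ))) ^ (2 / p) := by
    rw [eLpNorm_rpow_eq _ hpos σ (by positivity : 0 < p * κ), ← ENNReal.rpow_mul, hX]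
    have h1 : σ * (p * κ) = q * κ := by rw [hq]; ring
    have h2 : 1 / (p * κ) = 1 / (2 * κ) * (2 / p) := by field_simp
    rw [h1, h2]
  have hR : eLpNorm (fun y => w y ^ σ) (ENNReal.ofReal p) (volume.restrict (closedBall x₀ ρ)) = Z ^ (1 / p) := by
    rw [eLpNorm_rpow_eq _ hpos σ hp, hZ]
  have hCS2 : ENNReal.ofReal ((CS : ℝ) ^ 2 * M₀) = (CS : ℝ≥0∞) ^ 2 * ENNReal.ofReal M₀ := by
    rw [ENNReal.ofReal_mul (sq_nonneg _), ENNReal.ofReal_pow (NNReal.coe_nonneg _), ENNReal.ofReal_coe_nnreal]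
  have key : ∀ m z : ℝ≥0∞, ((CS : ℝ≥0∞) * (m * z) ^ (1 / 2 : ℝ)) ^ (2 / p) =
      ((CS : ℝ≥0∞) ^ 2 * m) ^ (1 / p) * z ^ (1 / p) := by
    intro m z
    rw [ENNReal.mul_rpow_of_nonneg _ _ (by positivity : (0 : ℝ) ≤ 2 / p), ← ENNReal.rpow_mul,
      show (1 / 2 : ℝ) * (2 / p) = 1 / p by field_simp,
      ENNReal.mul_rpow_of_nonneg m z (by positivity : (0 : ℝ) ≤ 1 / p),
      ENNReal.mul_rpow_of_nonneg _ m (by positivity : (0 : ℝ) ≤ 1 / p), ← mul_assoc]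
    congr 2
    rw [← ENNReal.rpow_natCast, ← ENNReal.rpow_mul]
    congr 1
    push_cast
    field_simp
  rw [hL, hR, hCS2, ← key]
  exact hD

end Literature.Analysis.PDE.DivForm.MoserStep

end

end Part4

/-!
## Part 5 — port of `Summits/NavierStokesRegularity/NavierStokesRegularity/Theorems/PoloidalWindowDoorPoloidalWindowRigidityDivFormMoserChain.lean`

# Route `PoloidalWindowDoor`, crux K2 (stmt-NavierStokesRegularity-19708) — task H5, step M3c: the MOSER ITERATION for
# positive and negative powers of an entire solution of `div(a∇u) = 0`, `n ≥ 3` (towards `divFormLiouville_holds`)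

Seat ns-poloidal-K2-p3 g2 (`ledger fact claim` #1 on `Literature.Analysis.PDE.divFormLiouville`; setting = that fact's
rendering, `w ≥ 1` an entire `C¹` weak solution).  Moser 1961 §4 / Gilbarg–Trudinger Thm 8.18: the reverse Hölder step
M3b (`…DivFormMoserStep.moser_step`) is chained along the radii `r_k = R(1 + 2^{-k})` (from `2R` down to `R`) and the
exponents `p_k = p₀ κ^k`, `κ = n/(n−2)`, with the tree's `Literature.Analysis.FunctionSpaces.eLpNorm_top_le_of_moser_chain`:
for `f = w^σ`, `σ = ±1`, provided no chain exponent `σ p_k` equals `1` and `(σp_k/(σp_k − 1))² ≤ D` along the chain,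
`‖f‖_{L^∞(B̄(x₀,R))} ≤ (K/R²)^{κ/(p₀(κ−1))} · 4^{κ/(p₀(κ−1)²)} · ‖f‖_{L^{p₀}(B̄(x₀,2R))}`,
`K = max(C_S,1)² · 8 (DnΛ + λ) C₀²/λ` — `κ/(κ−1) = n/2`, so the right side is scale-invariant:
`(K/R²)^{n/(2p₀)} ‖f‖_{L^{p₀}(B̄_{2R})} = K^{n/(2p₀)} (R^{-n} ∫_{B̄_{2R}} f^{p₀})^{1/p₀}`.

* `moser_chain_sup` — the displayed local boundedness of `w^σ` (both signs).

WHAT THIS IS NOT: not yet the Liouville theorem (M4: Harnack ⇒ Liouville, and `n ≤ 2`); nothing NS-specific.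
-/

section Part5

noncomputable section

open _root_.MeasureTheory _root_.Set _root_.Function _root_.Filter _root_.Topology _root_.Metric _root_.Module
open scoped _root_.Matrix _root_.ENNReal _root_.NNReal

namespace Literature.Analysis.PDE.DivForm.MoserChain

open Literature.Analysis.PDE.DivForm.ReverseHolder
open Literature.Analysis.PDE.DivForm.MoserStep
open Literature.Analysis.FunctionSpaces

variable {n : ℕ} {a : EuclideanSpace ℝ (Fin n) → Matrix (Fin n) (Fin n) ℝ} {lam Λ : ℝ}
  {w : EuclideanSpace ℝ (Fin n) → ℝ}

/-- **MOSER ITERATION, local boundedness of `w^σ`** (Moser 1961 §4; Gilbarg–Trudinger Thm 8.18, proof), `n ≥ 3`,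
`κ = n/(n−2)`: for an entire `C¹` weak solution `w ≥ 1`, `σ = ±1`, `p₀ > 0` such that along the chain `p_k = p₀κ^k`
no `σp_k` equals `1` and `(σp_k/(σp_k−1))² ≤ D`, every `x₀` and `R > 0`:
`‖w^σ‖_{L^∞(B̄(x₀,R))} ≤ (K/R²)^{κ/(p₀(κ−1))} 4^{κ/(p₀(κ−1)²)} ‖w^σ‖_{L^{p₀}(B̄(x₀,2R))}`,
`K = max(C_S,1)² · 2(DnΛ + λ)/λ · 4C₀²` (`C_S` Mathlib's Sobolev constant, `C₀` the cutoff constant).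
[cite: Moser1961Harnack, Theorem 1, proof (the iteration chain)] -/
theorem moser_chain_sup (hn : 3 ≤ n) (hsymm : ∀ y, (a y).IsSymm) (hlam : 0 < lam)
    (hmeas : ∀ i j, Measurable fun y => a y i j)
    (hell : ∀ y (ξ : Fin n → ℝ), lam * (ξ ⬝ᵥ ξ) ≤ ξ ⬝ᵥ (a y *ᵥ ξ)) (hbd : ∀ y i j, |a y i j| ≤ Λ)
    (hw : ContDiff ℝ 1 w) (hw1 : ∀ y, 1 ≤ w y)
    (hweak : ∀ η : EuclideanSpace ℝ (Fin n) → ℝ, ContDiff ℝ 1 η → HasCompactSupport η →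
      ∫ y, ∑ i, ∑ j, a y i j * fderiv ℝ w y (EuclideanSpace.single i 1) *
        fderiv ℝ η y (EuclideanSpace.single j 1) = 0)
    {σ : ℝ} (hσ : σ = 1 ∨ σ = -1) {p₀ : ℝ} (hp₀ : 0 < p₀) {D : ℝ} (hD0 : 0 ≤ D)
    (hne : ∀ k : ℕ, σ * (p₀ * (n / (n - 2 : ℝ)) ^ k) ≠ 1)
    (hD : ∀ k : ℕ, (σ * (p₀ * (n / (n - 2 : ℝ)) ^ k) / (σ * (p₀ * (n / (n - 2 : ℝ)) ^ k) - 1)) ^ 2 ≤ D)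
    {C₀ : ℝ} (hC₀ : 0 < C₀) (hcut : ∀ (x₀ : EuclideanSpace ℝ (Fin n)) (ρ' ρ : ℝ), 0 < ρ' → ρ' < ρ →
      ∃ χ : EuclideanSpace ℝ (Fin n) → ℝ, ContDiff ℝ 1 χ ∧ HasCompactSupport χ ∧ (∀ x, 0 ≤ χ x ∧ χ x ≤ 1) ∧
        (∀ x ∈ closedBall x₀ ρ', χ x = 1) ∧ (∀ x, x ∉ ball x₀ ρ → χ x = 0) ∧ ∀ x, ‖fderiv ℝ χ x‖ ≤ C₀ / (ρ - ρ'))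
    (x₀ : EuclideanSpace ℝ (Fin n)) {R : ℝ} (hR : 0 < R) :
    eLpNorm (fun y => w y ^ σ) ∞ (volume.restrict (closedBall x₀ R)) ≤
      ENNReal.ofReal ((max (eLpNormLESNormFDerivOfEqInnerConst (volume : Measure (EuclideanSpace ℝ (Fin n))) 2 : ℝ) 1) ^ 2
            * (2 * (D * (n * Λ) + lam) / lam * (4 * C₀ ^ 2)) / R ^ 2) ^
          ((n / (n - 2 : ℝ)) / (p₀ * ((n / (n - 2 : ℝ)) - 1))) *
        (4 : ℝ≥0∞) ^ ((n / (n - 2 : ℝ)) / (p₀ * ((n / (n - 2 : ℝ)) - 1) ^ 2)) *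
        eLpNorm (fun y => w y ^ σ) (ENNReal.ofReal p₀) (volume.restrict (closedBall x₀ (2 * R))) := by
  -- notation
  set κ : ℝ := n / (n - 2 : ℝ) with hκ
  set CS : ℝ≥0 := eLpNormLESNormFDerivOfEqInnerConst (volume : Measure (EuclideanSpace ℝ (Fin n))) 2 with hCS
  set K : ℝ := (max (CS : ℝ) 1) ^ 2 * (2 * (D * (n * Λ) + lam) / lam * (4 * C₀ ^ 2)) with hK
  have hn2 : (0 : ℝ) < n - 2 := by
    have : (3 : ℝ) ≤ n := by exact_mod_cast hn
    linarith
  have hκ1 : 1 < κ := by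
    rw [hκ, lt_div_iff₀ hn2]; linarith
  have hκ0 : 0 < κ := zero_lt_one.trans hκ1
  have hpos : ∀ y, 0 < w y := fun y => lt_of_lt_of_le one_pos (hw1 y)
  have hnΛ : 0 ≤ (n : ℝ) * Λ :=
    mul_nonneg (Nat.cast_nonneg n) ((abs_nonneg _).trans (hbd x₀ ⟨0, by omega⟩ ⟨0, by omega⟩))
  have hmax : (1 : ℝ) ≤ max (CS : ℝ) 1 := le_max_right _ _
  have hKpos : 0 < K := by rw [hK]; positivity
  -- radii and sets
  set r : ℕ → ℝ := fun k => R * (1 + (2 : ℝ)⁻¹ ^ k) with hr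
  set A : ℕ → Set (EuclideanSpace ℝ (Fin n)) := fun k => closedBall x₀ (r k) with hA
  have hrpos : ∀ k, 0 < r k := fun k => by positivity
  have hrdiff : ∀ k, r k - r (k + 1) = R * (2 : ℝ)⁻¹ ^ (k + 1) := fun k => by
    simp only [hr, pow_succ]; ring
  have hrlt : ∀ k, r (k + 1) < r k := fun k => by
    have h := hrdiff k
    have : (0 : ℝ) < R * (2 : ℝ)⁻¹ ^ (k + 1) := by positivity
    linarith
  -- the chain constants
  set Cch : ℝ≥0 := Real.toNNReal (K / R ^ 2) with hCch
  have hCch0 : Cch ≠ 0 := by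
    rw [hCch]; exact (Real.toNNReal_pos.2 (by positivity)).ne'
  have hb : (4 : ℝ≥0) ≠ 0 := by norm_num
  have hcoeC : ((Cch : ℝ≥0) : ℝ≥0∞) = ENNReal.ofReal (K / R ^ 2) := rfl
  have hcoe4 : ((4 : ℝ≥0) : ℝ≥0∞) = 4 := by norm_num
  -- the reverse Hölder chain
  have H : ∀ k : ℕ, eLpNorm (fun y => w y ^ σ) (ENNReal.ofReal (p₀ * κ ^ (k + 1))) (volume.restrict (A (k + 1))) ≤
      (((Cch : ℝ≥0) : ℝ≥0∞) * ((4 : ℝ≥0) : ℝ≥0∞) ^ k) ^ (1 / (p₀ * κ ^ k)) *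
        eLpNorm (fun y => w y ^ σ) (ENNReal.ofReal (p₀ * κ ^ k)) (volume.restrict (A k)) := by
    intro k
    have hpk : 0 < p₀ * κ ^ k := by positivity
    have hstep := moser_step hn hsymm hlam hmeas hell hbd hw hw1 hweak hσ hpk (hne k) hcut x₀ (hrpos (k + 1)) (hrlt k)
    rw [pow_succ, ← mul_assoc]
    refine hstep.trans (mul_le_mul' (ENNReal.rpow_le_rpow ?_ (by positivity)) le_rfl)
    -- the step constant is at most `Cch · 4^k`
    rw [hcoeC, hcoe4, show (4 : ℝ≥0∞) ^ k = ENNReal.ofReal (4 ^ k) by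
      rw [ENNReal.ofReal_pow (by norm_num : (0:ℝ) ≤ 4)]; norm_num, ← ENNReal.ofReal_mul (by positivity)]
    refine ENNReal.ofReal_le_ofReal ?_
    set q : ℝ := σ * (p₀ * κ ^ k) with hq
    have h1 : (q / (q - 1)) ^ 2 * (n * Λ) ≤ D * (n * Λ) := mul_le_mul_of_nonneg_right (hD k) hnΛ
    have h2 : (C₀ / (r k - r (k + 1))) ^ 2 = 4 * C₀ ^ 2 * 4 ^ k / R ^ 2 := by
      rw [hrdiff, inv_pow, show (4 : ℝ) ^ k = (2 ^ k) ^ 2 by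
        rw [show (4 : ℝ) = 2 ^ 2 by norm_num, ← pow_mul, ← pow_mul, mul_comm]]
      field_simp
      ring
    have h3 : (CS : ℝ) ^ 2 ≤ (max (CS : ℝ) 1) ^ 2 := pow_le_pow_left₀ (NNReal.coe_nonneg _) (le_max_left _ _) 2
    have h4 : 2 * ((q / (q - 1)) ^ 2 * (n * Λ) + lam) / lam ≤ 2 * (D * (n * Λ) + lam) / lam := by
      refine div_le_div_of_nonneg_right ?_ hlam.le
      linarith
    have h4' : 0 ≤ 2 * ((q / (q - 1)) ^ 2 * (n * Λ) + lam) / lam := by positivity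
    calc (CS : ℝ) ^ 2 * (2 * ((q / (q - 1)) ^ 2 * (n * Λ) + lam) / lam * (C₀ / (r k - r (k + 1))) ^ 2)
        = (CS : ℝ) ^ 2 * (2 * ((q / (q - 1)) ^ 2 * (n * Λ) + lam) / lam) * (4 * C₀ ^ 2 * 4 ^ k / R ^ 2) := by
          rw [h2]; ring
      _ ≤ (max (CS : ℝ) 1) ^ 2 * (2 * (D * (n * Λ) + lam) / lam) * (4 * C₀ ^ 2 * 4 ^ k / R ^ 2) := by
          have h5 : 0 ≤ 4 * C₀ ^ 2 * 4 ^ k / R ^ 2 := by positivity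
          exact mul_le_mul_of_nonneg_right (mul_le_mul h3 h4 h4' (by positivity)) h5
      _ = K / R ^ 2 * 4 ^ k := by rw [hK]; ring
  -- Moser's iteration lemma
  have hf : AEStronglyMeasurable (fun y => w y ^ σ) (volume : Measure (EuclideanSpace ℝ (Fin n))) :=
    (contDiff_rpow_of_one_le hw hw1 σ).continuous.aestronglyMeasurable
  have hchain := eLpNorm_top_le_of_moser_chain (μ := (volume : Measure (EuclideanSpace ℝ (Fin n)))) hf
    (A := A) hp₀ hκ1 hCch0 hb H
  -- `B̄(x₀,R) ⊆ ⋂ A_k` and `A 0 = B̄(x₀,2R)`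
  have hsub : closedBall x₀ R ⊆ ⋂ k, A k := by
    refine subset_iInter fun k => closedBall_subset_closedBall ?_
    have : (0 : ℝ) ≤ R * (2 : ℝ)⁻¹ ^ k := by positivity
    simp only [hr]; linarith
  have hA0 : A 0 = closedBall x₀ (2 * R) := by
    simp only [hA, hr, pow_zero]; ring_nf
  calc eLpNorm (fun y => w y ^ σ) ∞ (volume.restrict (closedBall x₀ R))
      ≤ eLpNorm (fun y => w y ^ σ) ∞ (volume.restrict (⋂ k, A k)) :=
        eLpNorm_mono_measure _ (Measure.restrict_mono hsub le_rfl)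
    _ ≤ ((Cch : ℝ≥0) : ℝ≥0∞) ^ (κ / (p₀ * (κ - 1))) * ((4 : ℝ≥0) : ℝ≥0∞) ^ (κ / (p₀ * (κ - 1) ^ 2)) *
          eLpNorm (fun y => w y ^ σ) (ENNReal.ofReal p₀) (volume.restrict (A 0)) := hchain
    _ = ENNReal.ofReal (K / R ^ 2) ^ (κ / (p₀ * (κ - 1))) * (4 : ℝ≥0∞) ^ (κ / (p₀ * (κ - 1) ^ 2)) *
          eLpNorm (fun y => w y ^ σ) (ENNReal.ofReal p₀) (volume.restrict (closedBall x₀ (2 * R))) := by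
        rw [hcoeC, hcoe4, hA0]

end Literature.Analysis.PDE.DivForm.MoserChain

end

end Part5

/-!
## Part 6 — port of `Summits/NavierStokesRegularity/NavierStokesRegularity/Theorems/PoloidalWindowDoorPoloidalWindowRigidityDivFormLogBMO.lean`

# Route `PoloidalWindowDoor`, crux K2 (stmt-NavierStokesRegularity-19708) — task H5, step M2a: `log u ∈ BMO(ℝⁿ)`
# for entire weak solutions of `div(a∇u) = 0` (towards `divFormLiouville_holds`, De Giorgi–Nash–Moser)

Seat ns-poloidal-K2-p3 g2 (`ledger fact claim` #1 on `Literature.Analysis.PDE.divFormLiouville`).  Setting = that fact's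
rendering with `u ≥ 1`.  Moser 1961 §5 / John–Nirenberg 1961: the logarithm of a positive entire solution has bounded
mean oscillation, with a bound depending only on `n` and `Λ/λ`.  Because the equation holds on ALL of `ℝⁿ`, no
localisation is needed: the logarithmic Caccioppoli inequality (M1b `gradLog_estimate`) with a cutoff of the ball
`B(x₀,2r)` equal to `1` on `B(x₀,r)` gives `∫_{B(x₀,r)} ‖D log u‖² ≤ K₁ r⁻² |B(x₀,r)|`, and the Poincaré–Wirtinger
inequality on the ball (tree `PoincareWirtingerConvex`) turns this into `⨍_{B} ‖log u − (log u)_B‖ ≤ K` for EVERY ball.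

* `exists_ball_cutoff` — cutoffs `χ ∈ C¹_c`, `0 ≤ χ ≤ 1`, `χ = 1` on `B(x₀,r)`, `χ = 0` off `B(x₀,2r)`,
  `‖Dχ‖ ≤ C₀/r` (from `SmoothCutoff.exists_smooth_cutoff`);
* `lintegral_ball_gradLog_sq_le` — `∫⁻_{B(x₀,r)} ‖D(log u)‖ₑ² ≤ K₁ · r⁻² · |B(x₀,r)|`;
* `laverage_oscillation_log_le` — `⨍⁻_{B(x₀,r)} ‖log u − (log u)_{B}‖ₑ ≤ K`;
* `memBMO_log` — `log u ∈ BMO(ℝⁿ)` with `eBMOSeminorm (log ∘ u) ≤ K(n, λ, Λ, C₀)`.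

WHAT THIS IS NOT: not yet the Liouville theorem (M2b crossover, M3, M4 to come); nothing NS-specific.
-/

section Part6

noncomputable section

open _root_.MeasureTheory _root_.Set _root_.Function _root_.Filter _root_.Topology _root_.Metric
open scoped _root_.Matrix _root_.ENNReal

namespace Literature.Analysis.PDE.DivForm.LogBMO

open Literature.Analysis.PDE.DivForm.Caccioppoli
open Literature.Analysis.PDE.DivForm.CaccioppoliPowers
open Literature.Analysis.FunctionSpaces

variable {n : ℕ}

/-! ### Cutoffs for balls -/

/-- **Ball cutoffs.**  There is `C₀ ≥ 0` (depending only on `n`) such that for every `x₀` and `r > 0` there is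
`χ ∈ C¹(ℝⁿ)` with compact support, `0 ≤ χ ≤ 1`, `χ = 1` on `B(x₀,r)`, `χ = 0` off `B(x₀,2r)`, `‖Dχ‖ ≤ C₀/r`.
[cite: Moser1961Harnack, Theorem 1, proof (log u has bounded mean oscillation)] -/
theorem exists_ball_cutoff (n : ℕ) : ∃ C₀ : ℝ, 0 ≤ C₀ ∧ ∀ (x₀ : EuclideanSpace ℝ (Fin n)) (r : ℝ), 0 < r →
    ∃ χ : EuclideanSpace ℝ (Fin n) → ℝ, ContDiff ℝ 1 χ ∧ HasCompactSupport χ ∧ (∀ x, 0 ≤ χ x ∧ χ x ≤ 1) ∧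
      (∀ x ∈ ball x₀ r, χ x = 1) ∧ (∀ x, x ∉ ball x₀ (2 * r) → χ x = 0) ∧ ∀ x, ‖fderiv ℝ χ x‖ ≤ C₀ / r := by
  obtain ⟨C, hC0, hC⟩ := exists_smooth_cutoff (volume : Measure (EuclideanSpace ℝ (Fin n)))
  refine ⟨2 * C, by positivity, fun x₀ r hr => ?_⟩
  obtain ⟨χ, hχs, hχ01, hχ1, hχ0, hχD⟩ := hC (ball x₀ (3 / 2 * r)) measurableSet_ball (r / 2) (by positivity)
  have hzero : ∀ x, x ∉ ball x₀ (2 * r) → χ x = 0 := by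
    intro x hx
    refine hχ0 x (Metric.ball_disjoint_ball ?_)
    rw [mem_ball, not_lt] at hx
    linarith
  refine ⟨χ, hχs.of_le (by norm_cast), ?_, hχ01, fun x hx => hχ1 x ?_, hzero, fun x => (hχD x).trans_eq (by ring)⟩
  · refine HasCompactSupport.intro (isCompact_closedBall x₀ (2 * r)) fun x hx => hzero x fun hx' => hx ?_
    exact ball_subset_closedBall hx'
  · rw [mem_ball] at hx
    intro z hz
    rw [mem_ball] at hz ⊢
    calc dist z x₀ ≤ dist z x + dist x x₀ := dist_triangle _ _ _
      _ < r / 2 + r := by linarith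
      _ = 3 / 2 * r := by ring

/-! ### The logarithm of a positive solution -/

variable {a : EuclideanSpace ℝ (Fin n) → Matrix (Fin n) (Fin n) ℝ} {lam Λ : ℝ} {u : EuclideanSpace ℝ (Fin n) → ℝ}

/-- `log u ∈ C¹` for `u ∈ C¹`, `u ≥ 1`.
[cite: Moser1961Harnack, Theorem 1, proof (log u has bounded mean oscillation)] -/
theorem contDiff_log (hu : ContDiff ℝ 1 u) (hu1 : ∀ y, 1 ≤ u y) : ContDiff ℝ 1 fun y => Real.log (u y) := by
  rw [contDiff_iff_contDiffAt]
  intro y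
  have hy : u y ≠ 0 := (lt_of_lt_of_le one_pos (hu1 y)).ne'
  exact (Real.contDiffAt_log.2 hy).comp y hu.contDiffAt

/-- `‖D(log u)‖² = ‖Du‖²/u²`. [cite: Moser1961Harnack, Theorem 1, proof (log u has bounded mean oscillation)] -/
theorem norm_fderiv_log_sq (hu : ContDiff ℝ 1 u) (hu1 : ∀ y, 1 ≤ u y) (y : EuclideanSpace ℝ (Fin n)) :
    ‖fderiv ℝ (fun y => Real.log (u y)) y‖ ^ 2 = (u y ^ 2)⁻¹ * ‖fderiv ℝ u y‖ ^ 2 := by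
  have hupos : 0 < u y := lt_of_lt_of_le one_pos (hu1 y)
  rw [fderiv.log ((hu.differentiable one_ne_zero) y) hupos.ne', norm_smul, mul_pow, Real.norm_eq_abs,
    abs_inv, inv_pow, sq_abs]

/-- **The gradient of `log u` on a ball**: `∫⁻_{B(x₀,r)} ‖D log u‖ₑ² ≤ (4nΛC₀²2ⁿ/λ) · r⁻² · |B(x₀,r)|`, for a cutoff
constant `C₀` as in `exists_ball_cutoff`.
[cite: Moser1961Harnack, Theorem 1, proof (log u has bounded mean oscillation)] -/
theorem lintegral_ball_gradLog_sq_le (hsymm : ∀ y, (a y).IsSymm) (hlam : 0 < lam)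
    (hmeas : ∀ i j, Measurable fun y => a y i j)
    (hell : ∀ y (ξ : Fin n → ℝ), lam * (ξ ⬝ᵥ ξ) ≤ ξ ⬝ᵥ (a y *ᵥ ξ)) (hbd : ∀ y i j, |a y i j| ≤ Λ)
    (hu : ContDiff ℝ 1 u) (hu1 : ∀ y, 1 ≤ u y)
    (hweak : ∀ η : EuclideanSpace ℝ (Fin n) → ℝ, ContDiff ℝ 1 η → HasCompactSupport η →
      ∫ y, ∑ i, ∑ j, a y i j * fderiv ℝ u y (EuclideanSpace.single i 1) *
        fderiv ℝ η y (EuclideanSpace.single j 1) = 0)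
    {C₀ : ℝ} {x₀ : EuclideanSpace ℝ (Fin n)} {r : ℝ} (hr : 0 < r)
    {χ : EuclideanSpace ℝ (Fin n) → ℝ} (hχ : ContDiff ℝ 1 χ) (hχc : HasCompactSupport χ)
    (hχ1 : ∀ x ∈ ball x₀ r, χ x = 1) (hχ0 : ∀ x, x ∉ ball x₀ (2 * r) → χ x = 0)
    (hχD : ∀ x, ‖fderiv ℝ χ x‖ ≤ C₀ / r) :
    ∫⁻ y in ball x₀ r, ‖fderiv ℝ (fun y => Real.log (u y)) y‖ₑ ^ 2 ≤
      ENNReal.ofReal (4 * (n * Λ) * C₀ ^ 2 * 2 ^ n / lam / r ^ 2) * volume (ball x₀ r) := by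
  have hupos : ∀ y, 0 < u y := fun y => lt_of_lt_of_le one_pos (hu1 y)
  have hnΛ : 0 ≤ (n : ℝ) * Λ := by
    rcases Nat.eq_zero_or_pos n with hn | hn
    · simp [hn]
    · exact mul_nonneg (Nat.cast_nonneg n) ((abs_nonneg _).trans (hbd x₀ ⟨0, hn⟩ ⟨0, hn⟩))
  -- (1) the logarithmic Caccioppoli inequality with this cutoff
  have h1 := gradLog_estimate hsymm hlam hmeas hell hbd hu hu1 hweak hχ hχc
  -- (2) the cutoff gradient: `∫ ‖Dχ‖² ≤ (C₀/r)² |B(x₀, 2r)|`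
  have hDχ_out : ∀ x, x ∉ closedBall x₀ (2 * r) → fderiv ℝ χ x = 0 := by
    intro x hx
    have hopen : IsOpen (closedBall x₀ (2 * r))ᶜ := isClosed_closedBall.isOpen_compl
    have hev : χ =ᶠ[𝓝 x] fun _ => 0 := by
      filter_upwards [hopen.mem_nhds hx] with z hz
      exact hχ0 z fun hz' => hz (ball_subset_closedBall hz')
    rw [hev.fderiv_eq, fderiv_const_apply]
  have hint_Dχ : ∫ y, ‖fderiv ℝ χ y‖ ^ 2 ≤ (C₀ / r) ^ 2 * (volume (closedBall x₀ (2 * r))).toReal := by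
    have hcont : Continuous fun y => ‖fderiv ℝ χ y‖ ^ 2 := ((hχ.continuous_fderiv one_ne_zero).norm).pow 2
    have heq : ∫ y, ‖fderiv ℝ χ y‖ ^ 2 = ∫ y in closedBall x₀ (2 * r), ‖fderiv ℝ χ y‖ ^ 2 := by
      refine (setIntegral_eq_integral_of_forall_compl_eq_zero fun y hy => ?_).symm
      rw [hDχ_out y hy, norm_zero, zero_pow two_ne_zero]
    rw [heq]
    calc ∫ y in closedBall x₀ (2 * r), ‖fderiv ℝ χ y‖ ^ 2
        ≤ ∫ y in closedBall x₀ (2 * r), (C₀ / r) ^ 2 := by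
          refine setIntegral_mono_on (hcont.continuousOn.integrableOn_compact (isCompact_closedBall _ _))
            (by simp [measure_closedBall_lt_top]) measurableSet_closedBall fun y _ => ?_
          exact pow_le_pow_left₀ (norm_nonneg _) (hχD y) 2
      _ = (C₀ / r) ^ 2 * (volume (closedBall x₀ (2 * r))).toReal := by
          rw [setIntegral_const, smul_eq_mul, mul_comm]; rfl
  -- (3) volumes: `|B̄(x₀,2r)| = 2ⁿ |B(x₀,r)|`
  have hvol : volume (closedBall x₀ (2 * r)) = ENNReal.ofReal (2 ^ n) * volume (ball x₀ r) := by
    rcases Nat.eq_zero_or_pos n with hn | hn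
    · subst hn
      have h0 : ∀ s : Set (EuclideanSpace ℝ (Fin 0)), s.Nonempty → s = univ := fun s hs => by
        obtain ⟨p, hp⟩ := hs; exact eq_univ_of_forall fun q => by rwa [Subsingleton.elim q p]
      rw [h0 _ ⟨x₀, mem_closedBall_self (by positivity)⟩, h0 _ ⟨x₀, mem_ball_self hr⟩]
      simp
    · haveI : Nonempty (Fin n) := ⟨⟨0, hn⟩⟩
      rw [Measure.addHaar_closedBall_eq_addHaar_ball, Measure.addHaar_ball_of_pos _ _ (by positivity : 0 < 2 * r),
        Measure.addHaar_ball_of_pos _ _ hr, ← mul_assoc, ← ENNReal.ofReal_mul (by positivity), mul_pow,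
        finrank_euclideanSpace, Fintype.card_fin]
  -- (4) the left side: on the ball `χ = 1` and `‖D log u‖² = ‖Du‖²/u²`
  have hcontL : Continuous fun y => (u y ^ 2)⁻¹ * ‖fderiv ℝ u y‖ ^ 2 :=
    ((hu.continuous.pow 2).inv₀ fun y => (pow_pos (hupos y) 2).ne').mul
      (((hu.continuous_fderiv one_ne_zero).norm).pow 2)
  have hinvu : Continuous fun y => (u y ^ 2)⁻¹ := (hu.continuous.pow 2).inv₀ fun y => (pow_pos (hupos y) 2).ne'
  have hnu : Continuous fun y => ‖fderiv ℝ u y‖ ^ 2 := ((hu.continuous_fderiv one_ne_zero).norm).pow 2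
  have hIfull : Integrable fun y => χ y ^ 2 * (u y ^ 2)⁻¹ * ‖fderiv ℝ u y‖ ^ 2 := by
    have hc : Continuous fun y => χ y ^ 2 * (u y ^ 2)⁻¹ * ‖fderiv ℝ u y‖ ^ 2 :=
      ((hχ.continuous.pow 2).mul hinvu).mul hnu
    exact hc.integrable_of_hasCompactSupport
      ((hasCompactSupport_testFun (u := u) (g := fun s => (s ^ 2)⁻¹) hχc).mul_right)
  have hball : ∫ y in ball x₀ r, (u y ^ 2)⁻¹ * ‖fderiv ℝ u y‖ ^ 2 ≤
      ∫ y, χ y ^ 2 * (u y ^ 2)⁻¹ * ‖fderiv ℝ u y‖ ^ 2 := by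
    calc ∫ y in ball x₀ r, (u y ^ 2)⁻¹ * ‖fderiv ℝ u y‖ ^ 2
        = ∫ y in ball x₀ r, χ y ^ 2 * (u y ^ 2)⁻¹ * ‖fderiv ℝ u y‖ ^ 2 :=
          setIntegral_congr_fun measurableSet_ball fun y hy => by rw [hχ1 y hy]; ring
      _ ≤ ∫ y, χ y ^ 2 * (u y ^ 2)⁻¹ * ‖fderiv ℝ u y‖ ^ 2 :=
          setIntegral_le_integral hIfull (Eventually.of_forall fun y => by positivity)
  -- assemble in `ℝ`
  have hreal : ∫ y in ball x₀ r, ‖fderiv ℝ (fun y => Real.log (u y)) y‖ ^ 2 ≤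
      4 * (n * Λ) * C₀ ^ 2 * 2 ^ n / lam / r ^ 2 * (volume (ball x₀ r)).toReal := by
    have hv : (volume (closedBall x₀ (2 * r))).toReal = 2 ^ n * (volume (ball x₀ r)).toReal := by
      rw [hvol, ENNReal.toReal_mul, ENNReal.toReal_ofReal (by positivity)]
    have hL : ∫ y in ball x₀ r, ‖fderiv ℝ (fun y => Real.log (u y)) y‖ ^ 2 =
        ∫ y in ball x₀ r, (u y ^ 2)⁻¹ * ‖fderiv ℝ u y‖ ^ 2 :=
      setIntegral_congr_fun measurableSet_ball fun y _ => norm_fderiv_log_sq hu hu1 y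
    rw [hL]
    have h2 : lam * ∫ y in ball x₀ r, (u y ^ 2)⁻¹ * ‖fderiv ℝ u y‖ ^ 2 ≤
        4 * (n * Λ) * ((C₀ / r) ^ 2 * (2 ^ n * (volume (ball x₀ r)).toReal)) := by
      calc lam * ∫ y in ball x₀ r, (u y ^ 2)⁻¹ * ‖fderiv ℝ u y‖ ^ 2
          ≤ lam * ∫ y, χ y ^ 2 * (u y ^ 2)⁻¹ * ‖fderiv ℝ u y‖ ^ 2 := mul_le_mul_of_nonneg_left hball hlam.le
        _ ≤ 4 * (n * Λ) * ∫ y, ‖fderiv ℝ χ y‖ ^ 2 := h1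
        _ ≤ 4 * (n * Λ) * ((C₀ / r) ^ 2 * (2 ^ n * (volume (ball x₀ r)).toReal)) := by
            rw [← hv]; exact mul_le_mul_of_nonneg_left hint_Dχ (by positivity)
    rw [← le_div_iff₀' hlam] at h2
    refine h2.trans (le_of_eq ?_)
    field_simp
  -- convert to `ℝ≥0∞`
  have hnn : 0 ≤ᵐ[volume.restrict (ball x₀ r)] fun y => ‖fderiv ℝ (fun y => Real.log (u y)) y‖ ^ 2 :=
    Eventually.of_forall fun y => by positivity
  have hIball : IntegrableOn (fun y => ‖fderiv ℝ (fun y => Real.log (u y)) y‖ ^ 2) (ball x₀ r) :=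
    ((((contDiff_log hu hu1).continuous_fderiv one_ne_zero).norm).pow 2).continuousOn.integrableOn_compact
      (isCompact_closedBall x₀ r) |>.mono_set ball_subset_closedBall
  calc ∫⁻ y in ball x₀ r, ‖fderiv ℝ (fun y => Real.log (u y)) y‖ₑ ^ 2
      = ∫⁻ y in ball x₀ r, ENNReal.ofReal (‖fderiv ℝ (fun y => Real.log (u y)) y‖ ^ 2) := by
        refine lintegral_congr fun y => ?_
        rw [← ofReal_norm, ← ENNReal.ofReal_pow (norm_nonneg _)]
    _ = ENNReal.ofReal (∫ y in ball x₀ r, ‖fderiv ℝ (fun y => Real.log (u y)) y‖ ^ 2) :=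
        (ofReal_integral_eq_lintegral_ofReal hIball hnn).symm
    _ ≤ ENNReal.ofReal (4 * (n * Λ) * C₀ ^ 2 * 2 ^ n / lam / r ^ 2 * (volume (ball x₀ r)).toReal) :=
        ENNReal.ofReal_le_ofReal hreal
    _ = ENNReal.ofReal (4 * (n * Λ) * C₀ ^ 2 * 2 ^ n / lam / r ^ 2) * volume (ball x₀ r) := by
        rw [ENNReal.ofReal_mul (by positivity), ENNReal.ofReal_toReal measure_ball_lt_top.ne]

/-! ### Mean oscillation of `log u` over balls, and `BMO` -/

/-- Cauchy–Schwarz for a Lebesgue average: `⨍⁻_s g ≤ K` once `∫⁻_s g² ≤ K² · μ s` — in the form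
`∫⁻_s g ≤ (∫⁻_s g²)^{1/2} (μ s)^{1/2}`.
[cite: Moser1961Harnack, Theorem 1, proof (log u has bounded mean oscillation)] -/
theorem setLIntegral_le_sqrt_mul {α : Type*} [MeasurableSpace α] (μ : Measure α) (s : Set α) {g : α → ℝ≥0∞}
    (hg : AEMeasurable g (μ.restrict s)) :
    ∫⁻ y in s, g y ∂μ ≤ (∫⁻ y in s, g y ^ 2 ∂μ) ^ (1 / 2 : ℝ) * (μ s) ^ (1 / 2 : ℝ) := by
  have h := ENNReal.lintegral_mul_le_Lp_mul_Lq (μ.restrict s) Real.HolderConjugate.two_two hg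
    (aemeasurable_const (b := (1 : ℝ≥0∞)))
  simp only [Pi.mul_apply, mul_one, lintegral_const, Measure.restrict_apply_univ, ENNReal.rpow_two] at h
  simpa [one_div] using h

/-- **Mean oscillation of `log u` over a ball** (Moser 1961 §5): with the cutoff constant `C₀` of `exists_ball_cutoff`,
`⨍⁻_{B(x₀,r)} ‖log u − (log u)_{B(x₀,r)}‖ₑ ≤ K`, `K = (2ⁿ(2r)² · 4nΛC₀²2ⁿ/(λr²))^{1/2} = (16·4ⁿ·nΛC₀²/λ)^{1/2}`.
[cite: Moser1961Harnack, Theorem 1, proof (log u has bounded mean oscillation)] -/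
theorem laverage_oscillation_log_le (hsymm : ∀ y, (a y).IsSymm) (hlam : 0 < lam)
    (hmeas : ∀ i j, Measurable fun y => a y i j)
    (hell : ∀ y (ξ : Fin n → ℝ), lam * (ξ ⬝ᵥ ξ) ≤ ξ ⬝ᵥ (a y *ᵥ ξ)) (hbd : ∀ y i j, |a y i j| ≤ Λ)
    (hu : ContDiff ℝ 1 u) (hu1 : ∀ y, 1 ≤ u y)
    (hweak : ∀ η : EuclideanSpace ℝ (Fin n) → ℝ, ContDiff ℝ 1 η → HasCompactSupport η →
      ∫ y, ∑ i, ∑ j, a y i j * fderiv ℝ u y (EuclideanSpace.single i 1) *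
        fderiv ℝ η y (EuclideanSpace.single j 1) = 0)
    {C₀ : ℝ}
    (hcut : ∀ (x₀ : EuclideanSpace ℝ (Fin n)) (r : ℝ), 0 < r →
      ∃ χ : EuclideanSpace ℝ (Fin n) → ℝ, ContDiff ℝ 1 χ ∧ HasCompactSupport χ ∧ (∀ x, 0 ≤ χ x ∧ χ x ≤ 1) ∧
        (∀ x ∈ ball x₀ r, χ x = 1) ∧ (∀ x, x ∉ ball x₀ (2 * r) → χ x = 0) ∧ ∀ x, ‖fderiv ℝ χ x‖ ≤ C₀ / r)
    (x₀ : EuclideanSpace ℝ (Fin n)) {r : ℝ} (hr : 0 < r) :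
    ⨍⁻ y in ball x₀ r, ‖Real.log (u y) - ⨍ z in ball x₀ r, Real.log (u z)‖ₑ ∂volume ≤
      ENNReal.ofReal ((2 ^ n * (2 * r) ^ 2 * (4 * (n * Λ) * C₀ ^ 2 * 2 ^ n / lam / r ^ 2)) ^ (1 / 2 : ℝ)) := by
  obtain ⟨χ, hχ, hχc, hχ01, hχ1, hχ0, hχD⟩ := hcut x₀ r hr
  set f : EuclideanSpace ℝ (Fin n) → ℝ := fun y => Real.log (u y) with hf
  have hfC : ContDiff ℝ 1 f := contDiff_log hu hu1
  have hB0 : volume (ball x₀ r) ≠ 0 := (measure_ball_pos volume x₀ hr).ne'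
  have hBt : volume (ball x₀ r) ≠ ∞ := measure_ball_lt_top.ne
  have hnΛ : 0 ≤ (n : ℝ) * Λ := by
    rcases Nat.eq_zero_or_pos n with hn | hn
    · simp [hn]
    · exact mul_nonneg (Nat.cast_nonneg n) ((abs_nonneg _).trans (hbd x₀ ⟨0, hn⟩ ⟨0, hn⟩))
  -- Poincaré–Wirtinger on the ball (diameter `2r`)
  have hP := lintegral_enorm_sub_setAverage_sq_le (μ := (volume : Measure (EuclideanSpace ℝ (Fin n)))) hfC
    (convex_ball x₀ r) measurableSet_ball hB0 hBt
    ((hfC.continuous.continuousOn.integrableOn_compact (isCompact_closedBall x₀ r)).mono_set ball_subset_closedBall)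
    (D := 2 * r) (fun y hy z hz => by
      rw [← dist_eq_norm]
      calc dist y z ≤ dist y x₀ + dist z x₀ := dist_triangle_right _ _ _
        _ ≤ 2 * r := by rw [mem_ball] at hy hz; linarith)
  rw [finrank_euclideanSpace, Fintype.card_fin] at hP
  -- the gradient bound
  have hG := lintegral_ball_gradLog_sq_le hsymm hlam hmeas hell hbd hu hu1 hweak hr hχ hχc hχ1 hχ0 hχD
  -- `∫⁻_B osc² ≤ K² |B|`
  set K2 : ℝ := 2 ^ n * (2 * r) ^ 2 * (4 * (n * Λ) * C₀ ^ 2 * 2 ^ n / lam / r ^ 2) with hK2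
  have hK2nn : 0 ≤ K2 := by rw [hK2]; positivity
  have hsq : ∫⁻ y in ball x₀ r, ‖f y - ⨍ z in ball x₀ r, f z‖ₑ ^ 2 ≤ ENNReal.ofReal K2 * volume (ball x₀ r) := by
    refine hP.trans ?_
    calc ENNReal.ofReal (2 ^ n * (2 * r) ^ 2) * ∫⁻ y in ball x₀ r, ‖fderiv ℝ f y‖ₑ ^ 2
        ≤ ENNReal.ofReal (2 ^ n * (2 * r) ^ 2) *
            (ENNReal.ofReal (4 * (n * Λ) * C₀ ^ 2 * 2 ^ n / lam / r ^ 2) * volume (ball x₀ r)) := by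
          gcongr
      _ = ENNReal.ofReal K2 * volume (ball x₀ r) := by
          rw [hK2, ← mul_assoc, ← ENNReal.ofReal_mul (by positivity)]
  -- Cauchy–Schwarz and division by `|B|`
  have hmeas_osc : AEMeasurable (fun y => ‖f y - ⨍ z in ball x₀ r, f z‖ₑ) (volume.restrict (ball x₀ r)) :=
    ((hfC.continuous.sub continuous_const).measurable.enorm).aemeasurable
  have hCS := setLIntegral_le_sqrt_mul volume (ball x₀ r) hmeas_osc
  rw [setLAverage_eq]
  refine (ENNReal.div_le_iff hB0 hBt).2 ?_
  calc ∫⁻ y in ball x₀ r, ‖f y - ⨍ z in ball x₀ r, f z‖ₑ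
      ≤ (∫⁻ y in ball x₀ r, ‖f y - ⨍ z in ball x₀ r, f z‖ₑ ^ 2) ^ (1 / 2 : ℝ) *
          volume (ball x₀ r) ^ (1 / 2 : ℝ) := hCS
    _ ≤ (ENNReal.ofReal K2 * volume (ball x₀ r)) ^ (1 / 2 : ℝ) * volume (ball x₀ r) ^ (1 / 2 : ℝ) := by
        gcongr
    _ = ENNReal.ofReal (K2 ^ (1 / 2 : ℝ)) * volume (ball x₀ r) := by
        rw [ENNReal.mul_rpow_of_nonneg _ _ (by norm_num : (0 : ℝ) ≤ 1 / 2),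
          ENNReal.ofReal_rpow_of_nonneg hK2nn (by norm_num : (0 : ℝ) ≤ 1 / 2), mul_assoc,
          ← ENNReal.rpow_add_of_nonneg _ _ (by norm_num : (0 : ℝ) ≤ 1 / 2) (by norm_num : (0 : ℝ) ≤ 1 / 2)]
        norm_num

/-- **`log u ∈ BMO(ℝⁿ)` with a universal bound** (Moser 1961 §5; John–Nirenberg 1961): there is `K ≥ 0`, depending
only on `n`, `λ`, `Λ`, such that for every coefficient field `a` and every `C¹` weak solution `u ≥ 1` of `div(a∇u) = 0`
on all of `ℝⁿ` (in the weak formulation of `Literature.Analysis.PDE.divFormLiouville`),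
`‖log u‖_* = eBMOSeminorm (log ∘ u) ≤ K`; in particular `MemBMO (log ∘ u)`.
[cite: Moser1961Harnack, Theorem 1, proof (log u has bounded mean oscillation)] -/
theorem exists_eBMOSeminorm_log_le (n : ℕ) {lam : ℝ} (hlam : 0 < lam) (Λ : ℝ) :
    ∃ K : ℝ, 0 ≤ K ∧ ∀ (a : EuclideanSpace ℝ (Fin n) → Matrix (Fin n) (Fin n) ℝ),
      (∀ i j, Measurable fun y => a y i j) → (∀ y, (a y).IsSymm) →
      (∀ y (ξ : Fin n → ℝ), lam * (ξ ⬝ᵥ ξ) ≤ ξ ⬝ᵥ (a y *ᵥ ξ)) → (∀ y i j, |a y i j| ≤ Λ) →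
      ∀ (u : EuclideanSpace ℝ (Fin n) → ℝ), ContDiff ℝ 1 u → (∀ y, 1 ≤ u y) →
        (∀ η : EuclideanSpace ℝ (Fin n) → ℝ, ContDiff ℝ 1 η → HasCompactSupport η →
          ∫ y, ∑ i, ∑ j, a y i j * fderiv ℝ u y (EuclideanSpace.single i 1) *
            fderiv ℝ η y (EuclideanSpace.single j 1) = 0) →
        eBMOSeminorm (fun y => Real.log (u y)) ≤ ENNReal.ofReal K ∧ MemBMO (fun y => Real.log (u y)) := by
  obtain ⟨C₀, -, hcut⟩ := exists_ball_cutoff n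
  -- the constant of `laverage_oscillation_log_le` does not depend on `r`; name it at `r = 1`
  refine ⟨(2 ^ n * (2 * 1) ^ 2 * (4 * (n * |Λ|) * C₀ ^ 2 * 2 ^ n / lam / 1 ^ 2)) ^ (1 / 2 : ℝ), by positivity,
    fun a hmeas hsymm hell hbd u hu hu1 hweak => ?_⟩
  have hnΛ : (n : ℝ) * Λ = n * |Λ| := by
    rcases Nat.eq_zero_or_pos n with hn | hn
    · simp [hn]
    · rw [abs_of_nonneg ((abs_nonneg _).trans (hbd 0 ⟨0, hn⟩ ⟨0, hn⟩))]
  have hle : eBMOSeminorm (fun y => Real.log (u y)) ≤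
      ENNReal.ofReal ((2 ^ n * (2 * 1) ^ 2 * (4 * (n * |Λ|) * C₀ ^ 2 * 2 ^ n / lam / 1 ^ 2)) ^ (1 / 2 : ℝ)) := by
    refine iSup_le fun x₀ => iSup_le fun r => iSup_le fun hr => ?_
    have h := laverage_oscillation_log_le hsymm hlam hmeas hell hbd hu hu1 hweak hcut x₀ hr
    refine h.trans (le_of_eq ?_)
    congr 2
    rw [hnΛ]
    field_simp
  refine ⟨hle, (contDiff_log hu hu1).continuous.locallyIntegrable, lt_of_le_of_lt hle ENNReal.ofReal_lt_top⟩

end Literature.Analysis.PDE.DivForm.LogBMO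

end

end Part6

/-!
## Part 7 — port of `Summits/NavierStokesRegularity/NavierStokesRegularity/Theorems/PoloidalWindowDoorPoloidalWindowRigidityDivFormCrossover.lean`

# Route `PoloidalWindowDoor`, crux K2 (stmt-NavierStokesRegularity-19708) — task H5, step M2b: the CROSSOVER estimate
# `(∫_B u^{p₀})(∫_B u^{-p₀}) ≤ C |B|²` for entire weak solutions of `div(a∇u) = 0` (towards `divFormLiouville_holds`)

Seat ns-poloidal-K2-p3 g2 (`ledger fact claim` #1 on `Literature.Analysis.PDE.divFormLiouville`).  Moser 1961 §5 with
John–Nirenberg 1961 (tree: `Literature.Analysis.FunctionSpaces.john_nirenberg_holds`): from M2a, `log u ∈ BMO(ℝⁿ)` with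
`‖log u‖_* ≤ K(n,λ,Λ)`; the John–Nirenberg inequality and the layer-cake formula give exponential integrability
`∫_B e^{p₀|log u − (log u)_B|} ≤ (1 + c₁)|B|` for `p₀ = c₂/(2K)`, whence the crossover of Moser's Harnack proof.

* `lintegral_exp_mul_oscillation_le` — BMO ⇒ exponential integrability on balls (layer cake + John–Nirenberg);
* `lintegral_rpow_mul_lintegral_rpow_neg_le` — `(∫⁻_B u^{p₀})(∫⁻_B u^{−p₀}) ≤ (1+c₁)² |B|²` for `u = e^f`;
* `exists_crossover` — packaged: `∃ p₀ > 0, C`, depending only on `n, λ, Λ`, such that the crossover holds for every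
  coefficient field and every entire `C¹` weak solution `u ≥ 1`, on every ball.

WHAT THIS IS NOT: not yet the Liouville theorem (M3 Moser iterations, M4 Harnack ⇒ Liouville to come); nothing NS-specific.
-/

section Part7

noncomputable section

open _root_.MeasureTheory _root_.Set _root_.Function _root_.Filter _root_.Topology _root_.Metric
open scoped _root_.Matrix _root_.ENNReal

namespace Literature.Analysis.PDE.DivForm.Crossover

open Literature.Analysis.PDE.DivForm.LogBMO
open Literature.Analysis.FunctionSpaces

variable {n : ℕ}

/-! ### Exponential integrability from `BMO` (John–Nirenberg + layer cake) -/

/-- `∫₀ˢ p e^{pt} dt = e^{ps} − 1`. [cite: Moser1961Harnack, Theorem 1, proof (crossover via John–Nirenberg)] -/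
theorem intervalIntegral_mul_exp_mul (p s : ℝ) :
    ∫ t in (0 : ℝ)..s, p * Real.exp (p * t) = Real.exp (p * s) - 1 := by
  have hderiv : ∀ t ∈ uIcc 0 s, HasDerivAt (fun t => Real.exp (p * t)) (p * Real.exp (p * t)) t := by
    intro t _
    have h := ((hasDerivAt_id t).const_mul p).exp
    simpa [mul_comm] using h
  have hint : IntervalIntegrable (fun t => p * Real.exp (p * t)) volume 0 s :=
    (continuous_const.mul (Real.continuous_exp.comp (continuous_const.mul continuous_id))).intervalIntegrable _ _
  rw [intervalIntegral.integral_eq_sub_of_hasDerivAt hderiv hint]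
  simp

/-- **Exponential integrability of a `BMO` function on balls.**  If `MemBMO f`, `‖f‖_* ≤ K` with `K > 0`, and `c₁, c₂`
are John–Nirenberg constants for `f`, then with `p₀ = c₂/(2K)`:
`∫⁻_{B} (e^{p₀ |f − f_B|} − 1) ≤ c₁ |B|` for every ball `B = B(x₀,r)`.
[cite: Moser1961Harnack, Theorem 1, proof (crossover via John–Nirenberg)] -/
theorem lintegral_exp_mul_oscillation_le {f : EuclideanSpace ℝ (Fin n) → ℝ} (hf : Measurable f) {K c₁ c₂ : ℝ}
    (hK : 0 < K) (hc₁ : 0 < c₁) (hc₂ : 0 < c₂) (hfK : eBMOSeminorm f ≤ ENNReal.ofReal K)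
    (hJN : ∀ (x₀ : EuclideanSpace ℝ (Fin n)) (r : ℝ), 0 < r → ∀ (t : ℝ), 0 < t →
      volume {x ∈ ball x₀ r | ENNReal.ofReal t * eBMOSeminorm f < ‖f x - ⨍ z in ball x₀ r, f z‖ₑ} ≤
        ENNReal.ofReal (c₁ * Real.exp (-c₂ * t)) * volume (ball x₀ r))
    (x₀ : EuclideanSpace ℝ (Fin n)) {r : ℝ} (hr : 0 < r) :
    ∫⁻ x in ball x₀ r, ENNReal.ofReal (Real.exp (c₂ / (2 * K) * |f x - ⨍ z in ball x₀ r, f z|) - 1) ≤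
      ENNReal.ofReal c₁ * volume (ball x₀ r) := by
  set p₀ : ℝ := c₂ / (2 * K) with hp₀
  have hp₀pos : 0 < p₀ := by rw [hp₀]; positivity
  set g : EuclideanSpace ℝ (Fin n) → ℝ := fun x => |f x - ⨍ z in ball x₀ r, f z| with hg
  have hg_nn : 0 ≤ᵐ[volume.restrict (ball x₀ r)] g := Eventually.of_forall fun x => abs_nonneg _
  have hg_m : AEMeasurable g (volume.restrict (ball x₀ r)) := ((hf.sub measurable_const).abs).aemeasurable
  -- layer cake with `G(s) = e^{p₀ s} − 1 = ∫₀ˢ p₀ e^{p₀ t} dt`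
  have hLC := lintegral_comp_eq_lintegral_meas_lt_mul (volume.restrict (ball x₀ r)) hg_nn hg_m
    (g := fun t => p₀ * Real.exp (p₀ * t))
    (fun t _ => (continuous_const.mul (Real.continuous_exp.comp (continuous_const.mul continuous_id))).intervalIntegrable
      _ _)
    (Eventually.of_forall fun t => by positivity)
  have hLHS : ∫⁻ x in ball x₀ r, ENNReal.ofReal (Real.exp (p₀ * g x) - 1) =
      ∫⁻ x in ball x₀ r, ENNReal.ofReal (∫ t in (0 : ℝ)..g x, p₀ * Real.exp (p₀ * t)) := by
    refine lintegral_congr fun x => ?_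
    rw [intervalIntegral_mul_exp_mul]
  rw [hLHS, hLC]
  -- the John–Nirenberg bound on the level sets, for `t > 0`
  have hlevel : ∀ t : ℝ, 0 < t →
      (volume.restrict (ball x₀ r)) {x | t < g x} ≤ ENNReal.ofReal (c₁ * Real.exp (-c₂ * (t / K))) * volume (ball x₀ r) := by
    intro t ht
    rw [Measure.restrict_apply' measurableSet_ball]
    refine (measure_mono ?_).trans (hJN x₀ r hr (t / K) (by positivity))
    intro x hx
    refine ⟨hx.2, ?_⟩
    have hx1 : t < g x := hx.1
    have h1 : ENNReal.ofReal (t / K) * eBMOSeminorm f ≤ ENNReal.ofReal t := by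
      have h2 : ENNReal.ofReal (t / K) * eBMOSeminorm f ≤ ENNReal.ofReal (t / K) * ENNReal.ofReal K :=
        mul_le_mul' le_rfl hfK
      have h3 : ENNReal.ofReal (t / K) * ENNReal.ofReal K = ENNReal.ofReal t := by
        rw [← ENNReal.ofReal_mul (by positivity), div_mul_cancel₀ _ hK.ne']
      exact h2.trans_eq h3
    refine lt_of_le_of_lt h1 ?_
    rw [Real.enorm_eq_ofReal_abs]
    exact ENNReal.ofReal_lt_ofReal_iff'.2 ⟨hx1, ht.trans hx1⟩
  -- integrate in `t`
  calc ∫⁻ t in Ioi (0 : ℝ), (volume.restrict (ball x₀ r)) {x | t < g x} * ENNReal.ofReal (p₀ * Real.exp (p₀ * t))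
      ≤ ∫⁻ t in Ioi (0 : ℝ), ENNReal.ofReal (c₁ * Real.exp (-c₂ * (t / K))) * volume (ball x₀ r) *
          ENNReal.ofReal (p₀ * Real.exp (p₀ * t)) := by
        refine setLIntegral_mono' measurableSet_Ioi fun t ht => ?_
        exact mul_le_mul' (hlevel t ht) le_rfl
    _ = ∫⁻ t in Ioi (0 : ℝ), ENNReal.ofReal (t ^ ((1 : ℝ) - 1) * Real.exp (-(p₀ * t))) *
          (ENNReal.ofReal (c₁ * p₀) * volume (ball x₀ r)) := by
        refine setLIntegral_congr_fun measurableSet_Ioi fun t ht => ?_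
        have ht0 : (0 : ℝ) < t := ht
        rw [sub_self, Real.rpow_zero, one_mul]
        -- `c₁ e^{-c₂ t/K} · p₀ e^{p₀ t} = e^{-p₀ t} · (c₁ p₀)` since `c₂/K = 2 p₀`
        have hexp : c₁ * Real.exp (-c₂ * (t / K)) * (p₀ * Real.exp (p₀ * t)) = Real.exp (-(p₀ * t)) * (c₁ * p₀) := by
          have h2 : -c₂ * (t / K) = -(p₀ * t) + -(p₀ * t) := by rw [hp₀]; field_simp; ring
          rw [h2, Real.exp_add]
          have h3 : Real.exp (-(p₀ * t)) * Real.exp (p₀ * t) = 1 := by rw [← Real.exp_add]; simp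
          linear_combination c₁ * p₀ * Real.exp (-(p₀ * t)) * h3
        rw [mul_right_comm, ← ENNReal.ofReal_mul (by positivity), hexp, ENNReal.ofReal_mul (by positivity), mul_assoc]
    _ = ENNReal.ofReal ((1 / p₀) ^ (1 : ℝ) * Real.Gamma 1) * (ENNReal.ofReal (c₁ * p₀) * volume (ball x₀ r)) := by
        rw [lintegral_mul_const' _ _ (by finiteness), lintegral_Ioi_ofReal_rpow_mul_exp_neg_mul one_pos hp₀pos]
    _ = ENNReal.ofReal c₁ * volume (ball x₀ r) := by
        rw [Real.Gamma_one, Real.rpow_one, mul_one, ← mul_assoc, ← ENNReal.ofReal_mul (by positivity)]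
        congr 2
        field_simp

/-- From `∫⁻_B (e^{p₀|f−f_B|} − 1) ≤ c₁|B|` to `∫⁻_B e^{p₀|f−f_B|} ≤ (1 + c₁)|B|`.
[cite: Moser1961Harnack, Theorem 1, proof (crossover via John–Nirenberg)] -/
theorem lintegral_exp_mul_oscillation_le' {f : EuclideanSpace ℝ (Fin n) → ℝ} (hf : Measurable f) {K c₁ c₂ : ℝ}
    (hK : 0 < K) (hc₁ : 0 < c₁) (hc₂ : 0 < c₂) (hfK : eBMOSeminorm f ≤ ENNReal.ofReal K)
    (hJN : ∀ (x₀ : EuclideanSpace ℝ (Fin n)) (r : ℝ), 0 < r → ∀ (t : ℝ), 0 < t →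
      volume {x ∈ ball x₀ r | ENNReal.ofReal t * eBMOSeminorm f < ‖f x - ⨍ z in ball x₀ r, f z‖ₑ} ≤
        ENNReal.ofReal (c₁ * Real.exp (-c₂ * t)) * volume (ball x₀ r))
    (x₀ : EuclideanSpace ℝ (Fin n)) {r : ℝ} (hr : 0 < r) :
    ∫⁻ x in ball x₀ r, ENNReal.ofReal (Real.exp (c₂ / (2 * K) * |f x - ⨍ z in ball x₀ r, f z|)) ≤
      ENNReal.ofReal (1 + c₁) * volume (ball x₀ r) := by
  have h := lintegral_exp_mul_oscillation_le hf hK hc₁ hc₂ hfK hJN x₀ hr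
  have hsplit : ∀ x, ENNReal.ofReal (Real.exp (c₂ / (2 * K) * |f x - ⨍ z in ball x₀ r, f z|)) =
      ENNReal.ofReal (Real.exp (c₂ / (2 * K) * |f x - ⨍ z in ball x₀ r, f z|) - 1) + 1 := by
    intro x
    have h1 : (1 : ℝ) ≤ Real.exp (c₂ / (2 * K) * |f x - ⨍ z in ball x₀ r, f z|) :=
      Real.one_le_exp (by positivity)
    rw [← ENNReal.ofReal_one, ← ENNReal.ofReal_add (by linarith) zero_le_one, sub_add_cancel]
  simp_rw [hsplit]
  rw [lintegral_add_right _ measurable_const, setLIntegral_const, one_mul, ENNReal.ofReal_add zero_le_one hc₁.le,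
    ENNReal.ofReal_one, add_mul, one_mul, add_comm]
  exact add_le_add le_rfl h

/-- **The crossover product bound**: for a measurable `u > 0` with `f = log u` as above,
`(∫⁻_B u^{p₀})(∫⁻_B u^{−p₀}) ≤ (1+c₁)² |B|²`, `p₀ = c₂/(2K)`.
[cite: Moser1961Harnack, Theorem 1, proof (crossover via John–Nirenberg)] -/
theorem lintegral_rpow_mul_lintegral_rpow_neg_le {u : EuclideanSpace ℝ (Fin n) → ℝ} (hum : Measurable u)
    (hupos : ∀ x, 0 < u x) {K c₁ c₂ : ℝ} (hK : 0 < K) (hc₁ : 0 < c₁) (hc₂ : 0 < c₂)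
    (hfK : eBMOSeminorm (fun x => Real.log (u x)) ≤ ENNReal.ofReal K)
    (hJN : ∀ (x₀ : EuclideanSpace ℝ (Fin n)) (r : ℝ), 0 < r → ∀ (t : ℝ), 0 < t →
      volume {x ∈ ball x₀ r | ENNReal.ofReal t * eBMOSeminorm (fun x => Real.log (u x)) <
          ‖Real.log (u x) - ⨍ z in ball x₀ r, Real.log (u z)‖ₑ} ≤
        ENNReal.ofReal (c₁ * Real.exp (-c₂ * t)) * volume (ball x₀ r))
    (x₀ : EuclideanSpace ℝ (Fin n)) {r : ℝ} (hr : 0 < r) :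
    (∫⁻ x in ball x₀ r, ENNReal.ofReal (u x ^ (c₂ / (2 * K)))) *
        (∫⁻ x in ball x₀ r, ENNReal.ofReal (u x ^ (-(c₂ / (2 * K))))) ≤
      ENNReal.ofReal ((1 + c₁) ^ 2) * volume (ball x₀ r) ^ 2 := by
  set p₀ : ℝ := c₂ / (2 * K) with hp₀
  set A : ℝ := ⨍ z in ball x₀ r, Real.log (u z) with hA
  have hE := lintegral_exp_mul_oscillation_le' (Real.measurable_log.comp hum) hK hc₁ hc₂ hfK hJN x₀ hr
  -- pointwise: `u^{±p₀} ≤ e^{±p₀ A} e^{p₀ |log u − A|}`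
  have hpt : ∀ (σ : ℝ), σ = 1 ∨ σ = -1 → ∀ x, u x ^ (σ * p₀) ≤
      Real.exp (σ * p₀ * A) * Real.exp (p₀ * |Real.log (u x) - A|) := by
    intro σ hσ x
    rw [Real.rpow_def_of_pos (hupos x), ← Real.exp_add]
    refine Real.exp_le_exp.2 ?_
    have hp : 0 ≤ p₀ := by rw [hp₀]; positivity
    have key : σ * p₀ * (Real.log (u x) - A) ≤ p₀ * |Real.log (u x) - A| := by
      rcases hσ with h | h
      · rw [h, one_mul]; exact mul_le_mul_of_nonneg_left (le_abs_self _) hp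
      · rw [h, neg_one_mul, neg_mul, ← mul_neg]; exact mul_le_mul_of_nonneg_left (neg_le_abs _) hp
    linarith
  have hbound : ∀ (σ : ℝ), σ = 1 ∨ σ = -1 →
      ∫⁻ x in ball x₀ r, ENNReal.ofReal (u x ^ (σ * p₀)) ≤
        ENNReal.ofReal (Real.exp (σ * p₀ * A)) * (ENNReal.ofReal (1 + c₁) * volume (ball x₀ r)) := by
    intro σ hσ
    calc ∫⁻ x in ball x₀ r, ENNReal.ofReal (u x ^ (σ * p₀))
        ≤ ∫⁻ x in ball x₀ r, ENNReal.ofReal (Real.exp (σ * p₀ * A)) *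
            ENNReal.ofReal (Real.exp (p₀ * |Real.log (u x) - A|)) := by
          refine lintegral_mono fun x => ?_
          rw [← ENNReal.ofReal_mul (Real.exp_pos _).le]
          exact ENNReal.ofReal_le_ofReal (hpt σ hσ x)
      _ = ENNReal.ofReal (Real.exp (σ * p₀ * A)) *
            ∫⁻ x in ball x₀ r, ENNReal.ofReal (Real.exp (p₀ * |Real.log (u x) - A|)) :=
          lintegral_const_mul' _ _ ENNReal.ofReal_ne_top
      _ ≤ ENNReal.ofReal (Real.exp (σ * p₀ * A)) * (ENNReal.ofReal (1 + c₁) * volume (ball x₀ r)) :=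
          mul_le_mul' le_rfl hE
  have h1 := hbound 1 (Or.inl rfl)
  have h2 := hbound (-1) (Or.inr rfl)
  simp only [one_mul] at h1
  simp only [neg_mul, one_mul] at h2
  calc (∫⁻ x in ball x₀ r, ENNReal.ofReal (u x ^ p₀)) * (∫⁻ x in ball x₀ r, ENNReal.ofReal (u x ^ (-p₀)))
      ≤ (ENNReal.ofReal (Real.exp (p₀ * A)) * (ENNReal.ofReal (1 + c₁) * volume (ball x₀ r))) *
          (ENNReal.ofReal (Real.exp (-(p₀ * A))) * (ENNReal.ofReal (1 + c₁) * volume (ball x₀ r))) :=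
        mul_le_mul' h1 h2
    _ = ENNReal.ofReal ((1 + c₁) ^ 2) * volume (ball x₀ r) ^ 2 := by
        have hee : ENNReal.ofReal (Real.exp (p₀ * A)) * ENNReal.ofReal (Real.exp (-(p₀ * A))) = 1 := by
          rw [← ENNReal.ofReal_mul (Real.exp_pos _).le, ← Real.exp_add, add_neg_cancel, Real.exp_zero,
            ENNReal.ofReal_one]
        have hcc : ENNReal.ofReal (1 + c₁) * ENNReal.ofReal (1 + c₁) = ENNReal.ofReal ((1 + c₁) ^ 2) := by
          rw [← ENNReal.ofReal_mul (by positivity), sq]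
        calc ENNReal.ofReal (Real.exp (p₀ * A)) * (ENNReal.ofReal (1 + c₁) * volume (ball x₀ r)) *
              (ENNReal.ofReal (Real.exp (-(p₀ * A))) * (ENNReal.ofReal (1 + c₁) * volume (ball x₀ r)))
            = (ENNReal.ofReal (Real.exp (p₀ * A)) * ENNReal.ofReal (Real.exp (-(p₀ * A)))) *
                ((ENNReal.ofReal (1 + c₁) * ENNReal.ofReal (1 + c₁)) * volume (ball x₀ r) ^ 2) := by ring
          _ = ENNReal.ofReal ((1 + c₁) ^ 2) * volume (ball x₀ r) ^ 2 := by rw [hee, hcc, one_mul]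

/-! ### The packaged crossover estimate -/

/-- **CROSSOVER (Moser 1961 §5 via John–Nirenberg).**  There are `p₀ > 0` and `C ≥ 0`, depending only on `n`, `λ`, `Λ`,
such that for every coefficient field `a` (measurable, symmetric, `λ|ξ|² ≤ ξ·aξ`, `|aᵢⱼ| ≤ Λ`) and every `C¹` weak solution
`u ≥ 1` of `div(a∇u) = 0` on all of `ℝⁿ` (weak formulation of `Literature.Analysis.PDE.divFormLiouville`), on every ball:
`(∫⁻_{B(x₀,r)} u^{p₀}) · (∫⁻_{B(x₀,r)} u^{−p₀}) ≤ C |B(x₀,r)|²`.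
[cite: Moser1961Harnack, Theorem 1, proof (crossover via John–Nirenberg)] -/
theorem exists_crossover (n : ℕ) {lam : ℝ} (hlam : 0 < lam) (Λ : ℝ) :
    ∃ p₀ C : ℝ, 0 < p₀ ∧ 0 ≤ C ∧ ∀ (a : EuclideanSpace ℝ (Fin n) → Matrix (Fin n) (Fin n) ℝ),
      (∀ i j, Measurable fun y => a y i j) → (∀ y, (a y).IsSymm) →
      (∀ y (ξ : Fin n → ℝ), lam * (ξ ⬝ᵥ ξ) ≤ ξ ⬝ᵥ (a y *ᵥ ξ)) → (∀ y i j, |a y i j| ≤ Λ) →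
      ∀ (u : EuclideanSpace ℝ (Fin n) → ℝ), ContDiff ℝ 1 u → (∀ y, 1 ≤ u y) →
        (∀ η : EuclideanSpace ℝ (Fin n) → ℝ, ContDiff ℝ 1 η → HasCompactSupport η →
          ∫ y, ∑ i, ∑ j, a y i j * fderiv ℝ u y (EuclideanSpace.single i 1) *
            fderiv ℝ η y (EuclideanSpace.single j 1) = 0) →
        ∀ (x₀ : EuclideanSpace ℝ (Fin n)) (r : ℝ), 0 < r →
          (∫⁻ x in ball x₀ r, ENNReal.ofReal (u x ^ p₀)) * (∫⁻ x in ball x₀ r, ENNReal.ofReal (u x ^ (-p₀))) ≤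
            ENNReal.ofReal C * volume (ball x₀ r) ^ 2 := by
  obtain ⟨K, hK0, hK⟩ := exists_eBMOSeminorm_log_le n hlam Λ
  obtain ⟨c₁, c₂, hc₁, hc₂, hJN⟩ := john_nirenberg_holds (EuclideanSpace ℝ (Fin n)) ℝ
  set K' : ℝ := max K 1 with hK'
  have hK'pos : 0 < K' := lt_of_lt_of_le one_pos (le_max_right _ _)
  refine ⟨c₂ / (2 * K'), (1 + c₁) ^ 2, by positivity, by positivity,
    fun a hmeas hsymm hell hbd u hu hu1 hweak x₀ r hr => ?_⟩
  obtain ⟨hbmo, hmem⟩ := hK a hmeas hsymm hell hbd u hu hu1 hweak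
  have hbmo' : eBMOSeminorm (fun x => Real.log (u x)) ≤ ENNReal.ofReal K' :=
    hbmo.trans (ENNReal.ofReal_le_ofReal (le_max_left _ _))
  have hupos : ∀ x, 0 < u x := fun x => lt_of_lt_of_le one_pos (hu1 x)
  exact lintegral_rpow_mul_lintegral_rpow_neg_le hu.continuous.measurable hupos hK'pos hc₁ hc₂ hbmo'
    (fun x₀ r hr t ht => hJN _ hmem x₀ r hr t ht) x₀ hr

end Literature.Analysis.PDE.DivForm.Crossover

end

end Part7

/-!
## Part 8 — port of `Summits/NavierStokesRegularity/NavierStokesRegularity/Theorems/PoloidalWindowDoorPoloidalWindowRigidityDivFormHarnack.lean`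

# Route `PoloidalWindowDoor`, crux K2 (stmt-NavierStokesRegularity-19708) — task H5, step M4a: MOSER'S HARNACK INEQUALITY
# at unit scale for entire solutions of `div(a∇u) = 0`, `n ≥ 3` (towards `divFormLiouville_holds`, De Giorgi–Nash–Moser)

Seat ns-poloidal-K2-p3 g2 (`ledger fact claim` #1 on `Literature.Analysis.PDE.divFormLiouville`; setting = that fact's
rendering, `w ≥ 1` an entire `C¹` weak solution).  Moser 1961, Thm 1: the sup chain (M3c with `σ = 1`, started from an
exponent `p₁ = κ^{j+½} ≤ p₀` whose chain `p₁κ^k` never meets `1`), the inf chain (`σ = −1`, exponent `p₀`), Hölder on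
`B̄(0,2)` and the crossover (M2b, exponent `p₀`) combine to `sup_{B̄(0,1)} w ≤ C_H inf_{B̄(0,1)} w`, `C_H = C_H(n,λ,Λ)`.
General balls follow by scaling (M4b).

* `enorm_le_eLpNorm_top` — a continuous function is bounded pointwise on `B̄(x₀,R)` by its `L^∞(B̄(x₀,R))` norm;
* `exists_chain_exponent` — `∃ p₁ ∈ (0,p₀]`, `p₁κ^k ≠ 1` and `(p₁κ^k/(p₁κ^k − 1))² ≤ (√κ/(√κ−1))²` for all `k`;
* `harnack_unit` — the displayed Harnack inequality on `B̄(0,1)`.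

WHAT THIS IS NOT: not yet the Liouville theorem (M4b scaling ⇒ Liouville for `n ≥ 3`, M4c `n ≤ 2`); nothing NS-specific.
-/

section Part8

noncomputable section

open _root_.MeasureTheory _root_.Set _root_.Function _root_.Filter _root_.Topology _root_.Metric _root_.Module
open scoped _root_.Matrix _root_.ENNReal _root_.NNReal

namespace Literature.Analysis.PDE.DivForm.Harnack

open Literature.Analysis.PDE.DivForm.ReverseHolder
open Literature.Analysis.PDE.DivForm.MoserStep
open Literature.Analysis.PDE.DivForm.MoserChain
open Literature.Analysis.PDE.DivForm.Crossover
open Literature.Analysis.FunctionSpaces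

variable {n : ℕ}

/-! ### Pointwise values versus the `L^∞` norm on a closed ball -/

/-- A continuous function is bounded at every point of `B̄(x₀,R)` (`R > 0`) by its `L^∞(B̄(x₀,R))` norm.
[cite: Moser1961Harnack, Theorem 1 (Harnack inequality on the unit ball)] -/
theorem enorm_le_eLpNorm_top {g : EuclideanSpace ℝ (Fin n) → ℝ} (hg : Continuous g) (x₀ : EuclideanSpace ℝ (Fin n))
    {R : ℝ} (hR : 0 < R) {x : EuclideanSpace ℝ (Fin n)} (hx : x ∈ closedBall x₀ R) :
    ‖g x‖ₑ ≤ eLpNorm g ∞ (volume.restrict (closedBall x₀ R)) := by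
  rw [eLpNorm_exponent_top, eLpNormEssSup_eq_essSup_enorm]
  by_contra hlt
  rw [not_le] at hlt
  set U : Set (EuclideanSpace ℝ (Fin n)) :=
    {y | essSup (fun z => ‖g z‖ₑ) (volume.restrict (closedBall x₀ R)) < ‖g y‖ₑ} with hU
  have hU0 : (volume.restrict (closedBall x₀ R)) U = 0 := meas_essSup_lt
  have hUopen : IsOpen U := isOpen_lt continuous_const hg.enorm
  have hxU : x ∈ U := hlt
  -- `U` meets the open ball: `x ∈ closure (ball x₀ R)`
  have hxcl : x ∈ closure (ball x₀ R) := by rwa [closure_ball x₀ hR.ne']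
  obtain ⟨z, hzU, hzB⟩ : (U ∩ ball x₀ R).Nonempty := mem_closure_iff.1 hxcl U hUopen hxU
  have hpos : 0 < volume (U ∩ ball x₀ R) :=
    (hUopen.inter isOpen_ball).measure_pos volume ⟨z, hzU, hzB⟩
  rw [Measure.restrict_apply' measurableSet_closedBall] at hU0
  have hle : volume (U ∩ ball x₀ R) ≤ volume (U ∩ closedBall x₀ R) :=
    measure_mono (inter_subset_inter_right _ ball_subset_closedBall)
  rw [hU0] at hle
  exact absurd (le_antisymm hle bot_le) hpos.ne'

/-! ### A chain of exponents avoiding `1` -/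

/-- For `κ > 1` and `p₀ > 0` there is `p₁ ∈ (0, p₀]` of the form `κ^{j+½}` (`j ∈ ℤ`); along the chain `p₁κ^k` no exponent
equals `1` and `(t/(t−1))² ≤ (√κ/(√κ−1))²`, `t = p₁κ^k`.
[cite: Moser1961Harnack, Theorem 1 (Harnack inequality on the unit ball)] -/
theorem exists_chain_exponent {κ : ℝ} (hκ : 1 < κ) {p₀ : ℝ} (hp₀ : 0 < p₀) :
    ∃ p₁ : ℝ, 0 < p₁ ∧ p₁ ≤ p₀ ∧ ∀ k : ℕ, 1 * (p₁ * κ ^ k) ≠ 1 ∧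
      (1 * (p₁ * κ ^ k) / (1 * (p₁ * κ ^ k) - 1)) ^ 2 ≤ (Real.sqrt κ / (Real.sqrt κ - 1)) ^ 2 := by
  have hκ0 : 0 < κ := zero_lt_one.trans hκ
  have hlogκ : 0 < Real.log κ := Real.log_pos hκ
  have hsqκ : 1 < Real.sqrt κ := by
    rw [show (1 : ℝ) = Real.sqrt 1 by simp]
    exact Real.sqrt_lt_sqrt zero_le_one hκ
  set j : ℤ := ⌊Real.log p₀ / Real.log κ - 1 / 2⌋ with hj
  set p₁ : ℝ := κ ^ ((j : ℝ) + 1 / 2) with hp₁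
  have hp₁pos : 0 < p₁ := Real.rpow_pos_of_pos hκ0 _
  refine ⟨p₁, hp₁pos, ?_, fun k => ?_⟩
  · -- `p₁ ≤ p₀`
    have h1 : ((j : ℝ) + 1 / 2) * Real.log κ ≤ Real.log p₀ := by
      have := Int.floor_le (Real.log p₀ / Real.log κ - 1 / 2)
      rw [← hj] at this
      have h' : (j : ℝ) + 1 / 2 ≤ Real.log p₀ / Real.log κ := by linarith
      calc ((j : ℝ) + 1 / 2) * Real.log κ ≤ Real.log p₀ / Real.log κ * Real.log κ :=
            mul_le_mul_of_nonneg_right h' hlogκ.le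
        _ = Real.log p₀ := div_mul_cancel₀ _ hlogκ.ne'
    calc p₁ = Real.exp (((j : ℝ) + 1 / 2) * Real.log κ) := by
          rw [hp₁, Real.rpow_def_of_pos hκ0, mul_comm]
      _ ≤ Real.exp (Real.log p₀) := Real.exp_le_exp.2 h1
      _ = p₀ := Real.exp_log hp₀
  · -- the chain exponent `t = κ^{m + 1/2}`, `m = j + k`
    set t : ℝ := 1 * (p₁ * κ ^ k) with ht
    have htm : t = κ ^ (((j + k : ℤ) : ℝ) + 1 / 2) := by
      rw [ht, one_mul, hp₁, ← Real.rpow_natCast, ← Real.rpow_add hκ0]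
      congr 1; push_cast; ring
    have htpos : 0 < t := by rw [htm]; exact Real.rpow_pos_of_pos hκ0 _
    set D : ℝ := Real.sqrt κ / (Real.sqrt κ - 1) with hD
    have hD1 : 1 ≤ D := by rw [hD, le_div_iff₀ (by linarith)]; linarith
    have hsqrt : Real.sqrt κ = κ ^ (1 / 2 : ℝ) := Real.sqrt_eq_rpow κ
    -- dichotomy on the integer `m = j + k`
    rcases le_or_gt 0 (j + k : ℤ) with hm | hm
    · -- `m ≥ 0`: `t ≥ √κ > 1`
      have hge : Real.sqrt κ ≤ t := by
        rw [htm, hsqrt]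
        refine Real.rpow_le_rpow_of_exponent_le hκ.le ?_
        have : (0 : ℝ) ≤ ((j + k : ℤ) : ℝ) := by exact_mod_cast hm
        linarith
      have ht1 : 1 < t := lt_of_lt_of_le hsqκ hge
      refine ⟨ht1.ne', ?_⟩
      have hq : t / (t - 1) ≤ D := by
        rw [hD, div_le_div_iff₀ (by linarith) (by linarith)]
        nlinarith
      have hq0 : 0 ≤ t / (t - 1) := div_nonneg htpos.le (by linarith)
      exact pow_le_pow_left₀ hq0 hq 2
    · -- `m ≤ -1`: `t ≤ 1/√κ < 1`
      have hle : t ≤ κ ^ (-(1 / 2 : ℝ)) := by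
        rw [htm]
        refine Real.rpow_le_rpow_of_exponent_le hκ.le ?_
        have : ((j + k : ℤ) : ℝ) ≤ -1 := by exact_mod_cast (Int.le_sub_one_iff.2 hm : (j + k : ℤ) ≤ 0 - 1)
        linarith
      have hinv : κ ^ (-(1 / 2 : ℝ)) = (Real.sqrt κ)⁻¹ := by rw [Real.rpow_neg hκ0.le, hsqrt]
      rw [hinv] at hle
      have hsq0 : 0 < Real.sqrt κ := by linarith
      have ht1 : t < 1 := lt_of_le_of_lt hle (inv_lt_one_of_one_lt₀ hsqκ)
      refine ⟨ht1.ne, ?_⟩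
      -- `|t/(t−1)| = t/(1−t) ≤ (1/√κ)/(1 − 1/√κ) = 1/(√κ − 1) ≤ D`
      have hq : |t / (t - 1)| ≤ D := by
        rw [abs_div, abs_of_pos htpos, abs_of_neg (by linarith), neg_sub]
        have h1t : 0 < 1 - t := by linarith
        rw [div_le_iff₀ h1t, hD]
        -- `t ≤ 1/√κ` and `D (1 - t) ≥ D (1 − 1/√κ) = √κ/(√κ−1) · (√κ−1)/√κ = 1 ≥ t`
        have hle' : t * Real.sqrt κ ≤ 1 := by
          have := mul_le_mul_of_nonneg_right hle hsq0.le
          rwa [inv_mul_cancel₀ hsq0.ne'] at this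
        rw [div_mul_eq_mul_div, le_div_iff₀ (by linarith)]
        nlinarith
      have := pow_le_pow_left₀ (abs_nonneg _) hq 2
      rwa [sq_abs] at this

/-! ### Harnack's inequality at unit scale -/

/-- **MOSER'S HARNACK INEQUALITY at unit scale** (Moser 1961, Thm 1), `n ≥ 3`: there is `C_H ≥ 0` depending only on
`n, λ, Λ` such that every entire `C¹` weak solution `w ≥ 1` of `div(a∇w) = 0` (coefficients measurable, symmetric,
`λ|ξ|² ≤ ξ·aξ`, `|aᵢⱼ| ≤ Λ`; weak formulation of `Literature.Analysis.PDE.divFormLiouville`) satisfies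
`w(x) ≤ C_H · w(y)` for all `x, y ∈ B̄(0,1)`.
[cite: Moser1961Harnack, Theorem 1 (Harnack inequality on the unit ball)] -/
theorem harnack_unit (hn : 3 ≤ n) {lam : ℝ} (hlam : 0 < lam) (Λ : ℝ) :
    ∃ C_H : ℝ, 0 ≤ C_H ∧ ∀ (a : EuclideanSpace ℝ (Fin n) → Matrix (Fin n) (Fin n) ℝ),
      (∀ i j, Measurable fun y => a y i j) → (∀ y, (a y).IsSymm) →
      (∀ y (ξ : Fin n → ℝ), lam * (ξ ⬝ᵥ ξ) ≤ ξ ⬝ᵥ (a y *ᵥ ξ)) → (∀ y i j, |a y i j| ≤ Λ) →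
      ∀ (w : EuclideanSpace ℝ (Fin n) → ℝ), ContDiff ℝ 1 w → (∀ y, 1 ≤ w y) →
        (∀ η : EuclideanSpace ℝ (Fin n) → ℝ, ContDiff ℝ 1 η → HasCompactSupport η →
          ∫ y, ∑ i, ∑ j, a y i j * fderiv ℝ w y (EuclideanSpace.single i 1) *
            fderiv ℝ η y (EuclideanSpace.single j 1) = 0) →
        ∀ x ∈ closedBall (0 : EuclideanSpace ℝ (Fin n)) 1, ∀ y ∈ closedBall (0 : EuclideanSpace ℝ (Fin n)) 1,
          w x ≤ C_H * w y := by
  -- the exponents and constants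
  set κ : ℝ := n / (n - 2 : ℝ) with hκ
  have hn2 : (0 : ℝ) < n - 2 := by
    have : (3 : ℝ) ≤ n := by exact_mod_cast hn
    linarith
  have hκ1 : 1 < κ := by rw [hκ, lt_div_iff₀ hn2]; linarith
  have hκ0 : 0 < κ := zero_lt_one.trans hκ1
  obtain ⟨p₀, Ccr, hp₀, hCcr, hcross⟩ := exists_crossover n hlam Λ
  obtain ⟨C₀, hC₀0, hcut⟩ := exists_closedBall_cutoff n
  obtain ⟨p₁, hp₁, hp₁p₀, hch₁⟩ := exists_chain_exponent hκ1 hp₀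
  set C₁ : ℝ := C₀ + 1 with hC₁
  have hC₁pos : 0 < C₁ := by rw [hC₁]; linarith
  have hcut' : ∀ (x₀ : EuclideanSpace ℝ (Fin n)) (ρ' ρ : ℝ), 0 < ρ' → ρ' < ρ →
      ∃ χ : EuclideanSpace ℝ (Fin n) → ℝ, ContDiff ℝ 1 χ ∧ HasCompactSupport χ ∧ (∀ x, 0 ≤ χ x ∧ χ x ≤ 1) ∧
        (∀ x ∈ closedBall x₀ ρ', χ x = 1) ∧ (∀ x, x ∉ ball x₀ ρ → χ x = 0) ∧
        ∀ x, ‖fderiv ℝ χ x‖ ≤ C₁ / (ρ - ρ') := by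
    intro x₀ ρ' ρ hρ' hρ
    obtain ⟨χ, h1, h2, h3, h4, h5, h6⟩ := hcut x₀ ρ' ρ hρ' hρ
    refine ⟨χ, h1, h2, h3, h4, h5, fun x => (h6 x).trans ?_⟩
    exact div_le_div_of_nonneg_right (by rw [hC₁]; linarith) (by linarith)
  set D₁ : ℝ := (Real.sqrt κ / (Real.sqrt κ - 1)) ^ 2 with hD₁
  set CS : ℝ := (max (eLpNormLESNormFDerivOfEqInnerConst (volume : Measure (EuclideanSpace ℝ (Fin n))) 2 : ℝ) 1)
    with hCS
  -- the two Moser constants at `R = 1`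
  set Φp : ℝ≥0∞ := ENNReal.ofReal (CS ^ 2 * (2 * (D₁ * (n * Λ) + lam) / lam * (4 * C₁ ^ 2)) / 1 ^ 2) ^
      (κ / (p₁ * (κ - 1))) * (4 : ℝ≥0∞) ^ (κ / (p₁ * (κ - 1) ^ 2)) with hΦp
  set Φm : ℝ≥0∞ := ENNReal.ofReal (CS ^ 2 * (2 * (1 * (n * Λ) + lam) / lam * (4 * C₁ ^ 2)) / 1 ^ 2) ^
      (κ / (p₀ * (κ - 1))) * (4 : ℝ≥0∞) ^ (κ / (p₀ * (κ - 1) ^ 2)) with hΦm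
  set V₂ : ℝ≥0∞ := volume (closedBall (0 : EuclideanSpace ℝ (Fin n)) (2 * 1)) with hV₂
  set V₄ : ℝ≥0∞ := volume (ball (0 : EuclideanSpace ℝ (Fin n)) 4) with hV₄
  set Q : ℝ≥0∞ := Φp * Φm * V₂ ^ (1 / p₁ - 1 / p₀) * (ENNReal.ofReal Ccr * V₄ ^ 2) ^ (1 / p₀) with hQ
  have hκe1 : 0 ≤ κ / (p₁ * (κ - 1)) := by apply div_nonneg hκ0.le; nlinarith
  have hκe2 : 0 ≤ κ / (p₁ * (κ - 1) ^ 2) := by positivity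
  have hκe3 : 0 ≤ κ / (p₀ * (κ - 1)) := by apply div_nonneg hκ0.le; nlinarith
  have hκe4 : 0 ≤ κ / (p₀ * (κ - 1) ^ 2) := by positivity
  have he : 0 ≤ 1 / p₁ - 1 / p₀ := by
    rw [sub_nonneg]; exact one_div_le_one_div_of_le hp₁ hp₁p₀
  have hV₂top : V₂ ≠ ⊤ := measure_closedBall_lt_top.ne
  have hV₄top : V₄ ≠ ⊤ := measure_ball_lt_top.ne
  have hQtop : Q ≠ ⊤ := by
    rw [hQ]
    refine ENNReal.mul_ne_top (ENNReal.mul_ne_top (ENNReal.mul_ne_top ?_ ?_) ?_) ?_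
    · exact ENNReal.mul_ne_top (ENNReal.rpow_ne_top_of_nonneg hκe1 ENNReal.ofReal_ne_top)
        (ENNReal.rpow_ne_top_of_nonneg hκe2 ENNReal.ofNat_ne_top)
    · exact ENNReal.mul_ne_top (ENNReal.rpow_ne_top_of_nonneg hκe3 ENNReal.ofReal_ne_top)
        (ENNReal.rpow_ne_top_of_nonneg hκe4 ENNReal.ofNat_ne_top)
    · exact ENNReal.rpow_ne_top_of_nonneg he hV₂top
    · exact ENNReal.rpow_ne_top_of_nonneg (by positivity)
        (ENNReal.mul_ne_top ENNReal.ofReal_ne_top (ENNReal.pow_ne_top hV₄top))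
  refine ⟨Q.toReal, ENNReal.toReal_nonneg, fun a hmeas hsymm hell hbd w hw hw1 hweak x hx y hy => ?_⟩
  have hpos : ∀ z, 0 < w z := fun z => lt_of_lt_of_le one_pos (hw1 z)
  -- the sup chain (`σ = 1`, exponent `p₁`) and the inf chain (`σ = -1`, exponent `p₀`) at `R = 1`
  have hsup := moser_chain_sup hn hsymm hlam hmeas hell hbd hw hw1 hweak (σ := 1) (Or.inl rfl) hp₁ (D := D₁)
    (by positivity) (fun k => (hch₁ k).1) (fun k => (hch₁ k).2) hC₁pos hcut' 0 one_pos
  have hinf := moser_chain_sup hn hsymm hlam hmeas hell hbd hw hw1 hweak (σ := -1) (Or.inr rfl) hp₀ (D := 1)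
    zero_le_one (fun k => by nlinarith [show 0 < p₀ * κ ^ k by positivity])
    (fun k => by
      have hq : (-1 : ℝ) * (p₀ * κ ^ k) < 0 := by nlinarith [show 0 < p₀ * κ ^ k by positivity]
      set q : ℝ := -1 * (p₀ * κ ^ k)
      have h1 : 0 < q / (q - 1) := div_pos_of_neg_of_neg hq (by linarith)
      have h2 : q / (q - 1) ≤ 1 := by rw [div_le_one_of_neg (by linarith)]; linarith
      nlinarith)
    hC₁pos hcut' 0 one_pos
  -- Hölder on `B̄(0,2)`: from `p₁` to `p₀`
  have hmeasw : AEStronglyMeasurable (fun z => w z ^ (1 : ℝ)) (volume.restrict (closedBall (0 : EuclideanSpace ℝ (Fin n)) (2 * 1))) :=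
    (contDiff_rpow_of_one_le hw hw1 1).continuous.aestronglyMeasurable
  have hH := eLpNorm_le_eLpNorm_mul_rpow_measure_univ (ENNReal.ofReal_le_ofReal hp₁p₀) hmeasw
  rw [Measure.restrict_apply_univ, ENNReal.toReal_ofReal hp₁.le, ENNReal.toReal_ofReal hp₀.le] at hH
  -- the `L^{p₀}` norms as lintegrals, and the crossover on `B(0,4)`
  have hP : eLpNorm (fun z => w z ^ (1 : ℝ)) (ENNReal.ofReal p₀) (volume.restrict (closedBall 0 (2 * 1))) =
      (∫⁻ z in closedBall (0 : EuclideanSpace ℝ (Fin n)) (2 * 1), ENNReal.ofReal (w z ^ p₀)) ^ (1 / p₀) := by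
    rw [eLpNorm_rpow_eq _ hpos 1 hp₀]; simp only [one_mul]
  have hM : eLpNorm (fun z => w z ^ (-1 : ℝ)) (ENNReal.ofReal p₀) (volume.restrict (closedBall 0 (2 * 1))) =
      (∫⁻ z in closedBall (0 : EuclideanSpace ℝ (Fin n)) (2 * 1), ENNReal.ofReal (w z ^ (-p₀))) ^ (1 / p₀) := by
    rw [eLpNorm_rpow_eq _ hpos (-1) hp₀]; simp only [neg_one_mul]
  have hsub : closedBall (0 : EuclideanSpace ℝ (Fin n)) (2 * 1) ⊆ ball 0 4 :=
    closedBall_subset_ball (by norm_num)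
  have hcr := hcross a hmeas hsymm hell hbd w hw hw1 hweak 0 4 (by norm_num)
  have hPM : (∫⁻ z in closedBall (0 : EuclideanSpace ℝ (Fin n)) (2 * 1), ENNReal.ofReal (w z ^ p₀)) *
      (∫⁻ z in closedBall (0 : EuclideanSpace ℝ (Fin n)) (2 * 1), ENNReal.ofReal (w z ^ (-p₀))) ≤
      ENNReal.ofReal Ccr * V₄ ^ 2 :=
    (mul_le_mul' (lintegral_mono_set hsub) (lintegral_mono_set hsub)).trans hcr
  -- pointwise values
  have hxv : ENNReal.ofReal (w x) ≤ eLpNorm (fun z => w z ^ (1 : ℝ)) ∞ (volume.restrict (closedBall 0 1)) := by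
    have h := enorm_le_eLpNorm_top (contDiff_rpow_of_one_le hw hw1 1).continuous 0 one_pos hx
    rwa [Real.rpow_one, Real.enorm_eq_ofReal (hpos x).le] at h
  have hyv : ENNReal.ofReal ((w y)⁻¹) ≤ eLpNorm (fun z => w z ^ (-1 : ℝ)) ∞ (volume.restrict (closedBall 0 1)) := by
    have h := enorm_le_eLpNorm_top (contDiff_rpow_of_one_le hw hw1 (-1)).continuous 0 one_pos hy
    rwa [Real.rpow_neg_one, Real.enorm_eq_ofReal (inv_nonneg.2 (hpos y).le)] at h
  -- assemble in `ℝ≥0∞`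
  have hprod : ENNReal.ofReal (w x * (w y)⁻¹) ≤ Q := by
    rw [ENNReal.ofReal_mul (hpos x).le]
    refine (mul_le_mul' hxv hyv).trans ?_
    refine (mul_le_mul' hsup hinf).trans ?_
    refine (mul_le_mul' (mul_le_mul' le_rfl hH) le_rfl).trans ?_
    rw [hP, hM]
    set Pp := ∫⁻ z in closedBall (0 : EuclideanSpace ℝ (Fin n)) (2 * 1), ENNReal.ofReal (w z ^ p₀)
    set Pm := ∫⁻ z in closedBall (0 : EuclideanSpace ℝ (Fin n)) (2 * 1), ENNReal.ofReal (w z ^ (-p₀))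
    have hpm : Pp ^ (1 / p₀) * Pm ^ (1 / p₀) ≤ (ENNReal.ofReal Ccr * V₄ ^ 2) ^ (1 / p₀) := by
      rw [← ENNReal.mul_rpow_of_nonneg _ _ (by positivity)]
      exact ENNReal.rpow_le_rpow hPM (by positivity)
    calc Φp * (Pp ^ (1 / p₀) * V₂ ^ (1 / p₁ - 1 / p₀)) * (Φm * Pm ^ (1 / p₀))
        = Φp * Φm * V₂ ^ (1 / p₁ - 1 / p₀) * (Pp ^ (1 / p₀) * Pm ^ (1 / p₀)) := by ring
      _ ≤ Φp * Φm * V₂ ^ (1 / p₁ - 1 / p₀) * (ENNReal.ofReal Ccr * V₄ ^ 2) ^ (1 / p₀) := mul_le_mul' le_rfl hpm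
      _ = Q := by rw [hQ]
  have hreal : w x * (w y)⁻¹ ≤ Q.toReal := (ENNReal.ofReal_le_iff_le_toReal hQtop).1 hprod
  have := mul_le_mul_of_nonneg_right hreal (hpos y).le
  rwa [mul_assoc, inv_mul_cancel₀ (hpos y).ne', mul_one] at this

end Literature.Analysis.PDE.DivForm.Harnack

end

end Part8

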